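import Mathlib.RepresentationTheory.Homological.GroupCohomology.Functoriality
import Mathlib.LinearAlgebra.LinearIndependent.Lemmas
import Mathlib.GroupTheory.Index
import Mathlib.LinearAlgebra.BilinearForm.Orthogonal
import Mathlib.Algebra.Group.Subgroup.Pointwise
import Literature.AlgebraicGeometry.HodgeTheory.LocallyTrivialExtensionClasses
import Literature.AlgebraicGeometry.HodgeTheory.SkewVanishingLattice
import Summits.HodgeConjecture.HodgeConjecture.Theorems.LinearSystemTorelliLocalTubeSpanAlgebra
import Summits.HodgeConjecture.HodgeConjecture.Theorems.LinearSystemTorelliLocalTubeSpanFrame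
import Summits.HodgeConjecture.HodgeConjecture.Theorems.LinearSystemTorelliLocalTubeSpanFrameMod
import Summits.HodgeConjecture.HodgeConjecture.Theorems.LinearSystemTorelliLocalTubeSpanFramePartial
import Summits.HodgeConjecture.HodgeConjecture.Theorems.LinearSystemTorelliLocalTubeSpanFramePartialSpan
import Summits.HodgeConjecture.HodgeConjecture.Theorems.LinearSystemTorelliLocalTubeSpanLayers
import Summits.HodgeConjecture.HodgeConjecture.Theorems.LinearSystemTorelliLocalTubeSpanSchnellExample
import Summits.HodgeConjecture.HodgeConjecture.Theorems.LinearSystemTorelliLocalTubeSpanPairs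
import Summits.HodgeConjecture.HodgeConjecture.Theorems.LinearSystemTorelliLocalTubeSpanPairsDual
import Summits.HodgeConjecture.HodgeConjecture.Theorems.LinearSystemTorelliLocalTubeSpanNCNodal
import Summits.HodgeConjecture.HodgeConjecture.Theorems.LinearSystemTorelliLocalTubeSpanReduction
import Summits.HodgeConjecture.HodgeConjecture.Theorems.LinearSystemTorelliLocalTubeSpanConj
import Summits.HodgeConjecture.HodgeConjecture.Theorems.LinearSystemTorelliLocalTubeSpanLocalKernel
import Summits.HodgeConjecture.HodgeConjecture.Theorems.LinearSystemTorelliLocalTubeSpanTransvections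
import Summits.HodgeConjecture.HodgeConjecture.Theorems.LinearSystemTorelliLocalTubeSpanRadical
import Summits.HodgeConjecture.HodgeConjecture.Theorems.LinearSystemTorelliLocalTubeSpanClusterFrame
import Summits.HodgeConjecture.HodgeConjecture.Theorems.LinearSystemTorelliLocalTubeSpanAbelianTail
import Summits.HodgeConjecture.HodgeConjecture.Theorems.LinearSystemTorelliLocalTubeSpanMultiCluster
import Summits.HodgeConjecture.HodgeConjecture.Theorems.LinearSystemTorelliLocalTubeSpanClusters
import Summits.HodgeConjecture.HodgeConjecture.Theorems.LinearSystemTorelliLocalTubeSpanUnimodularChain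
import Summits.HodgeConjecture.HodgeConjecture.Theorems.LinearSystemTorelliLocalTubeSpanSaturation
import Summits.HodgeConjecture.HodgeConjecture.Theorems.LinearSystemTorelliLocalTubeSpanThinRep
import Summits.HodgeConjecture.HodgeConjecture.Theorems.LinearSystemTorelliLocalTubeSpanThinClassification
import Summits.HodgeConjecture.HodgeConjecture.Theorems.LinearSystemTorelliLocalTubeSpanThinCocycle
import Summits.HodgeConjecture.HodgeConjecture.Theorems.LinearSystemTorelliLocalTubeSpanThinDynamics
import Summits.HodgeConjecture.HodgeConjecture.Theorems.LinearSystemTorelliLocalTubeSpanRankTwoPairingTwo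
import Summits.HodgeConjecture.HodgeConjecture.Theorems.LinearSystemTorelliLocalTubeSpanConnectedClusters
import Summits.HodgeConjecture.HodgeConjecture.Theorems.LinearSystemTorelliLocalTubeSpanImage
import Mathlib.GroupTheory.FreeGroup.Basic
import Mathlib.LinearAlgebra.Matrix.BilinearForm
import Mathlib.LinearAlgebra.Matrix.ToLinearEquiv
import Mathlib.RepresentationTheory.Basic
import Mathlib.Logic.Relation
import Mathlib.Data.Fin.VecNotation
import Mathlib.RingTheory.IsTensorProduct
import Mathlib.LinearAlgebra.FreeModule.Finite.Quotient
import Summits.HodgeConjecture.HodgeConjecture.Theorems.LinearSystemTorelliLocalTubeSpanThin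
import Summits.HodgeConjecture.HodgeConjecture.Theorems.LinearSystemTorelliLocalTubeSpanRetract
import Summits.HodgeConjecture.HodgeConjecture.Theorems.LinearSystemTorelliLocalTubeSpanCoordinatesUp
import Summits.HodgeConjecture.HodgeConjecture.Theorems.LinearSystemTorelliLocalTubeSpanFiniteWitness
import Summits.HodgeConjecture.HodgeConjecture.Theorems.LinearSystemTorelliLocalTubeSpanBaseChangeRetraction
import Summits.HodgeConjecture.HodgeConjecture.Theorems.LinearSystemTorelliLocalTubeSpanBaseChangeCoordinates
import Summits.HodgeConjecture.HodgeConjecture.Theorems.LinearSystemTorelliLocalTubeSpanFiniteIndex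
import Summits.HodgeConjecture.HodgeConjecture.Theorems.LinearSystemTorelliLocalTubeSpanDirectSum
import Summits.HodgeConjecture.HodgeConjecture.Theorems.LinearSystemTorelliLocalTubeSpanBaseChange
import Summits.HodgeConjecture.HodgeConjecture.Theorems.LinearSystemTorelliLocalTubeSpanTrivialSummand
import Summits.HodgeConjecture.HodgeConjecture.Theorems.LinearSystemTorelliLocalTubeSpanDistinguishedBasis
import Summits.HodgeConjecture.HodgeConjecture.Theorems.LinearSystemTorelliLocalTubeSpanRankTwoPairingThree
import Summits.HodgeConjecture.HodgeConjecture.Theorems.LinearSystemTorelliLocalTubeSpanRankTwoPairingOne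
import Summits.HodgeConjecture.HodgeConjecture.Theorems.LinearSystemTorelliLocalTubeSpanLocalKernelOfBalls
import Summits.HodgeConjecture.HodgeConjecture.Theorems.LinearSystemTorelliLocalTubeSpanIndependentCycles
import Summits.HodgeConjecture.HodgeConjecture.Theorems.LinearSystemTorelliLocalTubeSpanNCSubconfiguration
import Summits.HodgeConjecture.HodgeConjecture.Theorems.LinearSystemTorelliLocalTubeSpanThinRepMu
import Summits.HodgeConjecture.HodgeConjecture.Theorems.LinearSystemTorelliLocalTubeSpanThinCocycleMu
import Summits.HodgeConjecture.HodgeConjecture.Theorems.LinearSystemTorelliLocalTubeSpanThinDynamicsMu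
import Summits.HodgeConjecture.HodgeConjecture.Theorems.LinearSystemTorelliLocalTubeSpanLocalSubgroupConj
import Summits.HodgeConjecture.HodgeConjecture.Theorems.LinearSystemTorelliLocalTubeSpanOneViewPoint
import Literature.AlgebraicGeometry.HodgeTheory.HyperplaneSectionLocalSystem
import Literature.AlgebraicGeometry.HodgeTheory.ClassesSupportedOnComplexification
import Literature.AlgebraicGeometry.HodgeTheory.RationalLattice
import Literature.AlgebraicGeometry.HodgeTheory.HyperplaneSectionRationalMonodromy
import Summits.HodgeConjecture.HodgeConjecture.Theorems.LinearSystemTorelliLocalTubeSpanRatTensorEquiv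
import Summits.HodgeConjecture.HodgeConjecture.Theorems.LinearSystemTorelliLocalTubeSpanVanishingTransfer
import Summits.HodgeConjecture.HodgeConjecture.Theorems.LinearSystemTorelliLocalTubeSpanCentralSplit
import Summits.HodgeConjecture.HodgeConjecture.Theorems.LinearSystemTorelliLocalTubeSpanUnimodularPencil
import Summits.HodgeConjecture.HodgeConjecture.Theorems.LinearSystemTorelliLocalTubeSpanNegOne
import Summits.HodgeConjecture.HodgeConjecture.Theorems.LinearSystemTorelliLocalTubeSpanLefschetzSplitting
import Summits.HodgeConjecture.HodgeConjecture.Theorems.LinearSystemTorelliLocalTubeSpanHardLefschetzMember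
import Summits.HodgeConjecture.HodgeConjecture.Theorems.LinearSystemTorelliLocalTubeSpanTypedAssemblyVanishing
import Summits.HodgeConjecture.HodgeConjecture.Theorems.LinearSystemTorelliLocalTubeSpanIndexBookkeeping
import Summits.HodgeConjecture.HodgeConjecture.Theorems.LinearSystemTorelliLocalTubeSpanOrbitSpan
import Summits.HodgeConjecture.HodgeConjecture.Theorems.LinearSystemTorelliLocalTubeSpanFunctionalOfAnnihilator
import Summits.HodgeConjecture.HodgeConjecture.Theorems.LinearSystemTorelliLocalTubeSpanShearLattice
import Summits.HodgeConjecture.HodgeConjecture.Theorems.LinearSystemTorelliLocalTubeSpanQuotientTransfer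
import Summits.HodgeConjecture.HodgeConjecture.Theorems.LinearSystemTorelliLocalTubeSpanFrameLift
import Summits.HodgeConjecture.HodgeConjecture.Theorems.LinearSystemTorelliLocalTubeSpanTypedBasis
import Summits.HodgeConjecture.HodgeConjecture.Theorems.LinearSystemTorelliLocalTubeSpanLocTrivCharacterisation
import Summits.HodgeConjecture.HodgeConjecture.Theorems.LinearSystemTorelliLocalTubeSpanStableLocalGroup
import Summits.HodgeConjecture.HodgeConjecture.Theorems.LinearSystemTorelliLocalTubeSpanLemma11OfNondegenerate
import Summits.HodgeConjecture.HodgeConjecture.Theorems.LinearSystemTorelliLocalTubeSpanCongruenceLemmas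
import Summits.HodgeConjecture.HodgeConjecture.Theorems.LinearSystemTorelliLocalTubeSpanStarBasis
import Summits.HodgeConjecture.HodgeConjecture.Theorems.LinearSystemTorelliLocalTubeSpanLemma11Nondegenerate
import Summits.HodgeConjecture.HodgeConjecture.Theorems.LinearSystemTorelliLocalTubeSpanCapstone
import Summits.HodgeConjecture.HodgeConjecture.Theorems.LinearSystemTorelliLocalTubeSpanCapstoneOrbit
import Summits.HodgeConjecture.HodgeConjecture.Theorems.LinearSystemTorelliLocalTubeSpanCapstoneOrbitJanssen
import Summits.HodgeConjecture.HodgeConjecture.Theorems.LinearSystemTorelliLocalTubeSpanTypedInstances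
import Summits.HodgeConjecture.HodgeConjecture.Theorems.LinearSystemTorelliLocalTubeSpanSp2Elementary
import Summits.HodgeConjecture.HodgeConjecture.Theorems.LinearSystemTorelliLocalTubeSpanCompanion
import Summits.HodgeConjecture.HodgeConjecture.Theorems.LinearSystemTorelliLocalTubeSpanStarBasisOfCompanions
import Summits.HodgeConjecture.HodgeConjecture.Theorems.LinearSystemTorelliLocalTubeSpanLemma11OfStarBasis
import Summits.HodgeConjecture.HodgeConjecture.Theorems.LinearSystemTorelliLocalTubeSpanCoprimeShift
import Summits.HodgeConjecture.HodgeConjecture.Theorems.LinearSystemTorelliLocalTubeSpanEuclidGame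
import Summits.HodgeConjecture.HodgeConjecture.Theorems.LinearSystemTorelliLocalTubeSpanPlaneCalculus
import Summits.HodgeConjecture.HodgeConjecture.Theorems.LinearSystemTorelliLocalTubeSpanUnimodularTransitivityLemmas
import Summits.HodgeConjecture.HodgeConjecture.Theorems.LinearSystemTorelliLocalTubeSpanUnimodularTransitivity
import Summits.HodgeConjecture.HodgeConjecture.Theorems.LinearSystemTorelliLocalTubeSpanOneFact
import Summits.HodgeConjecture.HodgeConjecture.Theorems.LinearSystemTorelliLocalTubeSpanRankTwoJanssen

/-!
# Crux LocalTubeSpan (stmt-HodgeConjecture-2490) — line `Sketch`: the lead's skeleton (cycles 1–7; cycle 7 = continuation lead c6, see the section `## Cycle 7` at the end)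

The crux `LinearSystemTorelli.LocalTubeSpan` ("local Schnell theorem") is INFORMAL in the route
file (no Lean signature; payload `crux.signature = null`), so no `LocalTubeSpan_of` can conclude the
crux by name.  This skeleton drives the line `Sketch` as the ALGEBRAIC SPINE of the crux and
concludes the crux's formal SURROGATE at a subgroup `S ≤ G` (the local fundamental group
`G_{s₀} ≤ G = π₁(P ∖ Δ, s)`):

  `LocalTubeSpanAt A S : LinearMap.ker (evalCoinvOn A S) = H1resKer A S`

— the c-free local Schnell property at `S` (for `p ≥ 2`, `d ≫ 0` the class map `c` is an
isomorphism by Schnell2010 Prop. 7, so nothing is given away).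

Cycle 1 (previous lead) landed `stub_kerEvalCoinvOn` (Algebra, p105080), `stub_frame` (Frame,
p105082), `stub_layers` (Layers, p105081), `stub_schnellExample` (p104036), `stub_pairs` (Pairs,
p105719), `stub_ncNodal` (NCNodal, p105841) — all linked below by import.

Cycle 2 (this lead) — the residual algebra of the crux, "frame for the non-abelian part, rank-drop on
the abelian quotient" (crux NOTES.md):

* `stub_frameMod` — LANDED p108078 (`…FrameMod.lean`, `localTubeSpan_injective_evalCoinv_of_frame_mod`):
    Schnell's frame theorem MODULO a `G`-stable submodule `M` missing the generators' lines.
* `stub_radicalCore` (THE HARDEST, lead; proved in work/stubs/Radical.lean as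
    `localTubeSpan_injective_evalCoinv_of_frame_on_span`, landing as soon as the farm has built
    FrameMod/SkewVanishingLattice) — vocabulary-free core of the Transfer C⁺ of cards
    central-meridian-inflation (S4) / pencil-configuration-janssen (P4), corrected: generators act as
    transvections along cycles `Δ` none of which lies in the radical `R = L ∩ L^⊥` of the local lattice
    `L = ℚΔ`; a linearly independent frame realised in `G` such that every generator has a power
    agreeing ON `L` with a frame-group element ⇒ third map injective.  The same file proves from it,
    granting the named fact `Schnell2010_lemma11` (Janssen): (a) ONE COMPLETE ORBIT (single orbit,
    pair `⟨δ₁, δ₂⟩ = 1`, integral, `ℤΔ` f.g.; `L ≤ V` arbitrary, form on `L` possibly DEGENERATE) ⇒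
    injective (`…_of_completeOrbit`: the two-component members `Y₁ ∪ Y₂`, refuters' stratum (N)); (b)
    `ℚΔ = V`: Schnell2010 Prop. 12 itself, global step 3 (`…_of_vanishingLattice`).
* `stub_conjTransvection`, `stub_isometryOfGenerators` — transvection calculus (proved in the same
    file: conjugate meridians ↦ transvections of transported cycles; generated by isometries ⇒
    isometries) — how consumers discharge "every `T_δ`, `δ ∈ Δ`, is realised" from orbit data.
* `stub_reduction` (LANDED p108925) — sub-configuration reduction: injectivity on `⟨s'⟩` + "all relations
    among the generators' cycles are supported on `s'`" ⇒ injectivity (mechanism of MIXED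
    Janssen/nodal points: NCNodal on an orthogonal sub-configuration, e.g. `T₁²T₃⁻¹T₄²` at a
    tacnode + node member).
* `stub_pairsDual` (LANDED p109591) — the crux's printed dual phrasing at the `H¹` level.
* `stub_conjInvariant` (LANDED p109919) — the surrogate is invariant under conjugating `S` (local subgroups
    are defined only up to conjugacy: needed for the typed statement over `localKernelOn`).
* `stub_localKernelForm` (LANDED p110025) — the typed shape: under the surrogate at all local subgroups of a
    neighbourhood `N`, the tree's `localKernelOn ι V s N` is the space of classes undetected on them.
* Cycle-3 programme registered ahead (section `Mixed`): `stub_framePartial`, `stub_framePartialOnSpan`,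
    `stub_abelianTail` (lead) and the composition `injective_evalCoinv_of_mixed` — MIXED points
    (Janssen cluster + transversal nodes tied by relations), the last configuration type of the
    refuters' case list below the general multi-orbit statement P.

Cycle 3 (continuation lead c2) — see the section comment `## Cycle 3` below: finite orbit data
(`stub_saturation`, `stub_unimodularChain`, composition `injective_evalCoinv_of_connectedCluster`:
connected complete clusters, incl. non-orthogonal clusters linked by a unimodular pair) and the
THIN BOUNDARY (`stub_thinRep`, `stub_thinDynamics` (lead), `stub_thinClassification`,
`stub_thinCocycle`, composition `exists_thinConfiguration_not_injective`: an integral symplectic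
transvection configuration `δ₁, δ₂, δ₁ + δ₂`, `⟨δ₁, δ₂⟩ = 4`, with NON-injective third map).

Cycle 4 (continuation lead c3) — see the section comment `## Cycle 4` below: PORTABILITY of cyclic
detection (`stub_retract`, `stub_coordinatesUp`, `stub_finiteWitness`, `stub_baseChangeRetraction`,
`stub_baseChangeCoordinates` (lead), compositions `injective_evalCoinv_iff_of_isBaseChange` /
`injective_evalCoinv_iff_of_tensorEquiv`: detection over `ℚ` ⇔ over `ℂ` for finite-dimensional `V_ℚ`
and ANY group — the base-change gap between the `ℚ`-spine and the tree's `ℂ`-local systems;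
`stub_finiteIndexAscent`; `stub_directSum`); wave 2: `stub_distinguishedBasis` (the isolated singular point
UNCONDITIONALLY: distinguished basis of meridians ⇒ no named fact), `stub_rankTwoPairingThree` (lead;
pairing 3 is detected by a product word — corrects the cycle-3 "thin from 3" remark),
`stub_rankTwoPairingOne`, `stub_localKernelOfBalls` (typed glue), remark `LocalTubeSpanAt.inf_ker_le`.

What the surrogate leaves to the planner (D-0014): typing the crux against
`HyperplaneSectionLocalSystem` / `localSubgroup` / `discriminantLocus`, and the geometric stubs of
the cards (Hamm–Lê pencil presentation of `G_{s₀}`; one branch = single orbit at `Y₁ ∪ Y₂`; the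
`⟨δ, δ'⟩ = 1` pair from a cusp of `Δ_Z`).

Cycles 5 and 6: see the section comments `## Cycle 5` / `## Cycle 6` below (cycle 6: the typed endpoint
repaired along a neighbourhood BASIS, and Schnell's Lemma 11 for degenerate lattices from the
nondegenerate case).
-/

set_option linter.dupNamespace false

noncomputable section

open CategoryTheory groupCohomology
open scoped Pointwise
open Literature.AlgebraicGeometry.HodgeTheory
open Summit.HodgeConjecture.HodgeConjecture.Theorems

namespace Summit.HodgeConjecture.HodgeConjecture.Cruxes.LocalTubeSpan.Sketch

universe u v

section Surrogate

variable {k G : Type u} [CommRing k] [Group G] (A : Rep k G)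

/-- SURROGATE of the informal crux at a subgroup `S` (a local fundamental group): the classes of
`H¹(G, A)` undetected by every element of `S` are exactly those restricting to zero on `S`
("tube classes over local pairs span the locally visible part"). -/
def LocalTubeSpanAt (S : Subgroup G) : Prop :=
  LinearMap.ker (evalCoinvOn A S) = H1resKer A S

/-- stub (LANDED p105080, Algebra file): the local form. -/
theorem stub_kerEvalCoinvOn (S : Subgroup G)
    (h : Function.Injective (evalCoinv (Rep.res S.subtype A))) :
    LinearMap.ker (evalCoinvOn A S) = H1resKer A S :=
  localTubeSpan_ker_evalCoinvOn_eq_H1resKer_of_injective A S h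

/-- stub (LANDED p105081, Layers file): card johnson-flux-detection's layer lemma. -/
theorem stub_layers (K : Subgroup G) (𝒲 : Submodule k (H1 A)) (hLevi : 𝒲 ⊓ H1resKer A K = ⊥)
    (hUnip : ∀ ξ ∈ 𝒲, evalCoinvOn A K ξ = 0 → ξ ∈ H1resKer A K) :
    ∀ ξ ∈ 𝒲, evalCoinvOn A K ξ = 0 → ξ = 0 :=
  localTubeSpan_evalCoinvOn_eq_zero_imp_of_layers A K 𝒲 hLevi hUnip

/-- stub (LANDED p109919, Conj file — `localTubeSpan_surrogate_conj_iff`; kept as a statement until the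
farm has built that module — conjugation invariance of the surrogate).  Local subgroups are defined
only up to conjugacy (change of view point / path), so the surrogate must not depend on the
conjugate chosen: both `ker (evalCoinvOn A S)` (undetectedness of a cocycle by `g` is equivalent
to undetectedness by `hgh⁻¹`: `φ(hgh⁻¹) = (hgh⁻¹ - 1)(h·x - φ(h))` when `φ(g) = (g - 1)x`) and
`H1resKer A S` (tree: `H1resKer_conj_smul`) are invariant. -/
theorem stub_conjInvariant (S : Subgroup G) (h : G) :
    (LinearMap.ker (evalCoinvOn A (MulAut.conj h • S)) = H1resKer A (MulAut.conj h • S)) ↔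
      (LinearMap.ker (evalCoinvOn A S) = H1resKer A S) :=
  localTubeSpan_surrogate_conj_iff A S h

/-- stub (LANDED p105719, Pairs file — `localTubeSpan_orthogonal_range_sub_id`; kept as a
statement until the farm has built that module): `((g - 1)V)^⊥ = V^g` and `(g - 1)V = (V^g)^⊥`
for an isometry of a nondegenerate reflexive form. -/
theorem stub_pairs {K V : Type u} [Field K] [AddCommGroup V] [Module K V] [FiniteDimensional K V]
    (B : LinearMap.BilinForm K V) (hB : B.Nondegenerate) (hBr : B.IsRefl)
    (g : V →ₗ[K] V) (hg : ∀ x y, B (g x) (g y) = B x y) :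
    B.orthogonal (LinearMap.range (g - LinearMap.id)) = LinearMap.ker (g - LinearMap.id) ∧
    LinearMap.range (g - LinearMap.id) = B.orthogonal (LinearMap.ker (g - LinearMap.id)) :=
  localTubeSpan_orthogonal_range_sub_id B hB hBr g hg

/-- stub (LANDED p105841, NCNodal file —
`localTubeSpan_injective_evalCoinv_of_orthogonal_transvections`; kept as a statement until the farm
has built that module): the normal-crossing nodal stratum — commuting Picard–Lefschetz
transvections along mutually orthogonal non-zero (possibly dependent) vanishing cycles: the third
map is injective (rank-drop elements with integral exponents). -/
theorem stub_ncNodal {G : Type} [Group G] (A : Rep ℚ G) [FiniteDimensional ℚ A.V]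
    (B : LinearMap.BilinForm ℚ A.V) (hB : B.Nondegenerate)
    {n : ℕ} (t : Fin n → G) (ht : Subgroup.closure (Set.range t) = ⊤)
    (δ : Fin n → A.V) (hδ : ∀ i, δ i ≠ 0)
    (hPL : ∀ (i : Fin n) (x : A.V), A.ρ (t i) x = x - B x (δ i) • δ i)
    (horth : ∀ i j, B (δ i) (δ j) = 0) :
    Function.Injective (evalCoinv A) :=
  localTubeSpan_injective_evalCoinv_of_orthogonal_transvections A B hB t ht δ hδ hPL horth

end Surrogate

section Frame

variable {k G : Type u} [Field k] [CharZero k] [Group G] (A : Rep k G)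

/-- stub (LANDED p105082, Frame file): Schnell2010 Prop. 12 in frame form. -/
theorem stub_frame (s : Set G) (hs : Subgroup.closure s = ⊤)
    (e : G → A.V) (hse : ∀ t ∈ s, subOneRange A t ≤ k ∙ e t)
    (hfix : ∀ t ∈ s, A.ρ t (e t) = e t) {r : ℕ} (u : Fin r → G) (δ : Fin r → A.V)
    (hδ : LinearIndependent k δ) (hu : ∀ i, subOneRange A (u i) ≤ k ∙ δ i)
    (hvirt : ∀ t ∈ s, ∃ m : ℕ, 0 < m ∧ t ^ m ∈ Subgroup.closure (Set.range u)) :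
    Function.Injective (evalCoinv A) :=
  localTubeSpan_injective_evalCoinv_of_frame A s hs e hse hfix u δ hδ hu hvirt

/-- stub (LANDED p108078, FrameMod file — `localTubeSpan_injective_evalCoinv_of_frame_mod`; kept
as a statement until the farm has built that module): the frame theorem MODULO a stable
submodule.  As `stub_frame`, but the generators `t ∈ s` need only have a positive power in the
subgroup generated by the frame `u_i` TOGETHER WITH all elements `κ` whose `(κ - 1)V` lies in a
`G`-stable submodule `M` that meets no generator line `k·e_t`. -/
theorem stub_frameMod (s : Set G) (hs : Subgroup.closure s = ⊤)
    (e : G → A.V) (hse : ∀ t ∈ s, subOneRange A t ≤ k ∙ e t)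
    (hfix : ∀ t ∈ s, A.ρ t (e t) = e t) {r : ℕ} (u : Fin r → G) (δ : Fin r → A.V)
    (hδ : LinearIndependent k δ) (hu : ∀ i, subOneRange A (u i) ≤ k ∙ δ i)
    (M : Submodule k A.V) (hM : ∀ (g : G), ∀ v ∈ M, A.ρ g v ∈ M)
    (hMe : ∀ t ∈ s, (k ∙ e t) ⊓ M = ⊥)
    (hvirt : ∀ t ∈ s, ∃ m : ℕ, 0 < m ∧
      t ^ m ∈ Subgroup.closure (Set.range u ∪ {κ : G | subOneRange A κ ≤ M})) :
    Function.Injective (evalCoinv A) :=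
  localTubeSpan_injective_evalCoinv_of_frame_mod A s hs e hse hfix u δ hδ hu M hM hMe hvirt

/-- stub (LANDED p104036, SchnellExample file): tightness — the third map is not injective for
general modules (Schnell2010 §6 Example, `ℤ²` on `ℚ³`). -/
theorem stub_schnellExample :
    ∃ (G : Type) (_ : Group G) (A : Rep ℚ G), ¬ Function.Injective (evalCoinv A) :=
  localTubeSpan_exists_not_injective_evalCoinv

/-- COMPOSITION (the line's transfer, frame regime): a detecting frame INSIDE the local group `S`
gives the surrogate crux at `S`. -/
theorem LocalTubeSpanAt_of (S : Subgroup G) (s : Set S) (hs : Subgroup.closure s = ⊤)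
    (e : S → A.V) (hse : ∀ t ∈ s, subOneRange A (t : G) ≤ k ∙ e t)
    (hfix : ∀ t ∈ s, A.ρ t (e t) = e t) {r : ℕ} (u : Fin r → S) (δ : Fin r → A.V)
    (hδ : LinearIndependent k δ) (hu : ∀ i, subOneRange A (u i : G) ≤ k ∙ δ i)
    (hvirt : ∀ t ∈ s, ∃ m : ℕ, 0 < m ∧ t ^ m ∈ Subgroup.closure (Set.range u)) :
    LocalTubeSpanAt A S :=
  stub_kerEvalCoinvOn A S
    (stub_frame (Rep.res S.subtype A) s hs e hse hfix u δ hδ hu hvirt)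

end Frame

section Transvections

variable {G : Type} [Group G] (A : Rep.{0} ℚ G)

/-- stub (p110211 PENDING farm, Transvections file — `localTubeSpan_conj_transvection_formula`): if `G`
acts by isometries of `B` and `t` acts as the Picard–Lefschetz transvection along `δ`, then
`g t g⁻¹` acts as the transvection along `g·δ` (conjugate meridians ↦ transported cycles). -/
theorem stub_conjTransvection (B : LinearMap.BilinForm ℚ A.V)
    (hiso : ∀ (g : G) (x y : A.V), B (A.ρ g x) (A.ρ g y) = B x y) (g t : G) (δ : A.V)
    (ht : ∀ x : A.V, A.ρ t x = x - B x δ • δ) (x : A.V) :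
    A.ρ (g * t * g⁻¹) x = x - B x (A.ρ g δ) • A.ρ g δ :=
  localTubeSpan_conj_transvection_formula B A.ρ hiso g t δ ht x

/-- stub (p110211 PENDING farm, Transvections file — `localTubeSpan_isometry_of_generators` ∘
`localTubeSpan_isometry_of_transvection_formula`): a group
generated by elements acting as transvections of an ALTERNATING form acts by isometries. -/
theorem stub_isometryOfGenerators (B : LinearMap.BilinForm ℚ A.V) (hB : B.IsAlt)
    (s : Set G) (hs : Subgroup.closure s = ⊤)
    (hsT : ∀ t ∈ s, ∃ δ : A.V, ∀ x : A.V, A.ρ t x = x - B x δ • δ) :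
    ∀ (g : G) (x y : A.V), B (A.ρ g x) (A.ρ g y) = B x y :=
  fun g x y => localTubeSpan_isometry_of_generators B A.ρ s hs (fun t ht => by
    obtain ⟨δ, hδ⟩ := hsT t ht
    exact localTubeSpan_isometry_of_transvection_formula B hB δ (A.ρ t) hδ) g x y

/-- stub (p110215 PENDING farm, Radical file — `localTubeSpan_injective_evalCoinv_of_frame_on_span`;
cycle 2's hardest, taken by the lead).  Vocabulary-free core of "RadicalProp12"
(Transfer C⁺ of the two ideator-2 cards, corrected).  Let `G` act on the finite-dimensional
`ℚ`-space `V = A` with an alternating form `B`, generated by a set `s` of elements acting as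
transvections `x ↦ x - B(x, δ)δ` along members of a set `Δ ⊆ V` ("local vanishing cycles") none of
which lies in the radical `R = L ∩ L^⊥` of the local lattice `L = ℚΔ` (automatic for a union of
complete orbits).  If there is a linearly independent frame `δ'_i` realised in `G` by transvections
`u_i` such that every generator has a positive power agreeing ON `L` with an element of the frame
group `⟨u_i⟩` (finite index of the frame group in the image of `G → GL(L)`: what Schnell's Lemma 11 /
Janssen's Theorem 2.5 supply for ONE COMPLETE ORBIT — `…_of_completeOrbit` in the same file derives
that case from the named fact `Schnell2010_lemma11`, and Schnell2010 Prop. 12 is the sub-case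
`ℚΔ = V`), then Schnell's third map `H¹(G, V) → ∏_g V/(g - 1)V` is injective.  The new step beyond
Schnell: the discrepancy `κ = γ⁻¹t^m` acts trivially on `L`, is an isometry and moves `V` into `L`,
hence `(κ - 1)V ⊆ R`, and `stub_frameMod` with `M = R` applies (visible classes are detected by
such local Torelli elements `κ`). -/
theorem stub_radicalCore [FiniteDimensional ℚ A.V]
    (B : LinearMap.BilinForm ℚ A.V) (hB : B.IsAlt) (Δ : Set A.V)
    (s : Set G) (hs : Subgroup.closure s = ⊤)
    (hsΔ : ∀ t ∈ s, ∃ δ ∈ Δ, ∀ x : A.V, A.ρ t x = x - B x δ • δ)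
    (hnotR : ∀ δ ∈ Δ, δ ∉ Submodule.span ℚ Δ ⊓ B.orthogonal (Submodule.span ℚ Δ))
    {r : ℕ} (u : Fin r → G) (δ' : Fin r → A.V)
    (hli : LinearIndependent ℚ δ') (hu : ∀ (i : Fin r) (x : A.V), A.ρ (u i) x = x - B x (δ' i) • δ' i)
    (hvirtL : ∀ t ∈ s, ∃ m : ℕ, 0 < m ∧ ∃ γ ∈ Subgroup.closure (Set.range u),
      ∀ x ∈ Submodule.span ℚ Δ, A.ρ (t ^ m) x = A.ρ γ x) :
    Function.Injective (evalCoinv A) :=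
  localTubeSpan_injective_evalCoinv_of_frame_on_span A B hB Δ s hs hsΔ hnotR u δ' hli hu hvirtL

/-- COMPOSITION (one-branch regime, core form): at a local group `S ≤ G` whose meridians act as
transvections along cycles `Δ` avoiding the radical of `ℚΔ`, a detecting frame on `ℚΔ` (Lemma 11
for the complete orbit) gives the surrogate crux at `S` (`stub_kerEvalCoinvOn ∘ stub_radicalCore`). -/
theorem LocalTubeSpanAt_of_oneBranch [FiniteDimensional ℚ A.V] (S : Subgroup G)
    (B : LinearMap.BilinForm ℚ A.V) (hB : B.IsAlt) (Δ : Set A.V)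
    (s : Set S) (hs : Subgroup.closure s = ⊤)
    (hsΔ : ∀ t ∈ s, ∃ δ ∈ Δ, ∀ x : A.V, A.ρ t x = x - B x δ • δ)
    (hnotR : ∀ δ ∈ Δ, δ ∉ Submodule.span ℚ Δ ⊓ B.orthogonal (Submodule.span ℚ Δ))
    {r : ℕ} (u : Fin r → S) (δ' : Fin r → A.V)
    (hli : LinearIndependent ℚ δ')
    (hu : ∀ (i : Fin r) (x : A.V), A.ρ (u i) x = x - B x (δ' i) • δ' i)
    (hvirtL : ∀ t ∈ s, ∃ m : ℕ, 0 < m ∧ ∃ γ ∈ Subgroup.closure (Set.range u),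
      ∀ x ∈ Submodule.span ℚ Δ, A.ρ (t ^ m) x = A.ρ γ x) :
    LocalTubeSpanAt A S :=
  stub_kerEvalCoinvOn A S
    (stub_radicalCore (Rep.res S.subtype A) B hB Δ s hs hsΔ hnotR u δ' hli hu hvirtL)

end Transvections

section Reduction

variable {k G : Type u} [Field k] [Group G] (A : Rep k G)

/-- stub (LANDED p108925, Reduction file — `localTubeSpan_injective_evalCoinv_of_subconfiguration`;
kept as a statement until the farm has built that module — sub-configuration reduction).  Let `G`, generated by `s`, act on the
finite-dimensional space `V = A` through Picard–Lefschetz transvections `t(x) = x - B(x, e_t) e_t`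
(`t ∈ s`) of a nondegenerate form `B`.  If Schnell's third map is injective for the subgroup
generated by a sub-family `s' ⊆ s`, and the remaining cycles `e_t`, `t ∈ s ∖ s'`, are linearly
independent modulo the span of the `e_t`, `t ∈ s'` (every linear relation among the generators'
cycles is supported on `s'`), then the third map of `G` is injective.  (An undetected class is a
coboundary `dv` on `⟨s'⟩`; after subtracting `dv` the cocycle vanishes on `s'` and equals `a_t e_t`
on the rest; a functional vanishing on `ℚ e(s')` with `f(e_t) = -a_t` exists by independence,
`x = B♯⁻¹ f` by nondegeneracy, and the cocycle equals `dx` on all generators.) -/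
theorem stub_reduction [FiniteDimensional k A.V] (B : LinearMap.BilinForm k A.V)
    (hB : B.Nondegenerate) (s : Set G) (hs : Subgroup.closure s = ⊤) (e : G → A.V)
    (hPL : ∀ t ∈ s, ∀ x : A.V, A.ρ t x = x - B x (e t) • e t)
    (s' : Set G) (hs' : s' ⊆ s)
    (hinj : Function.Injective (evalCoinv (Rep.res (Subgroup.closure s').subtype A)))
    (hind : LinearIndependent k
      (fun t : ↥(s \ s') => (Submodule.span k (e '' s')).mkQ (e t))) :
    Function.Injective (evalCoinv A) :=
  localTubeSpan_injective_evalCoinv_of_subconfiguration A B hB s hs e hPL s' hs' hinj hind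

/-- stub (LANDED p109591, PairsDual file — `localTubeSpan_evalCoinv_eq_zero_iff_pairs`; kept as a
statement until the farm has built that module — the crux's printed dual phrasing at the `H¹` level).  If `G` acts by
isometries of a nondegenerate reflexive form `B` on the finite-dimensional `V = A`, a class `[φ]`
is undetected by Schnell's third map iff ALL its tube periods over pairs vanish:
`B α (φ g) = 0` whenever `g α = α` ([Schnell2010] §3 (tube-dual), §8 Lemma 13). -/
theorem stub_pairsDual [FiniteDimensional k A.V] (B : LinearMap.BilinForm k A.V)
    (hB : B.Nondegenerate) (hBr : B.IsRefl)
    (hiso : ∀ (g : G) (x y : A.V), B (A.ρ g x) (A.ρ g y) = B x y) (φ : cocycles₁ A) :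
    evalCoinv A (H1π A φ) = 0 ↔
      ∀ (g : G) (α : A.V), A.ρ g α = α → B α ((φ : G → A.V) g) = 0 :=
  localTubeSpan_evalCoinv_eq_zero_iff_pairs A B hB hBr hiso φ

end Reduction

section Mixed

/-!
### Cycle 3 programme (registered ahead): MIXED points — complete orbits glued to nodes

At a member with a one-branch (Janssen-complete) cluster AND transversal nodes whose cycles are tied
to the cluster's radical by global relations (tacnode + node: `δ₁ + δ₃ + δ₄ = 0`), neither mechanism
alone suffices: the frame kills an undetected cocycle on the cluster's meridians (`stub_framePartial`,
`stub_framePartialOnSpan`), and the residual cocycle on the CENTRAL node meridians is a coboundary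
by the NC rank-drop mechanism run on the orthogonal sub-configurations `{a, a + cℓ} ∪ nodes`
supplied by Janssen companions `a + cℓ ∈ Δ` (Janssen 1983 Thm. 2.9; `stub_abelianTail`).
-/

variable {k G : Type u} [Field k] [CharZero k] [Group G]

/-- stub (wave 2 — the frame theorem with a PARTIAL conclusion).  Hypotheses of `stub_frameMod`
for a sub-family `s₁` of elements only (no generation assumption): every undetected cocycle is,
up to ONE coboundary, zero on the frame and on `s₁`.  (Same proof as FrameMod: adjust at the
ordered product of the frame, peel by linear independence, then `m·φ(t) ∈ M ∩ k·e_t = 0`.) -/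
theorem stub_framePartial (A : Rep k G) {r : ℕ} (u : Fin r → G) (δ : Fin r → A.V)
    (hδ : LinearIndependent k δ) (hu : ∀ i, subOneRange A (u i) ≤ k ∙ δ i)
    (M : Submodule k A.V) (hM : ∀ (g : G), ∀ v ∈ M, A.ρ g v ∈ M)
    (s₁ : Set G) (e : G → A.V) (hse : ∀ t ∈ s₁, subOneRange A t ≤ k ∙ e t)
    (hfix : ∀ t ∈ s₁, A.ρ t (e t) = e t) (hMe : ∀ t ∈ s₁, (k ∙ e t) ⊓ M = ⊥)
    (hvirt : ∀ t ∈ s₁, ∃ m : ℕ, 0 < m ∧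
      t ^ m ∈ Subgroup.closure (Set.range u ∪ {κ : G | subOneRange A κ ≤ M}))
    (φ : cocycles₁ A) (hφ : ∀ g : G, (φ : G → A.V) g ∈ subOneRange A g) :
    ∃ v : A.V, (∀ i, (φ : G → A.V) (u i) = A.ρ (u i) v - v) ∧
      ∀ t ∈ s₁, (φ : G → A.V) t = A.ρ t v - v :=
  localTubeSpan_exists_sub_eq_of_frame_partial A u δ hδ hu M hM s₁ e hse hfix hMe hvirt φ hφ

variable {G₀ : Type} [Group G₀] (A : Rep.{0} ℚ G₀)

/-- stub (wave 2/3 — partial frame theorem on the span of a sub-family, transvection form).  `G`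
generated by `s` acting as transvections of an alternating `B`; for a sub-family `s₁ ⊆ s` whose
cycles avoid the radical of their own span `L₁` and such that the OTHER generators' cycles are
orthogonal to `L₁` (transversal nodes), a linearly independent frame inside `⟨s₁⟩` with every
`t ∈ s₁` having a power that agrees ON `L₁` with a frame-group element (Lemma 11 for the complete
orbit) forces every undetected cocycle to be a coboundary on `s₁` (up to one coboundary).  From
`stub_framePartial` with `M = L₁ ∩ L₁^⊥` by the `κ`-argument of `stub_radicalCore`. -/
theorem stub_framePartialOnSpan [FiniteDimensional ℚ A.V] (B : LinearMap.BilinForm ℚ A.V)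
    (hB : B.IsAlt) (s : Set G₀) (hs : Subgroup.closure s = ⊤) (e : G₀ → A.V)
    (hPL : ∀ t ∈ s, ∀ x : A.V, A.ρ t x = x - B x (e t) • e t)
    (s₁ : Set G₀) (hs₁ : s₁ ⊆ s)
    (hnotR : ∀ t ∈ s₁, e t ∉ Submodule.span ℚ (e '' s₁) ⊓ B.orthogonal (Submodule.span ℚ (e '' s₁)))
    (hout : ∀ t ∈ s \ s₁, ∀ y ∈ Submodule.span ℚ (e '' s₁), B y (e t) = 0)
    {r : ℕ} (u : Fin r → G₀) (hu₁ : ∀ i, u i ∈ Subgroup.closure s₁) (δ' : Fin r → A.V)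
    (hli : LinearIndependent ℚ δ')
    (hu : ∀ (i : Fin r) (x : A.V), A.ρ (u i) x = x - B x (δ' i) • δ' i)
    (hvirtL : ∀ t ∈ s₁, ∃ m : ℕ, 0 < m ∧ ∃ γ ∈ Subgroup.closure (Set.range u),
      ∀ x ∈ Submodule.span ℚ (e '' s₁), A.ρ (t ^ m) x = A.ρ γ x)
    (φ : cocycles₁ A) (hφ : ∀ g : G₀, (φ : G₀ → A.V) g ∈ subOneRange A g) :
    ∃ v : A.V, ∀ t ∈ s₁, (φ : G₀ → A.V) t = A.ρ t v - v :=
  localTubeSpan_exists_sub_eq_of_frame_on_span_partial A B hB s hs e hPL s₁ hs₁ hnotR hout u hu₁ δ' hli hu hvirtL φ hφ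

/-- stub (wave 2 — THE HARDEST of cycle 3, lead: the ABELIAN TAIL).  `G` generated by `s₁ ∪ s₂`
acting as transvections of a nondegenerate alternating `B`; the cycles of `s₂` (transversal NODES)
are non-zero and orthogonal to every cycle; JANSSEN COMPANIONS: for every non-zero `ℓ` lying both in
`L₁ = ℚ e(s₁)` and in `ℚ e(s₂)` (a relation tying node cycles to the cluster) there are elements
`g₁, g₂ ∈ ⟨s₁⟩` acting as transvections along `a` and `a + cℓ` (`a ∈ L₁`, `c ≠ 0`; Janssen 1983
Thm. 2.9 supplies `a + 2β ∈ Δ` for `β` in the radical of a complete orbit).  Then an undetected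
cocycle that VANISHES on `s₁` is a coboundary.  (For each relation `y + Σ c_t e_t = 0`, `y ∈ L₁`,
the NC lemma on the abelian subgroup `⟨g₁, g₂, nodes⟩` — orthogonal cycles `a, a + cℓ, e_t` — gives
`x_H` with `B(x_H, a) = B(x_H, a + cℓ) = 0`, `a_t = -B(x_H, e_t)`, whence `Σ c_t a_t = 0`; so a
functional `f` with `f|L₁ = 0`, `f(e_t) = -a_t` exists, `x = B♯⁻¹ f`, and `φ = dx` on all
generators.) -/
theorem stub_abelianTail [FiniteDimensional ℚ A.V] (B : LinearMap.BilinForm ℚ A.V)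
    (hB : B.Nondegenerate) (hBalt : B.IsAlt)
    (s₁ s₂ : Set G₀) (hs : Subgroup.closure (s₁ ∪ s₂) = ⊤) (e : G₀ → A.V)
    (hPL : ∀ t ∈ s₁ ∪ s₂, ∀ x : A.V, A.ρ t x = x - B x (e t) • e t)
    (horth : ∀ t ∈ s₂, ∀ t' ∈ s₁ ∪ s₂, B (e t) (e t') = 0) (hne : ∀ t ∈ s₂, e t ≠ 0)
    (hcomp : ∀ ℓ ∈ Submodule.span ℚ (e '' s₁) ⊓ Submodule.span ℚ (e '' s₂), ℓ ≠ 0 →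
      ∃ g₁ ∈ Subgroup.closure s₁, ∃ g₂ ∈ Subgroup.closure s₁, ∃ (a : A.V) (c : ℚ),
        a ≠ 0 ∧ a + c • ℓ ≠ 0 ∧ c ≠ 0 ∧ a ∈ Submodule.span ℚ (e '' s₁) ∧
        (∀ x : A.V, A.ρ g₁ x = x - B x a • a) ∧
        (∀ x : A.V, A.ρ g₂ x = x - B x (a + c • ℓ) • (a + c • ℓ)))
    (φ : cocycles₁ A) (hφ : ∀ g : G₀, (φ : G₀ → A.V) g ∈ subOneRange A g)
    (hφ₁ : ∀ t ∈ s₁, (φ : G₀ → A.V) t = 0) :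
    H1π A φ = 0 :=
  localTubeSpan_H1π_eq_zero_of_abelianTail A B hB hBalt s₁ s₂ hs e hPL horth hne hcomp φ hφ hφ₁

/-- COMPOSITION (mixed points): `stub_framePartialOnSpan` (the cluster's meridians `s₁`) followed by
`stub_abelianTail` (the nodes `s₂`) gives injectivity of Schnell's third map for
`G = ⟨s₁ ∪ s₂⟩`. -/
theorem injective_evalCoinv_of_mixed [FiniteDimensional ℚ A.V] (B : LinearMap.BilinForm ℚ A.V)
    (hB : B.Nondegenerate) (hBalt : B.IsAlt)
    (s₁ s₂ : Set G₀) (hs : Subgroup.closure (s₁ ∪ s₂) = ⊤) (e : G₀ → A.V)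
    (hPL : ∀ t ∈ s₁ ∪ s₂, ∀ x : A.V, A.ρ t x = x - B x (e t) • e t)
    (horth : ∀ t ∈ s₂, ∀ t' ∈ s₁ ∪ s₂, B (e t) (e t') = 0) (hne : ∀ t ∈ s₂, e t ≠ 0)
    (hnotR : ∀ t ∈ s₁, e t ∉ Submodule.span ℚ (e '' s₁) ⊓ B.orthogonal (Submodule.span ℚ (e '' s₁)))
    {r : ℕ} (u : Fin r → G₀) (hu₁ : ∀ i, u i ∈ Subgroup.closure s₁) (δ' : Fin r → A.V)
    (hli : LinearIndependent ℚ δ')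
    (hu : ∀ (i : Fin r) (x : A.V), A.ρ (u i) x = x - B x (δ' i) • δ' i)
    (hvirtL : ∀ t ∈ s₁, ∃ m : ℕ, 0 < m ∧ ∃ γ ∈ Subgroup.closure (Set.range u),
      ∀ x ∈ Submodule.span ℚ (e '' s₁), A.ρ (t ^ m) x = A.ρ γ x)
    (hcomp : ∀ ℓ ∈ Submodule.span ℚ (e '' s₁) ⊓ Submodule.span ℚ (e '' s₂), ℓ ≠ 0 →
      ∃ g₁ ∈ Subgroup.closure s₁, ∃ g₂ ∈ Subgroup.closure s₁, ∃ (a : A.V) (c : ℚ),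
        a ≠ 0 ∧ a + c • ℓ ≠ 0 ∧ c ≠ 0 ∧ a ∈ Submodule.span ℚ (e '' s₁) ∧
        (∀ x : A.V, A.ρ g₁ x = x - B x a • a) ∧
        (∀ x : A.V, A.ρ g₂ x = x - B x (a + c • ℓ) • (a + c • ℓ))) :
    Function.Injective (evalCoinv A) := by
  refine (injective_iff_map_eq_zero _).2 fun ξ hξ => ?_
  induction ξ using H1_induction_on with
  | h φ =>
    have hund : ∀ g : G₀, (φ : G₀ → A.V) g ∈ subOneRange A g := fun g => by
      have := congr_fun hξ g
      rwa [evalCoinv_H1π, Pi.zero_apply, Submodule.mkQ_apply, Submodule.Quotient.mk_eq_zero]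
        at this
    -- orthogonality of the node cycles to `L₁` in the form `stub_framePartialOnSpan` wants
    have hout : ∀ t ∈ (s₁ ∪ s₂) \ s₁, ∀ y ∈ Submodule.span ℚ (e '' s₁), B y (e t) = 0 := by
      intro t ht y hy
      have ht₂ : t ∈ s₂ := ht.1.resolve_left ht.2
      refine Submodule.span_induction (fun x hx => ?_) (by simp) (fun x y _ _ hx hy => ?_)
        (fun c x _ hx => ?_) hy
      · obtain ⟨t', ht', rfl⟩ := hx
        rw [← hBalt.neg_eq, horth t ht₂ t' (Or.inl ht'), neg_zero]
      · rw [map_add, LinearMap.add_apply, hx, hy, add_zero]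
      · rw [map_smul, LinearMap.smul_apply, hx, smul_zero]
    obtain ⟨v, hv⟩ := stub_framePartialOnSpan A B hBalt (s₁ ∪ s₂) hs e hPL s₁
      Set.subset_union_left hnotR hout u hu₁ δ' hli hu hvirtL φ hund
    -- the adjusted cocycle vanishes on `s₁`, is undetected, and differs from `φ` by a coboundary
    set φ' : cocycles₁ A := φ - ⟨d₀₁ A v, d₀₁_apply_mem_cocycles₁ v⟩ with hφ'def
    have hφ'apply : ∀ g, (φ' : G₀ → A.V) g = (φ : G₀ → A.V) g - (A.ρ g v - v) := fun g => by
      rw [hφ'def]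
      change (φ : G₀ → A.V) g - d₀₁ A v g = _
      rw [d₀₁_hom_apply]
    have hund' : ∀ g : G₀, (φ' : G₀ → A.V) g ∈ subOneRange A g :=
      localTubeSpan_undetected_sub_d₀₁ A φ hund v
    have hzero' : H1π A φ' = 0 :=
      stub_abelianTail A B hB hBalt s₁ s₂ hs e hPL horth hne hcomp φ' hund'
        (fun t ht => by rw [hφ'apply, hv t ht, sub_self])
    have e1 : φ = φ' + ⟨d₀₁ A v, d₀₁_apply_mem_cocycles₁ v⟩ := by rw [hφ'def]; abel
    rw [e1, map_add, hzero', zero_add, H1π_eq_zero_iff]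
    exact ⟨v, rfl⟩


/-- stub (LANDED p114209 + p114449, files `…MultiTail` + `…MultiCluster` —
`localTubeSpan_injective_evalCoinv_of_multiCluster` — MULTI-BRANCH points).  Finitely many
pairwise-ORTHOGONAL Janssen clusters `s j` plus transversal nodes `s₀`: the general multi-orbit
configuration statement `P(V; δ)` for geometric configurations (every branch complete or nodal,
distinct branches orthogonal).  Per cluster: a transvection frame inside `⟨s j⟩` in which every
meridian has a power up to elements trivial on `L_j` (Lemma 11), no cycle in the radical of `L_j`,
Janssen companions for every non-zero radical vector (Thm. 2.9).  Then the third map is injective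
(per-cluster partial frame theorem, then ONE functional on `Σ L_j + ℚe(s₀)`: relations live in the
radicals, consistency by the NC lemma on `{a_j, a_j + c_j y_j} ∪ nodes`). -/
theorem stub_multiCluster [FiniteDimensional ℚ A.V]
    (B : LinearMap.BilinForm ℚ A.V) (hB : B.Nondegenerate) (hBalt : B.IsAlt)
    {b : ℕ} (s : Fin b → Set G₀) (s₀ : Set G₀) (hs : Subgroup.closure (s₀ ∪ ⋃ j, s j) = ⊤)
    (e : G₀ → A.V) (hPL : ∀ t ∈ s₀ ∪ ⋃ j, s j, ∀ x : A.V, A.ρ t x = x - B x (e t) • e t)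
    (horth : ∀ i j, i ≠ j → ∀ t ∈ s i, ∀ t' ∈ s j, B (e t) (e t') = 0)
    (horth₀ : ∀ t ∈ s₀, ∀ t' ∈ s₀ ∪ ⋃ j, s j, B (e t) (e t') = 0) (hne₀ : ∀ t ∈ s₀, e t ≠ 0)
    (hnotR : ∀ (j : Fin b), ∀ t ∈ s j,
      e t ∉ Submodule.span ℚ (e '' s j) ⊓ B.orthogonal (Submodule.span ℚ (e '' s j)))
    (r : Fin b → ℕ) (u : (j : Fin b) → Fin (r j) → G₀) (hu₁ : ∀ j i, u j i ∈ Subgroup.closure (s j))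
    (δ' : (j : Fin b) → Fin (r j) → A.V) (hli : ∀ j, LinearIndependent ℚ (δ' j))
    (hu : ∀ (j : Fin b) (i : Fin (r j)) (x : A.V), A.ρ (u j i) x = x - B x (δ' j i) • δ' j i)
    (hvirtL : ∀ (j : Fin b), ∀ t ∈ s j, ∃ m : ℕ, 0 < m ∧ ∃ γ ∈ Subgroup.closure (Set.range (u j)),
      ∀ x ∈ Submodule.span ℚ (e '' s j), A.ρ (t ^ m) x = A.ρ γ x)
    (hcomp : ∀ (j : Fin b), ∀ ℓ ∈ Submodule.span ℚ (e '' s j) ⊓ B.orthogonal (Submodule.span ℚ (e '' s j)),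
      ℓ ≠ 0 → ∃ g₁ ∈ Subgroup.closure (s j), ∃ g₂ ∈ Subgroup.closure (s j), ∃ (a : A.V) (c : ℚ),
        a ≠ 0 ∧ a + c • ℓ ≠ 0 ∧ c ≠ 0 ∧ a ∈ Submodule.span ℚ (e '' s j) ∧
        (∀ x : A.V, A.ρ g₁ x = x - B x a • a) ∧
        (∀ x : A.V, A.ρ g₂ x = x - B x (a + c • ℓ) • (a + c • ℓ))) :
    Function.Injective (evalCoinv A) :=
  localTubeSpan_injective_evalCoinv_of_multiCluster A B hB hBalt s s₀ hs e hPL horth horth₀ hne₀ hnotR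
    r u hu₁ δ' hli hu hvirtL hcomp

/-- COMPOSITION (multi-branch regime): the surrogate crux at a local group `S` of multi-branch type
(`stub_kerEvalCoinvOn ∘ stub_multiCluster`). -/
theorem LocalTubeSpanAt_of_multiCluster [FiniteDimensional ℚ A.V] (S : Subgroup G₀)
    (B : LinearMap.BilinForm ℚ A.V) (hB : B.Nondegenerate) (hBalt : B.IsAlt)
    {b : ℕ} (s : Fin b → Set S) (s₀ : Set S) (hs : Subgroup.closure (s₀ ∪ ⋃ j, s j) = ⊤)
    (e : S → A.V) (hPL : ∀ t ∈ s₀ ∪ ⋃ j, s j, ∀ x : A.V, A.ρ t x = x - B x (e t) • e t)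
    (horth : ∀ i j, i ≠ j → ∀ t ∈ s i, ∀ t' ∈ s j, B (e t) (e t') = 0)
    (horth₀ : ∀ t ∈ s₀, ∀ t' ∈ s₀ ∪ ⋃ j, s j, B (e t) (e t') = 0) (hne₀ : ∀ t ∈ s₀, e t ≠ 0)
    (hnotR : ∀ (j : Fin b), ∀ t ∈ s j,
      e t ∉ Submodule.span ℚ (e '' s j) ⊓ B.orthogonal (Submodule.span ℚ (e '' s j)))
    (r : Fin b → ℕ) (u : (j : Fin b) → Fin (r j) → S) (hu₁ : ∀ j i, u j i ∈ Subgroup.closure (s j))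
    (δ' : (j : Fin b) → Fin (r j) → A.V) (hli : ∀ j, LinearIndependent ℚ (δ' j))
    (hu : ∀ (j : Fin b) (i : Fin (r j)) (x : A.V), A.ρ (u j i) x = x - B x (δ' j i) • δ' j i)
    (hvirtL : ∀ (j : Fin b), ∀ t ∈ s j, ∃ m : ℕ, 0 < m ∧ ∃ γ ∈ Subgroup.closure (Set.range (u j)),
      ∀ x ∈ Submodule.span ℚ (e '' s j), A.ρ (t ^ m) x = A.ρ γ x)
    (hcomp : ∀ (j : Fin b), ∀ ℓ ∈ Submodule.span ℚ (e '' s j) ⊓ B.orthogonal (Submodule.span ℚ (e '' s j)),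
      ℓ ≠ 0 → ∃ g₁ ∈ Subgroup.closure (s j), ∃ g₂ ∈ Subgroup.closure (s j), ∃ (a : A.V) (c : ℚ),
        a ≠ 0 ∧ a + c • ℓ ≠ 0 ∧ c ≠ 0 ∧ a ∈ Submodule.span ℚ (e '' s j) ∧
        (∀ x : A.V, A.ρ g₁ x = x - B x a • a) ∧
        (∀ x : A.V, A.ρ g₂ x = x - B x (a + c • ℓ) • (a + c • ℓ))) :
    LocalTubeSpanAt A S :=
  stub_kerEvalCoinvOn A S (stub_multiCluster (Rep.res S.subtype A) B hB hBalt s s₀ hs e hPL horth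
    horth₀ hne₀ hnotR r u hu₁ δ' hli hu hvirtL hcomp)

end Mixed

section Typed

open _root_.Topology Filter

variable {k S : Type u} [CommRing k] [TopologicalSpace S] {T : Type v} [TopologicalSpace T]
  (ι : C(S, T)) (V : Literature.AlgebraicGeometry.Motives.LocalSystem k S) (s : S)

/-- stub (LANDED p110025, LocalKernel file — `localTubeSpan_localKernelOn_eq_iInf_ker_of_surrogate`;
kept as a statement until the farm has built that module — the typed shape of the crux over the
tree's local-system vocabulary).
If the surrogate holds at every local subgroup of a subset `N ⊆ T` (all view points `s'` with
`ι s' ∈ N`, all paths `γ` to the base point), then the tree's `localKernelOn ι V s N` (classes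
restricting to zero on all those local subgroups) is exactly the space of classes UNDETECTED on all
of them — the c-free LocalTubeSpan at `N` in the form a planner can type against
`HyperplaneSectionLocalSystem` (with `N` a small ball around `t₀ ∈ Δ`). -/
theorem stub_localKernelForm (N : Set T)
    (h : ∀ (s' : S) (hs' : ι s' ∈ N) (γ : Path s' s),
      LinearMap.ker (evalCoinvOn (monodromyRepObj V s) (localSubgroup ι s N hs' γ)) =
        H1resKer (monodromyRepObj V s) (localSubgroup ι s N hs' γ)) :
    localKernelOn ι V s N = ⨅ (s' : S) (hs' : ι s' ∈ N) (γ : Path s' s),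
      LinearMap.ker (evalCoinvOn (monodromyRepObj V s) (localSubgroup ι s N hs' γ)) :=
  localTubeSpan_localKernelOn_eq_iInf_ker_of_surrogate ι V s N h

end Typed

section RationalComposition

variable {G : Type} [Group G] (A : Rep.{0} ℚ G)

/-- COMPOSITION at a NORMAL-CROSSING NODAL point (`stub_kerEvalCoinvOn ∘ stub_ncNodal`). -/
theorem LocalTubeSpanAt_of_ncNodal [FiniteDimensional ℚ A.V] (S : Subgroup G)
    (B : LinearMap.BilinForm ℚ A.V) (hB : B.Nondegenerate)
    {n : ℕ} (t : Fin n → S) (ht : Subgroup.closure (Set.range t) = ⊤)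
    (δ : Fin n → A.V) (hδ : ∀ i, δ i ≠ 0)
    (hPL : ∀ (i : Fin n) (x : A.V), A.ρ (t i) x = x - B x (δ i) • δ i)
    (horth : ∀ i j, B (δ i) (δ j) = 0) :
    LocalTubeSpanAt A S :=
  stub_kerEvalCoinvOn A S (stub_ncNodal (Rep.res S.subtype A) B hB t ht δ hδ hPL horth)

end RationalComposition

/-!
## Cycle 3 (continuation lead c2): finite orbit data, linked clusters, and the THIN BOUNDARY

Two additions to the spine.

* **Saturation** (`stub_saturation`, `stub_unimodularChain`, composition
  `injective_evalCoinv_of_connectedCluster`): the consumers of `…_of_completeOrbit` /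
  `…_of_orthogonalClusters` are stated over the (infinite) orbit `Δ`; geometrically one is handed
  FINITE data — the cycles `e(t)` of finitely many local meridians `t ∈ s₁`, their integral
  pairings, and the `⟨δ, δ'⟩ = ±1` edges of the local Dynkin diagram.  The orbit-saturation
  `Δ = ⟨s₁⟩ · e(s₁)` carries everything the consumers need, and a chain of unimodular edges puts the
  generator cycles in one orbit (`T_b T_a b = a` for `⟨a, b⟩ = 1`).  In particular two complete
  clusters LINKED by a unimodular cross pair (case 5a of the line card: non-orthogonal branches) merge
  into one complete orbit and are covered by case 2.
* **Thin boundary** (`stub_thinRep`, `stub_thinDynamics`, `stub_thinClassification`,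
  `stub_thinCocycle`, composition `exists_thinConfiguration_not_injective`): the general
  multi-orbit statement P is FALSE for integral symplectic transvection configurations.  On the
  rank-2 symplectic `ℚ`-space with `⟨δ₁, δ₂⟩ = 4`, the three transvections along
  `δ₁, δ₂, δ₃ = δ₁ + δ₂` generate a group (ping-pong with three cones: free, thin, three cusps) in
  which every element either has `g - 1` invertible or is conjugate to a power of a generator; the
  cocycle with values `0, 0, δ₃` on the generators is then undetected by every element but is not a
  coboundary (a coboundary `dx` has exponents `-B(x, δ_i)`, additive in the relation
  `δ₃ = δ₁ + δ₂`).  So LocalTubeSpan is not a consequence of "local monodromy acts by Picard–Lefschetz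
  transvections along integral vanishing cycles"; every proof must use the Janssen-completeness
  (arithmeticity) of the local vanishing configuration, and the relation `δ₁ + δ₂ - δ₃` is the
  algebraic template of an undetected visible class.
-/

section Saturation

variable {G : Type} [Group G] (A : Rep.{0} ℚ G)

/-- stub (LANDED p117319, UnimodularChain file — `localTubeSpan_exists_apply_eq_of_unimodularChain`; cycle 3, wave 1 — unimodular chains).  If the generators `t ∈ s₁` act as transvections
`x ↦ x - B(x, e_t) e_t` of an alternating form and `t, t'` are joined by a chain of generators
whose consecutive cycles pair to `±1`, then `e_{t'}` lies in the `⟨s₁⟩`-orbit of `e_t`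
(one edge: `T_b T_a (b) = a` when `B(a, b) = 1`). -/
theorem stub_unimodularChain (B : LinearMap.BilinForm ℚ A.V) (hB : B.IsAlt) (s₁ : Set G)
    (e : G → A.V) (hPL : ∀ t ∈ s₁, ∀ x : A.V, A.ρ t x = x - B x (e t) • e t) {t t' : G}
    (h : Relation.ReflTransGen
      (fun a b : G => a ∈ s₁ ∧ b ∈ s₁ ∧ (B (e a) (e b) = 1 ∨ B (e a) (e b) = -1)) t t') :
    ∃ g ∈ Subgroup.closure s₁, A.ρ g (e t) = e t' :=
  localTubeSpan_exists_apply_eq_of_unimodularChain A B hB s₁ e hPL h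

/-- stub (LANDED p117381, Saturation file — `localTubeSpan_saturation`; cycle 3, wave 1 — the orbit-saturation of finite integral data).  Generators `t ∈ s₁`
(finitely many) act as transvections of an alternating `B` along cycles `e_t` with integral
pairings and lying in ONE `⟨s₁⟩`-orbit.  Then the saturation `Δ = ⟨s₁⟩ · e(s₁)` contains the
generator cycles, lies in `ℚ e(s₁)`, has all its transvections realised in `⟨s₁⟩` (conjugates),
has `ℤΔ` finitely generated (`ℤΔ = ℤ e(s₁)` is `⟨s₁⟩`-stable by integrality), is integral,
`⟨s₁⟩`-stable and a single `⟨s₁⟩`-orbit — the orbit data consumed by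
`localTubeSpan_injective_evalCoinv_of_completeOrbit` / `…_of_orthogonalClusters`. -/
theorem stub_saturation (B : LinearMap.BilinForm ℚ A.V) (hB : B.IsAlt) (s₁ : Set G)
    (hs₁ : s₁.Finite) (e : G → A.V) (hPL : ∀ t ∈ s₁, ∀ x : A.V, A.ρ t x = x - B x (e t) • e t)
    (hint : ∀ t ∈ s₁, ∀ t' ∈ s₁, ∃ n : ℤ, B (e t) (e t') = n)
    (horb : ∀ t ∈ s₁, ∀ t' ∈ s₁, ∃ g ∈ Subgroup.closure s₁, A.ρ g (e t) = e t')
    (Δ : Set A.V) (hΔ : Δ = {x : A.V | ∃ g ∈ Subgroup.closure s₁, ∃ t ∈ s₁, A.ρ g (e t) = x}) :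
    (∀ t ∈ s₁, e t ∈ Δ) ∧
    (∀ δ ∈ Δ, δ ∈ Submodule.span ℚ (e '' s₁)) ∧
    (∀ δ ∈ Δ, ∃ g ∈ Subgroup.closure s₁, ∀ x : A.V, A.ρ g x = x - B x δ • δ) ∧
    (Submodule.span ℤ Δ).FG ∧
    (∀ δ ∈ Δ, ∀ δ' ∈ Δ, ∃ n : ℤ, B δ δ' = n) ∧
    (∀ g ∈ Subgroup.closure s₁, ∀ δ ∈ Δ, A.ρ g δ ∈ Δ) ∧
    (∀ δ ∈ Δ, ∀ δ' ∈ Δ, ∃ g ∈ Subgroup.closure s₁, A.ρ g δ = δ') :=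
  localTubeSpan_saturation A B hB s₁ hs₁ e hPL hint horb Δ hΔ

/-- COMPOSITION (cycle 3): a CONNECTED complete cluster from finite data.  `G = ⟨s⟩` (finitely
many meridians) acting by transvections of an alternating `B` along cycles with integral pairings,
whose unimodular Dynkin graph (`t ∼ t'` iff `B(e_t, e_{t'}) = ±1`) connects all of `s` and has an
edge with `B(e_{t₁}, e_{t₂}) = 1`.  Then, granting Schnell's Lemma 11, the third map is injective
(`stub_unimodularChain` + `stub_saturation` + `localTubeSpan_injective_evalCoinv_of_completeOrbit`).
Two complete clusters linked by a unimodular cross pair are such a configuration (case 5a). -/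
theorem injective_evalCoinv_of_connectedCluster (hL11 : Schnell2010_lemma11)
    [FiniteDimensional ℚ A.V] (B : LinearMap.BilinForm ℚ A.V) (hB : B.IsAlt)
    (s : Set G) (hsfin : s.Finite) (hs : Subgroup.closure s = ⊤) (e : G → A.V)
    (hPL : ∀ t ∈ s, ∀ x : A.V, A.ρ t x = x - B x (e t) • e t)
    (hint : ∀ t ∈ s, ∀ t' ∈ s, ∃ n : ℤ, B (e t) (e t') = n)
    (hconn : ∀ t ∈ s, ∀ t' ∈ s, Relation.ReflTransGen
      (fun a b : G => a ∈ s ∧ b ∈ s ∧ (B (e a) (e b) = 1 ∨ B (e a) (e b) = -1)) t t')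
    (hpair : ∃ t₁ ∈ s, ∃ t₂ ∈ s, B (e t₁) (e t₂) = 1) :
    Function.Injective (evalCoinv A) := by
  set Δ : Set A.V := {x : A.V | ∃ g ∈ Subgroup.closure s, ∃ t ∈ s, A.ρ g (e t) = x} with hΔ
  have horb : ∀ t ∈ s, ∀ t' ∈ s, ∃ g ∈ Subgroup.closure s, A.ρ g (e t) = e t' :=
    fun t ht t' ht' => stub_unimodularChain A B hB s e hPL (hconn t ht t' ht')
  obtain ⟨hes, -, hΔG, hfg, hintΔ, hstable, htrans⟩ :=
    stub_saturation A B hB s hsfin e hPL hint horb Δ hΔ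
  obtain ⟨t₁, ht₁, t₂, ht₂, h12⟩ := hpair
  refine localTubeSpan_injective_evalCoinv_of_completeOrbit A hL11 B hB Δ s hs
    (fun t ht => ⟨e t, hes t ht, hPL t ht⟩) (fun δ hδ => ?_) hfg hintΔ
    (fun g δ hδ => hstable g (by rw [hs]; exact Subgroup.mem_top g) δ hδ)
    (fun δ hδ δ' hδ' => ?_) ⟨e t₁, hes t₁ ht₁, e t₂, hes t₂ ht₂, h12⟩
  · obtain ⟨g, -, hg⟩ := hΔG δ hδ
    exact ⟨g, hg⟩
  · obtain ⟨g, -, hg⟩ := htrans δ hδ δ' hδ'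
    exact ⟨g, hg⟩

/-- COMPOSITION (cycle 3): the surrogate crux at a local group `S` carrying a connected complete
cluster given by finite data (`stub_kerEvalCoinvOn ∘ injective_evalCoinv_of_connectedCluster`). -/
theorem LocalTubeSpanAt_of_connectedCluster (hL11 : Schnell2010_lemma11)
    [FiniteDimensional ℚ A.V] (S : Subgroup G) (B : LinearMap.BilinForm ℚ A.V) (hB : B.IsAlt)
    (s : Set S) (hsfin : s.Finite) (hs : Subgroup.closure s = ⊤) (e : S → A.V)
    (hPL : ∀ t ∈ s, ∀ x : A.V, A.ρ t x = x - B x (e t) • e t)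
    (hint : ∀ t ∈ s, ∀ t' ∈ s, ∃ n : ℤ, B (e t) (e t') = n)
    (hconn : ∀ t ∈ s, ∀ t' ∈ s, Relation.ReflTransGen
      (fun a b : S => a ∈ s ∧ b ∈ s ∧ (B (e a) (e b) = 1 ∨ B (e a) (e b) = -1)) t t')
    (hpair : ∃ t₁ ∈ s, ∃ t₂ ∈ s, B (e t₁) (e t₂) = 1) :
    LocalTubeSpanAt A S :=
  stub_kerEvalCoinvOn A S (injective_evalCoinv_of_connectedCluster (Rep.res S.subtype A) hL11 B hB
    s hsfin hs e hPL hint hconn hpair)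

/-- stub (LANDED p117860, ConnectedClusters file — `localTubeSpan_injective_evalCoinv_of_connectedClusters`; cycle 3, wave 2 — orthogonal connected clusters from finite data).  The capstone
`localTubeSpan_injective_evalCoinv_of_orthogonalClusters` (finitely many pairwise ORTHOGONAL
complete clusters plus transversal nodes, from orbit data, conditional on Schnell's Lemma 11 and
Janssen's Theorem 2.9) restated over FINITE data: each cluster `s j` is a finite set of meridians
whose cycles have integral pairings and a CONNECTED unimodular Dynkin graph with an edge of pairing
`1`; distinct clusters orthogonal; node cycles non-zero and orthogonal to everything.  (Per cluster:
`stub_unimodularChain` + `stub_saturation` give the orbit data; orthogonality of the saturations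
follows by bilinearity from the orthogonality of the generator cycles, since `Δ_j ⊆ ℚ e(s_j)`.) -/
theorem stub_connectedClusters (hL11 : Schnell2010_lemma11) (h29 : Janssen1983_thm2_9)
    [FiniteDimensional ℚ A.V] (B : LinearMap.BilinForm ℚ A.V) (hB : B.Nondegenerate)
    (hBalt : B.IsAlt) {b : ℕ} (s : Fin b → Set G) (s₀ : Set G) (hsfin : ∀ j, (s j).Finite)
    (hs : Subgroup.closure (s₀ ∪ ⋃ j, s j) = ⊤)
    (e : G → A.V) (hPL : ∀ t ∈ s₀ ∪ ⋃ j, s j, ∀ x : A.V, A.ρ t x = x - B x (e t) • e t)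
    (hint : ∀ (j : Fin b), ∀ t ∈ s j, ∀ t' ∈ s j, ∃ n : ℤ, B (e t) (e t') = n)
    (hconn : ∀ (j : Fin b), ∀ t ∈ s j, ∀ t' ∈ s j, Relation.ReflTransGen
      (fun a c : G => a ∈ s j ∧ c ∈ s j ∧ (B (e a) (e c) = 1 ∨ B (e a) (e c) = -1)) t t')
    (hpair : ∀ j, ∃ t₁ ∈ s j, ∃ t₂ ∈ s j, B (e t₁) (e t₂) = 1)
    (horth : ∀ i j, i ≠ j → ∀ t ∈ s i, ∀ t' ∈ s j, B (e t) (e t') = 0)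
    (horth₀ : ∀ t ∈ s₀, ∀ t' ∈ s₀ ∪ ⋃ j, s j, B (e t) (e t') = 0) (hne₀ : ∀ t ∈ s₀, e t ≠ 0) :
    Function.Injective (evalCoinv A) :=
  localTubeSpan_injective_evalCoinv_of_connectedClusters A hL11 h29 B hB hBalt s s₀ hsfin hs e hPL hint
    hconn hpair horth horth₀ hne₀

/-- COMPOSITION (cycle 3): the surrogate crux at a local group of multi-branch type given by
finite data (`stub_kerEvalCoinvOn ∘ stub_connectedClusters`). -/
theorem LocalTubeSpanAt_of_connectedClusters (hL11 : Schnell2010_lemma11)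
    (h29 : Janssen1983_thm2_9) [FiniteDimensional ℚ A.V] (S : Subgroup G)
    (B : LinearMap.BilinForm ℚ A.V) (hB : B.Nondegenerate) (hBalt : B.IsAlt)
    {b : ℕ} (s : Fin b → Set S) (s₀ : Set S) (hsfin : ∀ j, (s j).Finite)
    (hs : Subgroup.closure (s₀ ∪ ⋃ j, s j) = ⊤)
    (e : S → A.V) (hPL : ∀ t ∈ s₀ ∪ ⋃ j, s j, ∀ x : A.V, A.ρ t x = x - B x (e t) • e t)
    (hint : ∀ (j : Fin b), ∀ t ∈ s j, ∀ t' ∈ s j, ∃ n : ℤ, B (e t) (e t') = n)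
    (hconn : ∀ (j : Fin b), ∀ t ∈ s j, ∀ t' ∈ s j, Relation.ReflTransGen
      (fun a c : S => a ∈ s j ∧ c ∈ s j ∧ (B (e a) (e c) = 1 ∨ B (e a) (e c) = -1)) t t')
    (hpair : ∀ j, ∃ t₁ ∈ s j, ∃ t₂ ∈ s j, B (e t₁) (e t₂) = 1)
    (horth : ∀ i j, i ≠ j → ∀ t ∈ s i, ∀ t' ∈ s j, B (e t) (e t') = 0)
    (horth₀ : ∀ t ∈ s₀, ∀ t' ∈ s₀ ∪ ⋃ j, s j, B (e t) (e t') = 0) (hne₀ : ∀ t ∈ s₀, e t ≠ 0) :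
    LocalTubeSpanAt A S :=
  stub_kerEvalCoinvOn A S (stub_connectedClusters (Rep.res S.subtype A) hL11 h29 B hB hBalt s s₀
    hsfin hs e hPL hint hconn hpair horth horth₀ hne₀)

end Saturation

section Thin

/-!
### The thin boundary: an integral symplectic transvection configuration with non-injective third map

Data (written out in every statement, no definitions): `V = ℚ²` (`Fin 2 → ℚ`),
`B₀(x, y) = 4(x₀y₁ - x₁y₀)` (nondegenerate, alternating), cycles `δ₁ = (1,0)`, `δ₂ = (0,1)`,
`δ₃ = (1,1) = δ₁ + δ₂`, pairings `B₀(δ₁, δ₂) = B₀(δ₁, δ₃) = 4`, `B₀(δ₂, δ₃) = -4`; the transvections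
`T_i(v) = v - B₀(v, δ_i) δ_i` are `T₁(v) = (v₀ + 4v₁, v₁)`, `T₂(v) = (v₀, v₁ - 4v₀)`,
`T₃(v) = v - 4(v₀ - v₁)(1, 1)`.  Ping-pong cones: `C₁ = {2|v₁| ≤ |v₀|}`, `C₂ = {2|v₀| ≤ |v₁|}`,
`C₃ = {4|v₀ - v₁| ≤ |v₀ + v₁|}` (pairwise meeting only in `0`; `T_i^n`, `n ≠ 0`, maps the
complement of the interior of `C_i` into `C_i`).
-/

/-- stub (LANDED p117321, ThinRep file — `localTubeSpan_exists_thinRep`; cycle 3, wave 1 — the representation).  The free group on three letters acts on `ℚ²`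
by the three transvections `T₁, T₂, T₃` (`FreeGroup.lift` into `GL₂(ℚ)`). -/
theorem stub_thinRep : ∃ ρ : Representation ℚ (FreeGroup (Fin 3)) (Fin 2 → ℚ),
    (∀ v, ρ (FreeGroup.of 0) v = ![v 0 + 4 * v 1, v 1]) ∧
    (∀ v, ρ (FreeGroup.of 1) v = ![v 0, v 1 - 4 * v 0]) ∧
    (∀ v, ρ (FreeGroup.of 2) v = ![v 0 - 4 * (v 0 - v 1), v 1 - 4 * (v 0 - v 1)]) :=
  localTubeSpan_exists_thinRep

/-- stub (LANDED p117887 (+ lemmas p117545), ThinDynamics file — `localTubeSpan_thinDynamics`; cycle 3 — THE HARDEST, lead: ping-pong dynamics).  For any group acting on `ℚ²` with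
three elements `τ i` acting as `T₁, T₂, T₃`, a CYCLICALLY REDUCED alternating product
`∏ (τ i_ℓ)^{n_ℓ}` (non-zero exponents, consecutive letters distinct, first letter ≠ last letter)
acts with `g - 1` INVERTIBLE: it maps the complement of the core of the last cone into the first
cone (ping-pong), so it is not the identity, and a unipotent would drag a vector of the third cone
into both the first cone (forward orbit) and the last cone (backward orbit), which meet only in `0`. -/
theorem stub_thinDynamics {G : Type} [Group G] (ρ : Representation ℚ G (Fin 2 → ℚ)) (τ : Fin 3 → G)
    (hτ₀ : ∀ v, ρ (τ 0) v = ![v 0 + 4 * v 1, v 1])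
    (hτ₁ : ∀ v, ρ (τ 1) v = ![v 0, v 1 - 4 * v 0])
    (hτ₂ : ∀ v, ρ (τ 2) v = ![v 0 - 4 * (v 0 - v 1), v 1 - 4 * (v 0 - v 1)])
    (L : List (Fin 3 × ℤ)) (hL0 : ∀ p ∈ L, p.2 ≠ 0) (hLc : L.IsChain (fun p q => p.1 ≠ q.1))
    (a b : Fin 3 × ℤ) (ha : L.head? = some a) (hb : L.getLast? = some b) (hab : a.1 ≠ b.1) :
    IsUnit (ρ (L.map fun p => τ p.1 ^ p.2).prod - 1) :=
  localTubeSpan_thinDynamics ρ τ hτ₀ hτ₁ hτ₂ L hL0 hLc a b ha hb hab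

/-- stub (LANDED p117436, ThinClassification file — `localTubeSpan_thinClassification`; cycle 3, wave 1 — cyclic reduction).  In a group generated by `τ 0, τ 1, τ 2` acting on
`ℚ²` such that cyclically reduced alternating products act with `g - 1` invertible, EVERY element
either acts with `g - 1` invertible or is conjugate to a power of a generator (write `g` as a
product of generator powers; merge equal neighbours, drop zero exponents, and conjugate the first
syllable to the end while the first and last letters agree — all three moves preserve the
dichotomy). -/
theorem stub_thinClassification {G : Type} [Group G] (ρ : Representation ℚ G (Fin 2 → ℚ))
    (τ : Fin 3 → G) (hgen : Subgroup.closure (Set.range τ) = ⊤)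
    (hdyn : ∀ (L : List (Fin 3 × ℤ)), (∀ p ∈ L, p.2 ≠ 0) → L.IsChain (fun p q => p.1 ≠ q.1) →
      ∀ a b : Fin 3 × ℤ, L.head? = some a → L.getLast? = some b → a.1 ≠ b.1 →
        IsUnit (ρ (L.map fun p => τ p.1 ^ p.2).prod - 1))
    (g : G) :
    IsUnit (ρ g - 1) ∨ ∃ (h : G) (i : Fin 3) (n : ℤ), g = h * τ i ^ n * h⁻¹ :=
  localTubeSpan_thinClassification ρ τ hgen hdyn g

/-- stub (LANDED p117543, ThinCocycle file — `localTubeSpan_not_injective_evalCoinv_thin`; cycle 3, wave 1 — the undetected non-coboundary).  For the free group on three letters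
acting on `ℚ²` by `T₁, T₂, T₃`, granted the dichotomy of `stub_thinClassification`, Schnell's third
map `H¹(F₃, ℚ²) → ∏_g ℚ²/(g - 1)ℚ²` is NOT injective: the cocycle with `φ(x₁) = φ(x₂) = 0`,
`φ(x₃) = δ₃ = (1, 1)` (free group: any generator values extend) is undetected by every element
(trivially where `g - 1` is invertible; by `φ(x_i^n) = n φ(x_i) ∈ ℚ δ_i = (x_i^n - 1)ℚ²` and
conjugation invariance of undetectedness elsewhere) but is not a coboundary (`dx(x₁) = dx(x₂) = 0`
forces `x = 0`). -/
theorem stub_thinCocycle (ρ : Representation ℚ (FreeGroup (Fin 3)) (Fin 2 → ℚ))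
    (hτ₀ : ∀ v, ρ (FreeGroup.of 0) v = ![v 0 + 4 * v 1, v 1])
    (hτ₁ : ∀ v, ρ (FreeGroup.of 1) v = ![v 0, v 1 - 4 * v 0])
    (hτ₂ : ∀ v, ρ (FreeGroup.of 2) v = ![v 0 - 4 * (v 0 - v 1), v 1 - 4 * (v 0 - v 1)])
    (hclass : ∀ g : FreeGroup (Fin 3), IsUnit (ρ g - 1) ∨
      ∃ (h : FreeGroup (Fin 3)) (i : Fin 3) (n : ℤ), g = h * FreeGroup.of i ^ n * h⁻¹) :
    ¬ Function.Injective (evalCoinv (Rep.of ρ)) :=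
  localTubeSpan_not_injective_evalCoinv_thin ρ hτ₀ hτ₁ hτ₂ hclass

/-- stub (LANDED p117855, RankTwoPairingTwo file — `localTubeSpan_injective_evalCoinv_rankTwoPairingTwo`; cycle 3, wave 2 — the arithmetic side of the boundary: pairing `2` is detected).  With
`⟨δ₁, δ₂⟩ = 2` instead of `4` — transvections `T₁'(v) = (v₀ + 2v₁, v₁)`, `T₂'(v) = (v₀, v₁ - 2v₀)`,
`T₃'(v) = v - 2(v₀ - v₁)(1,1)` of `B₀'(x, y) = 2(x₀y₁ - x₁y₀)` along `(1,0), (0,1), (1,1)` — the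
configuration is ARITHMETIC: `-T₃' = T₂'⁻¹ T₁'⁻¹`, so `T₃'² = (T₂'⁻¹T₁'⁻¹)²` lies in the frame group
`⟨T₁', T₂'⟩` and Schnell's frame argument (`localTubeSpan_injective_evalCoinv_of_frame_mod_bot`:
the discrepancy `τ₂² ((τ₁⁻¹τ₀⁻¹)²)⁻¹` acts trivially) shows the third map IS injective for any group
generated by three elements acting this way.  (This is why even cross pairings `±2` passed the
cycle-2 probe; the thin example needs `|⟨δ, δ'⟩| ≥ 3`.) -/
theorem stub_rankTwoPairingTwo {G : Type} [Group G] (ρ : Representation ℚ G (Fin 2 → ℚ))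
    (τ : Fin 3 → G) (hgen : Subgroup.closure (Set.range τ) = ⊤)
    (hτ₀ : ∀ v, ρ (τ 0) v = ![v 0 + 2 * v 1, v 1])
    (hτ₁ : ∀ v, ρ (τ 1) v = ![v 0, v 1 - 2 * v 0])
    (hτ₂ : ∀ v, ρ (τ 2) v = ![v 0 - 2 * (v 0 - v 1), v 1 - 2 * (v 0 - v 1)]) :
    Function.Injective (evalCoinv (Rep.of ρ)) :=
  localTubeSpan_injective_evalCoinv_rankTwoPairingTwo ρ τ hgen hτ₀ hτ₁ hτ₂

/-- REMARK (LANDED p117862, Image file — `localTubeSpan_injective_evalCoinv_iff_of_range_eq`): cyclic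
detection depends only on the IMAGE group `ρ(G) ⊆ End V` (relation erasure), so the thin
configuration below is a counterexample for every group realising its image, and LocalTubeSpan at
`s₀` is a property of the linear local monodromy group `⟨T_δ : δ ∈ Δ_loc⟩` alone. -/
theorem injective_evalCoinv_iff_of_range_eq {G G' V : Type} [Group G] [Group G'] [AddCommGroup V]
    [Module ℚ V] (ρ : Representation ℚ G V) (ρ' : Representation ℚ G' V)
    (h : Set.range ρ = Set.range ρ') :
    Function.Injective (evalCoinv (Rep.of ρ)) ↔ Function.Injective (evalCoinv (Rep.of ρ')) :=
  localTubeSpan_injective_evalCoinv_iff_of_range_eq ρ ρ' h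

/-- COMPOSITION (cycle 3, the thin boundary): there is a finitely generated group acting on a
2-dimensional `ℚ`-space through INTEGRAL symplectic transvections `x ↦ x - B(x, e_t) e_t` of a
nondegenerate alternating form along three cycles `e_{t₃} = e_{t₁} + e_{t₂}` with
`B(e_{t₁}, e_{t₂}) = 4`, whose third map `H¹(G, V) → ∏_g V/(g - 1)V` is not injective.  The general
multi-orbit statement P thus fails for transvection configurations; LocalTubeSpan needs the
Janssen-completeness of local vanishing configurations, not just their Picard–Lefschetz shape. -/
theorem exists_thinConfiguration_not_injective :
    ∃ (G : Type) (_ : Group G) (A : Rep ℚ G) (B : LinearMap.BilinForm ℚ A.V) (s : Set G)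
      (e : G → A.V), B.Nondegenerate ∧ B.IsAlt ∧ s.Finite ∧ Subgroup.closure s = ⊤ ∧
      (∀ t ∈ s, ∀ x : A.V, A.ρ t x = x - B x (e t) • e t) ∧
      (∀ t ∈ s, ∀ t' ∈ s, ∃ n : ℤ, B (e t) (e t') = n) ∧
      Module.finrank ℚ A.V = 2 ∧
      (∃ t₁ ∈ s, ∃ t₂ ∈ s, ∃ t₃ ∈ s, e t₃ = e t₁ + e t₂ ∧ B (e t₁) (e t₂) = 4) ∧
      ¬ Function.Injective (evalCoinv A) := by
  classical
  obtain ⟨ρ, h0, h1, h2⟩ := stub_thinRep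
  -- the dichotomy for the free group, from the dynamics
  have hclass := stub_thinClassification ρ FreeGroup.of (FreeGroup.closure_range_of _)
    (fun L hL0 hLc a b ha hb hab => stub_thinDynamics ρ FreeGroup.of h0 h1 h2 L hL0 hLc a b ha hb hab)
  have hthin := stub_thinCocycle ρ h0 h1 h2 hclass
  -- the data
  let d : Fin 3 → (Fin 2 → ℚ) := ![![1, 0], ![0, 1], ![1, 1]]
  have hd0 : d 0 = ![1, 0] := rfl
  have hd1 : d 1 = ![0, 1] := rfl
  have hd2 : d 2 = ![1, 1] := rfl
  let B : LinearMap.BilinForm ℚ (Fin 2 → ℚ) := Matrix.toBilin' !![(0 : ℚ), 4; -4, 0]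
  have hBapply : ∀ x y : Fin 2 → ℚ, B x y = 4 * (x 0 * y 1 - x 1 * y 0) := fun x y => by
    change Matrix.toBilin' !![(0 : ℚ), 4; -4, 0] x y = _
    rw [Matrix.toBilin'_apply']
    simp [Matrix.mulVec, dotProduct, Fin.sum_univ_two]
    ring
  let e : FreeGroup (Fin 3) → (Fin 2 → ℚ) := fun g =>
    if hg : ∃ i, FreeGroup.of i = g then d (Classical.choose hg) else 0
  have he : ∀ i, e (FreeGroup.of i) = d i := fun i => by
    have hg : ∃ j, FreeGroup.of j = FreeGroup.of i := ⟨i, rfl⟩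
    change (if hg : ∃ j, FreeGroup.of j = FreeGroup.of i then d (Classical.choose hg) else 0) = d i
    rw [dif_pos hg, FreeGroup.of_injective (Classical.choose_spec hg)]
  refine ⟨FreeGroup (Fin 3), inferInstance, Rep.of ρ, B, Set.range FreeGroup.of, e, ?_, ?_,
    Set.finite_range _, FreeGroup.closure_range_of _, ?_, ?_, Module.finrank_fin_fun ℚ, ?_, hthin⟩
  · -- nondegenerate: `det = 16`
    refine LinearMap.BilinForm.nondegenerate_toBilin'_iff_det_ne_zero.2 ?_
    rw [Matrix.det_fin_two_of]
    norm_num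
  · -- alternating
    intro x
    rw [hBapply]
    ring
  · -- the generators act as the transvections along `d i`
    have key : ∀ (i : Fin 3) (x : Fin 2 → ℚ), ρ (FreeGroup.of i) x = x - B x (d i) • d i := by
      intro i x
      rw [hBapply]
      match i with
      | 0 => rw [h0, hd0]; ext j; fin_cases j <;> simp
      | 1 => rw [h1, hd1]; ext j; fin_cases j <;> simp
      | 2 => rw [h2, hd2]; ext j; fin_cases j <;> simp
    rintro _ ⟨i, rfl⟩ x
    rw [he]
    exact key i x
  · -- integral pairings (`0, ±4`)
    have key : ∀ i j : Fin 3, ∃ n : ℤ, B (d i) (d j) = n := by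
      intro i j
      rw [hBapply]
      match i, j with
      | 0, 0 => exact ⟨0, by norm_num [hd0]⟩
      | 0, 1 => exact ⟨4, by norm_num [hd0, hd1]⟩
      | 0, 2 => exact ⟨4, by norm_num [hd0, hd2]⟩
      | 1, 0 => exact ⟨-4, by norm_num [hd0, hd1]⟩
      | 1, 1 => exact ⟨0, by norm_num [hd1]⟩
      | 1, 2 => exact ⟨-4, by norm_num [hd1, hd2]⟩
      | 2, 0 => exact ⟨-4, by norm_num [hd0, hd2]⟩
      | 2, 1 => exact ⟨4, by norm_num [hd1, hd2]⟩
      | 2, 2 => exact ⟨0, by norm_num [hd2]⟩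
    rintro _ ⟨i, rfl⟩ _ ⟨j, rfl⟩
    rw [he, he]
    exact key i j
  · refine ⟨FreeGroup.of 0, ⟨0, rfl⟩, FreeGroup.of 1, ⟨1, rfl⟩, FreeGroup.of 2, ⟨2, rfl⟩, ?_, ?_⟩
    · rw [he, he, he, hd0, hd1, hd2]; ext j; fin_cases j <;> simp
    · rw [he, he, hBapply, hd0, hd1]; norm_num

end Thin

/-!
## Cycle 4 (continuation lead c3): PORTABILITY of cyclic detection — base change, finite index, direct sums

The line's theorems are over `ℚ` (`Rep ℚ G`, alternating `ℚ`-forms, integral pairings), and they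
must be (cycle 3: the thin boundary shows nothing survives without the arithmetic of the lattice);
the tree's hyperplane-section package (`HyperplaneSectionLocalSystem`, `vanishingLocalSystem`,
`monodromyRepObj`) carries its local systems over `ℂ` with a fibrewise `ℚ`-structure
(`IsRationalClass`, `ofRatClassBaseChangeEquiv : ℂ ⊗_ℚ Hᵏ(X; ℚ) ≃ Hᵏ(X; ℂ)`).  The crux NOTES
(cycle-3 addendum, "the BASE-CHANGE GAP") therefore ask for ONE more algebraic layer before any
typed crux can be concluded from the spine: cyclic detection (injectivity of Schnell's third map)
must be PORTABLE —

* along extension of scalars `k → K` (`stub_retract` down, `stub_coordinatesUp` up, the data from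
  Mathlib's `IsBaseChange` by `stub_baseChangeRetraction` / `stub_baseChangeCoordinates`, the
  finiteness input `stub_finiteWitness`; compositions `injective_evalCoinv_iff_of_isBaseChange`,
  `injective_evalCoinv_iff_of_tensorEquiv`, `LocalTubeSpanAt_of_tensorEquiv`).  NOTE the
  hypothesis that makes the ascent work is finite-dimensionality of `V` over `k` (so that the
  invariants `V^G` are cut out by finitely many group elements), NOT finite generation of `G`:
  an undetected `K`-cocycle decomposes along a `k`-basis of `K` into undetected `k`-cocycles
  `φ_j = d x_j`, and only finitely many `φ_j` can be non-zero because each non-zero one moves a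
  vector off `V^G`, which finitely many elements witness;
* from finite-index subgroups (`stub_finiteIndexAscent`: for `[G : H]` invertible in `k` the
  restriction `H¹(G, V) → H¹(H, V)` is injective by averaging over cosets, so detection on `H`
  gives detection on `G` — pure local braid groups inside local braid groups, subgroups generated
  by powers of meridians);
* between complementary stable summands (`stub_directSum`: `V = W₁ ⊕ W₂` both `G`-stable —
  `H^{2p-1}(X_s) = H^{2p-1}(X_s)_van ⊕ i^*H^{2p-1}(X)` with trivial action on the second summand,
  the two carriers `monodromyBetti` / `vanishingMonodromy` the typed package offers).
-/

section Portability

universe w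

variable {k K G : Type u} [Group G]

/-- stub (LANDED p119332, Retract file — `localTubeSpan_injective_evalCoinv_of_retract`; cycle 4, wave 1 — detection DESCENDS along an equivariant retraction; any two coefficient
rings).  If `i : A → A'` is an additive `G`-map with an additive `G`-equivariant retraction `P`
(`P ∘ i = id`) — e.g. `A' = K ⊗_k A` with `P = r ⊗ id` for a `k`-linear retraction `r : K → k`, or
`A` a stable direct summand of `A'` — then injectivity of Schnell's third map for `A'` implies it
for `A`: an undetected cocycle `φ` of `A` pushes to the undetected cocycle `i ∘ φ = d x'` of `A'`,
and `φ = P ∘ i ∘ φ = d (P x')`. -/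
theorem stub_retract [CommRing k] [CommRing K] (A : Rep k G) (A' : Rep K G)
    (i : A.V →+ A'.V) (hi : ∀ (g : G) (x : A.V), i (A.ρ g x) = A'.ρ g (i x))
    (P : A'.V →+ A.V) (hP : ∀ (g : G) (x' : A'.V), P (A'.ρ g x') = A.ρ g (P x'))
    (hPi : ∀ x : A.V, P (i x) = x) (hinj : Function.Injective (evalCoinv A')) :
    Function.Injective (evalCoinv A) :=
  localTubeSpan_injective_evalCoinv_of_retract A A' i hi P hP hPi hinj

/-- stub (LANDED p119398, CoordinatesUp file — `localTubeSpan_injective_evalCoinv_of_coordinates`; cycle 4, wave 1 — detection ASCENDS along equivariant coordinates).  Let `i : A → A'` be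
an additive `G`-map (`A` over `k`, `A'` over `K`) and let `π_j : A' → A` (`j ∈ J`) be additive
`G`-equivariant "coordinates" with scalars `b_j ∈ K`: every `x'` has finitely many non-zero
coordinates and `x' = Σ_j b_j • i (π_j x')` (the sum over any finite set carrying the support) —
e.g. `A' = K ⊗_k A`, `b` a `k`-basis of `K`, `π_j = b_j^* ⊗ id`.  Suppose the invariants of `A`
are witnessed by a finite set `F ⊆ G` (`stub_finiteWitness`).  Then injectivity of Schnell's third
map for `A` implies it for `A'`: an undetected `φ'` has undetected coordinates `φ_j = π_j ∘ φ'`,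
each a coboundary `d x_j` by hypothesis; for `j` outside the finite set
`J₀ = ⋃_{g ∈ F} supp π_•(φ' g)` the cocycle `φ_j` vanishes on `F`, so `x_j` is `F`-invariant,
hence `G`-invariant, hence `φ_j = 0` and we may take `x_j = 0`; then
`φ' = d (Σ_{j ∈ J₀} b_j • i x_j)`. -/
theorem stub_coordinatesUp [CommRing k] [CommRing K] (A : Rep k G) (A' : Rep K G)
    (i : A.V →+ A'.V) (hi : ∀ (g : G) (x : A.V), i (A.ρ g x) = A'.ρ g (i x))
    {J : Type v} (b : J → K) (π : J → (A'.V →+ A.V))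
    (hπ : ∀ (j : J) (g : G) (x' : A'.V), π j (A'.ρ g x') = A.ρ g (π j x'))
    (hfin : ∀ x' : A'.V, (Function.support fun j => π j x').Finite)
    (hrec : ∀ (x' : A'.V) (T : Finset J), (∀ j ∉ T, π j x' = 0) →
      x' = ∑ j ∈ T, b j • i (π j x'))
    (F : Finset G) (hF : ∀ x : A.V, (∀ g ∈ F, A.ρ g x = x) → ∀ g : G, A.ρ g x = x)
    (hinj : Function.Injective (evalCoinv A)) :
    Function.Injective (evalCoinv A') :=
  localTubeSpan_injective_evalCoinv_of_coordinates A A' i hi b π hπ hfin hrec F hF hinj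

/-- stub (LANDED p119359, FiniteWitness file — `localTubeSpan_exists_finset_fixed_imp_fixed`; cycle 4, wave 1 — invariants are witnessed by finitely many elements).  For a
finite-dimensional representation there is a finite set `F ⊆ G` such that every vector fixed by
`F` is fixed by `G` (`V^G = ⋂_g ker (g - 1)` is attained by a finite sub-intersection: take `F`
minimising `dim ⋂_{g ∈ F} ker (g - 1)`).  This — not finite generation of `G` — is the finiteness
the ascent `stub_coordinatesUp` consumes. -/
theorem stub_finiteWitness [Field k] (A : Rep k G) [FiniteDimensional k A.V] :
    ∃ F : Finset G, ∀ x : A.V, (∀ g ∈ F, A.ρ g x = x) → ∀ g : G, A.ρ g x = x :=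
  localTubeSpan_exists_finset_fixed_imp_fixed A

/-- stub (LANDED p119361, BaseChangeRetraction file — `localTubeSpan_exists_retraction_of_isBaseChange`; cycle 4, wave 1 — the retraction of a base change).  For a field `k`, a non-trivial
commutative `k`-algebra `K` and a base change `i : V → V'` (`IsBaseChange K i`, i.e.
`K ⊗_k V ≃ V'`, `c ⊗ x ↦ c • i x`), there is a `k`-linear retraction `P` of `i` that is NATURAL
for every compatible pair (`f : V → V` `k`-linear, `f' : V' → V'` `K`-linear, `f' ∘ i = i ∘ f`):
`P ∘ f' = f ∘ P`.  (Take a `k`-linear `r : K → k` with `r 1 = 1` and `P = (r ⊗ id) ∘ e⁻¹`; a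
compatible `f'` is `e ∘ (id ⊗ f) ∘ e⁻¹`.)  With `f = ρ(g)`, `f' = ρ'(g)` this is the input of
`stub_retract`. -/
theorem stub_baseChangeRetraction [Field k] [CommRing K] [Nontrivial K] [Algebra k K]
    {V : Type v} [AddCommGroup V] [Module k V]
    {V' : Type w} [AddCommGroup V'] [Module k V'] [Module K V'] [IsScalarTower k K V']
    (i : V →ₗ[k] V') (hi : IsBaseChange K i) :
    ∃ P : V' →ₗ[k] V, (∀ x : V, P (i x) = x) ∧
      ∀ (f : V →ₗ[k] V) (f' : V' →ₗ[K] V'), (∀ x : V, i (f x) = f' (i x)) →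
        ∀ x' : V', P (f' x') = f (P x') :=
  localTubeSpan_exists_retraction_of_isBaseChange i hi

/-- stub (p119585, BaseChangeCoordinates file — `localTubeSpan_exists_coordinates_of_isBaseChange`; cycle 4 — THE HARDEST, lead: the coordinates of a base change).  For a field `k`, a
commutative `k`-algebra `K` and a base change `i : V → V'` (`IsBaseChange K i`), there are scalars
`b_j ∈ K` (a `k`-basis of `K`) and `k`-linear coordinates `π_j : V' → V` such that every `x'` has
finitely many non-zero coordinates, `x' = Σ_{j ∈ T} b_j • i (π_j x')` for every finite `T`
carrying them, and the `π_j` are NATURAL for every compatible pair (`f' ∘ i = i ∘ f` ⇒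
`π_j ∘ f' = f ∘ π_j`).  (`π_j = (b_j^* ⊗ id) ∘ e⁻¹` for the equivalence `e : K ⊗_k V ≃ V'`.)  With
`f = ρ(g)`, `f' = ρ'(g)` this is the input of `stub_coordinatesUp`. -/
theorem stub_baseChangeCoordinates [Field k] [CommRing K] [Algebra k K]
    {V : Type v} [AddCommGroup V] [Module k V]
    {V' : Type w} [AddCommGroup V'] [Module k V'] [Module K V'] [IsScalarTower k K V']
    (i : V →ₗ[k] V') (hi : IsBaseChange K i) :
    ∃ (J : Type u) (b : J → K) (π : J → (V' →ₗ[k] V)),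
      (∀ x' : V', (Function.support fun j => π j x').Finite) ∧
      (∀ (x' : V') (T : Finset J), (∀ j ∉ T, π j x' = 0) →
        x' = ∑ j ∈ T, b j • i (π j x')) ∧
      ∀ (f : V →ₗ[k] V) (f' : V' →ₗ[K] V'), (∀ x : V, i (f x) = f' (i x)) →
        ∀ (j : J) (x' : V'), π j (f' x') = f (π j x') :=
  localTubeSpan_exists_coordinates_of_isBaseChange i hi

/-- stub (LANDED p119511, FiniteIndex file — `localTubeSpan_injective_evalCoinv_of_finiteIndex`, with the stronger `localTubeSpan_H1res_injective_of_finiteIndex`; cycle 4, wave 1 — detection ASCENDS from finite-index subgroups).  For a subgroup `H` of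
finite index invertible in the field `k`, the restriction `H¹(G, A) → H¹(H, A)` is injective
(a cocycle that is a coboundary on `H` is, after subtracting it, constant on the cosets `gH`, and
then equals `d(-y)` for the average `y` of its values over `G/H`); hence if Schnell's third map of
`A|_H` is injective, so is that of `A` (an undetected class restricts to an undetected class). -/
theorem stub_finiteIndexAscent [Field k] (A : Rep k G) (H : Subgroup G) [H.FiniteIndex]
    (hn : (H.index : k) ≠ 0)
    (hinj : Function.Injective (evalCoinv (Rep.res H.subtype A))) :
    Function.Injective (evalCoinv A) :=
  localTubeSpan_injective_evalCoinv_of_finiteIndex A H hn hinj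

/-- stub (LANDED p119536, DirectSum file — `localTubeSpan_injective_evalCoinv_iff_of_isCompl`; cycle 4, wave 1 — complementary stable summands).  If `A = W₁ ⊕ W₂` with both summands
`G`-stable, Schnell's third map of `A` is injective iff those of `W₁` and `W₂` are
(`H¹(G, W₁ ⊕ W₂) = H¹(G, W₁) ⊕ H¹(G, W₂)` and `(g - 1)(W₁ ⊕ W₂) = (g - 1)W₁ ⊕ (g - 1)W₂`:
project an undetected cocycle to the summands; conversely a summand is an equivariant retract).
With `W₂ = i^* H^{2p-1}(X)` (trivial action, where detection is automatic) this moves between the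
full cohomology of the smooth member and its vanishing part. -/
theorem stub_directSum [CommRing k] (A : Rep k G) (W₁ W₂ : Submodule k A.V)
    (h₁ : ∀ g : G, W₁ ≤ W₁.comap (A.ρ g)) (h₂ : ∀ g : G, W₂ ≤ W₂.comap (A.ρ g))
    (hc : IsCompl W₁ W₂) :
    Function.Injective (evalCoinv A) ↔
      Function.Injective (evalCoinv (Rep.of (A.ρ.subrepresentation W₁ h₁))) ∧
        Function.Injective (evalCoinv (Rep.of (A.ρ.subrepresentation W₂ h₂))) :=
  localTubeSpan_injective_evalCoinv_iff_of_isCompl A W₁ W₂ h₁ h₂ hc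

/-- COMPOSITION (cycle 4 — BASE CHANGE; landed as `localTubeSpan_injective_evalCoinv_iff_of_isBaseChange`, file `…BaseChange`, p119960).  For a field `k`, a non-trivial commutative `k`-algebra
`K`, a finite-dimensional `k`-representation `A` of ANY group `G` and a `K`-representation `A'`
that is a base change of `A` along an equivariant `i` (`IsBaseChange K i`), Schnell's third map
is injective for `A` iff it is for `A'`.  (`⇒`: `stub_baseChangeCoordinates` + `stub_finiteWitness`
+ `stub_coordinatesUp`; `⇐`: `stub_baseChangeRetraction` + `stub_retract`.) -/
theorem injective_evalCoinv_iff_of_isBaseChange [Field k] [CommRing K] [Nontrivial K]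
    [Algebra k K] (A : Rep k G) [FiniteDimensional k A.V] (A' : Rep K G) [Module k A'.V]
    [IsScalarTower k K A'.V] (i : A.V →ₗ[k] A'.V) (hi : IsBaseChange K i)
    (hiG : ∀ (g : G) (x : A.V), i (A.ρ g x) = A'.ρ g (i x)) :
    Function.Injective (evalCoinv A) ↔ Function.Injective (evalCoinv A') := by
  -- the additive shadows of the `k`-linear data (the stubs are stated for additive maps)
  have hiG' : ∀ (g : G) (x : A.V), i.toAddMonoidHom (A.ρ g x) = A'.ρ g (i.toAddMonoidHom x) :=
    fun g x => by simpa only [LinearMap.toAddMonoidHom_coe] using hiG g x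
  constructor
  · intro hinj
    obtain ⟨J, b, π, hfin, hrec, hnat⟩ := stub_baseChangeCoordinates (K := K) i hi
    obtain ⟨F, hF⟩ := stub_finiteWitness A
    have hπ' : ∀ (j : J) (g : G) (x' : A'.V),
        (π j).toAddMonoidHom (A'.ρ g x') = A.ρ g ((π j).toAddMonoidHom x') :=
      fun j g x' => by
        simpa only [LinearMap.toAddMonoidHom_coe] using hnat (A.ρ g) (A'.ρ g) (hiG g) j x'
    have hfin' : ∀ x' : A'.V, (Function.support fun j => (π j).toAddMonoidHom x').Finite :=
      fun x' => by simpa only [LinearMap.toAddMonoidHom_coe] using hfin x'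
    have hrec' : ∀ (x' : A'.V) (T : Finset J), (∀ j ∉ T, (π j).toAddMonoidHom x' = 0) →
        x' = ∑ j ∈ T, b j • i.toAddMonoidHom ((π j).toAddMonoidHom x') :=
      fun x' T hT => by
        simp only [LinearMap.toAddMonoidHom_coe] at hT ⊢
        exact hrec x' T hT
    exact stub_coordinatesUp A A' i.toAddMonoidHom hiG' b (fun j => (π j).toAddMonoidHom)
      hπ' hfin' hrec' F hF hinj
  · intro hinj
    obtain ⟨P, hPi, hnat⟩ := stub_baseChangeRetraction (K := K) i hi
    have hP' : ∀ (g : G) (x' : A'.V), P.toAddMonoidHom (A'.ρ g x') = A.ρ g (P.toAddMonoidHom x') :=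
      fun g x' => by
        simpa only [LinearMap.toAddMonoidHom_coe] using hnat (A.ρ g) (A'.ρ g) (hiG g) x'
    have hPi' : ∀ x : A.V, P.toAddMonoidHom (i.toAddMonoidHom x) = x := fun x => by
      simpa only [LinearMap.toAddMonoidHom_coe] using hPi x
    exact stub_retract A A' i.toAddMonoidHom hiG' P.toAddMonoidHom hP' hPi' hinj

open scoped TensorProduct in
/-- COMPOSITION (cycle 4 — BASE CHANGE, tensor form; the shape of the tree's complexification
`ofRatClassBaseChangeEquiv : ℂ ⊗_ℚ Hᵏ(X; ℚ) ≃ₗ[ℂ] Hᵏ(X; ℂ)`).  If `e : K ⊗_k A ≃ A'` is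
`K`-linear and intertwines `id ⊗ ρ(g)` with `ρ'(g)`, then Schnell's third map is injective for
the finite-dimensional `k`-representation `A` iff it is for the `K`-representation `A'` — for ANY
group `G` (no finite generation).  So every injectivity theorem of the `ℚ`-spine holds verbatim for
the complexified monodromy representation of a typed crux. -/
theorem injective_evalCoinv_iff_of_tensorEquiv [Field k] [CommRing K] [Nontrivial K]
    [Algebra k K] (A : Rep k G) [FiniteDimensional k A.V] (A' : Rep K G)
    (e : K ⊗[k] A.V ≃ₗ[K] A'.V)
    (he : ∀ (g : G) (c : K) (x : A.V), e (c ⊗ₜ A.ρ g x) = A'.ρ g (e (c ⊗ₜ x))) :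
    Function.Injective (evalCoinv A) ↔ Function.Injective (evalCoinv A') := by
  letI : Module k A'.V := Module.compHom A'.V (algebraMap k K)
  haveI : IsScalarTower k K A'.V :=
    ⟨fun c d x => show ((c • d) • x : A'.V) = algebraMap k K c • (d • x) by
      rw [Algebra.smul_def, mul_smul]⟩
  let i : A.V →ₗ[k] A'.V :=
    (e.restrictScalars k).toLinearMap ∘ₗ TensorProduct.mk k K A.V 1
  have hi_apply : ∀ x, i x = e (1 ⊗ₜ x) := fun x => rfl
  have hi : IsBaseChange K i := IsBaseChange.of_equiv e fun x => (hi_apply x).symm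
  have hiG : ∀ (g : G) (x : A.V), i (A.ρ g x) = A'.ρ g (i x) := fun g x => by
    rw [hi_apply, hi_apply, ← he g 1 x]
  exact injective_evalCoinv_iff_of_isBaseChange A A' i hi hiG

open scoped TensorProduct in
/-- COMPOSITION (cycle 4): the surrogate crux over `K` (e.g. `ℂ`) at a local group `S` from
injectivity of the third map of the `k`-form (e.g. `ℚ`) restricted to `S`
(`stub_kerEvalCoinvOn ∘ injective_evalCoinv_iff_of_tensorEquiv` for `A|_S`, `A'|_S`). -/
theorem LocalTubeSpanAt_of_tensorEquiv [Field k] [CommRing K] [Nontrivial K]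
    [Algebra k K] (A : Rep k G) [FiniteDimensional k A.V] (A' : Rep K G)
    (e : K ⊗[k] A.V ≃ₗ[K] A'.V)
    (he : ∀ (g : G) (c : K) (x : A.V), e (c ⊗ₜ A.ρ g x) = A'.ρ g (e (c ⊗ₜ x)))
    (S : Subgroup G) (hinj : Function.Injective (evalCoinv (Rep.res S.subtype A))) :
    LocalTubeSpanAt A' S :=
  stub_kerEvalCoinvOn A' S
    ((injective_evalCoinv_iff_of_tensorEquiv (Rep.res S.subtype A) (Rep.res S.subtype A') e
      (fun g c x => he g c x)).1 hinj)

/-- COMPOSITION (cycle 4): the surrogate crux at a local group `S` from injectivity of the third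
map on a finite-index subgroup `H ≤ S` (index invertible in `k`)
(`stub_kerEvalCoinvOn ∘ stub_finiteIndexAscent`). -/
theorem LocalTubeSpanAt_of_finiteIndex [Field k] (A : Rep k G) (S : Subgroup G)
    (H : Subgroup S) [H.FiniteIndex] (hn : (H.index : k) ≠ 0)
    (hinj : Function.Injective (evalCoinv (Rep.res H.subtype (Rep.res S.subtype A)))) :
    LocalTubeSpanAt A S :=
  stub_kerEvalCoinvOn A S (stub_finiteIndexAscent (Rep.res S.subtype A) H hn hinj)

/-- COROLLARY (cycle 4): detection is automatic for a TRIVIAL representation (`(g - 1)A = 0`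
forces an undetected cocycle to vanish). -/
theorem injective_evalCoinv_of_isTrivial [CommRing k] (A : Rep k G) [A.ρ.IsTrivial] :
    Function.Injective (evalCoinv A) := by
  refine (injective_iff_map_eq_zero _).2 fun ξ hξ => ?_
  have h := localTubeSpan_mem_H1resKer_of_evalCoinv_eq_zero A ⊤
    (fun g _ v => Representation.isTrivial_apply A.ρ g v) hξ
  rwa [H1resKer_top, Submodule.mem_bot] at h

/-- COMPOSITION (cycle 4): with a stable complement on which `G` acts TRIVIALLY (the invariant
part `i^*H^{2p-1}(X)` next to the vanishing cohomology), detection for `A` is equivalent to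
detection for the summand `W₁` (`stub_directSum` + `injective_evalCoinv_of_isTrivial`). -/
theorem injective_evalCoinv_iff_of_trivialComplement [CommRing k] (A : Rep k G)
    (W₁ W₂ : Submodule k A.V) (h₁ : ∀ g : G, W₁ ≤ W₁.comap (A.ρ g))
    (h₂ : ∀ (g : G), ∀ w ∈ W₂, A.ρ g w = w) (hc : IsCompl W₁ W₂) :
    Function.Injective (evalCoinv A) ↔
      Function.Injective (evalCoinv (Rep.of (A.ρ.subrepresentation W₁ h₁))) := by
  have h₂' : ∀ g : G, W₂ ≤ W₂.comap (A.ρ g) := fun g w hw => by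
    rw [Submodule.mem_comap, h₂ g w hw]; exact hw
  haveI : (Rep.of (A.ρ.subrepresentation W₂ h₂')).ρ.IsTrivial :=
    ⟨fun g => LinearMap.ext fun w => Subtype.ext (h₂ g w w.2)⟩
  rw [stub_directSum A W₁ W₂ h₁ h₂' hc]
  exact ⟨fun h => h.1, fun h => ⟨h, injective_evalCoinv_of_isTrivial _⟩⟩

end Portability

/-!
## Cycle 4, wave 2 (continuation lead c3): the isolated point UNCONDITIONALLY, the pairing-3 correction, typed glue

* `stub_distinguishedBasis` — **the isolated-singularity case without named facts.**  If the local
  group is generated by finitely many meridians `t_i` acting as transvections along LINEARLY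
  INDEPENDENT cycles `δ_i` (a distinguished basis of the Milnor lattice: Brieskorn–Gabrielov — the
  local fundamental group of the discriminant complement of an isolated hypersurface singularity is
  generated by `μ` meridians of a generic local pencil whose vanishing cycles form a distinguished
  BASIS) and no `δ_i` is orthogonal to all the others (connected Dynkin diagram: one singular
  point, not a node), then Schnell's third map is injective — by `stub_radicalCore` with the
  generators themselves as the frame (`m = 1`), so NEITHER `Schnell2010_lemma11` NOR
  `Janssen1983_thm2_9` is needed.  Lemma 11 enters only when the generating meridians' cycles are
  linearly DEPENDENT (the global pencil; non-isolated members; extra nodes).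
* `stub_rankTwoPairingThree` (lead) — CORRECTION of the cycle-3 remark "the thin regime starts at
  `|⟨δ, δ'⟩| = 3`": for the triangle `δ₁, δ₂, δ₁ + δ₂` with `⟨δ₁, δ₂⟩ = 3` the third map IS
  injective, by a THIRD detection mechanism (neither a finite-index frame — `⟨T₁, T₂⟩` is thin —
  nor normal-crossing rank drop): the product word `τ₂ τ₀ τ₁` is a unipotent at a "fourth cusp"
  (the configuration generates the arithmetic group `Γ(3)`, four cusps, `S₃(Γ(3)) = 0`), and
  undetectedness there is exactly the coboundary condition `a₂ = a₀ + a₁`.  Exact computation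
  (item evidence `mu_triangle.py`): undetected values modulo coboundaries have dimension `0` for
  `μ = 1, 2, 3` (detecting words of length `≤ 6`) and `1` for `μ = 4, 5, 6` up to word length 6
  (`μ = 4` is the landed thin boundary; the same three-cone ping-pong works for every `μ ≥ 4`).
* `stub_rankTwoPairingOne` — `μ = 1` (the cusp `A₂`: `T_{δ₁+δ₂} = T₁ T₂ T₁⁻¹`, frame argument).
* `stub_localKernelOfBalls` — typed glue over `LocallyTrivialExtensionClasses`: the surrogate at
  all small open balls (`LocalTubeSpanCFreeBalls` shape) implies the colimit form
  (`LocalTubeSpanCFree` shape: undetected near `t₀` ⇒ in `localKernel`).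
-/

section IsolatedPoint

variable {G : Type} [Group G] (A : Rep.{0} ℚ G)

/-- stub (LANDED p120169, DistinguishedBasis file — `localTubeSpan_injective_evalCoinv_of_distinguishedBasis`; cycle 4, wave 2 — the isolated singular point, UNCONDITIONALLY).  `G` generated by
finitely many elements `t_i` acting as transvections `x ↦ x - B(x, δ_i) δ_i` of an alternating
form along LINEARLY INDEPENDENT cycles `δ_i`, none orthogonal to all the others.  Then Schnell's
third map `H¹(G, V) → ∏_g V/(g - 1)V` is injective (the ambient `V ⊇ L = ℚδ` arbitrary, the
form on `L` possibly degenerate).  Proof: `stub_radicalCore` with `Δ = {δ_i}`, frame `u = t`,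
`m = 1`; `δ_i ∉ rad L` iff some `B(δ_i, δ_j) ≠ 0`. -/
theorem stub_distinguishedBasis [FiniteDimensional ℚ A.V]
    (B : LinearMap.BilinForm ℚ A.V) (hB : B.IsAlt) {r : ℕ} (t : Fin r → G)
    (ht : Subgroup.closure (Set.range t) = ⊤) (δ : Fin r → A.V) (hli : LinearIndependent ℚ δ)
    (hPL : ∀ (i : Fin r) (x : A.V), A.ρ (t i) x = x - B x (δ i) • δ i)
    (hconn : ∀ i : Fin r, ∃ j : Fin r, B (δ i) (δ j) ≠ 0) :
    Function.Injective (evalCoinv A) :=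
  localTubeSpan_injective_evalCoinv_of_distinguishedBasis A B hB t ht δ hli hPL hconn

/-- COMPOSITION (cycle 4, wave 2): the surrogate crux at a local group `S` presented by a
distinguished basis of meridians (`stub_kerEvalCoinvOn ∘ stub_distinguishedBasis`) — the local
Schnell theorem at an isolated non-nodal singular point, with no named fact. -/
theorem LocalTubeSpanAt_of_distinguishedBasis [FiniteDimensional ℚ A.V] (S : Subgroup G)
    (B : LinearMap.BilinForm ℚ A.V) (hB : B.IsAlt) {r : ℕ} (t : Fin r → S)
    (ht : Subgroup.closure (Set.range t) = ⊤) (δ : Fin r → A.V) (hli : LinearIndependent ℚ δ)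
    (hPL : ∀ (i : Fin r) (x : A.V), A.ρ (t i) x = x - B x (δ i) • δ i)
    (hconn : ∀ i : Fin r, ∃ j : Fin r, B (δ i) (δ j) ≠ 0) :
    LocalTubeSpanAt A S :=
  stub_kerEvalCoinvOn A S
    (stub_distinguishedBasis (Rep.res S.subtype A) B hB t ht δ hli hPL hconn)

end IsolatedPoint

section PairingThree

/-- stub (p120213, RankTwoPairingThree file — `localTubeSpan_injective_evalCoinv_rankTwoPairingThree`; cycle 4, wave 2 — THE HARDEST, lead: pairing `3` is detected by a product word).  For
any group generated by three elements acting on `ℚ²` as the transvections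
`T₁(v) = (v₀ + 3v₁, v₁)`, `T₂(v) = (v₀, v₁ - 3v₀)`, `T₃(v) = v - 3(v₀ - v₁)(1, 1)` of
`B₀(x, y) = 3(x₀y₁ - x₁y₀)` along `(1,0), (0,1), (1,1)`, Schnell's third map is injective: an
undetected cocycle has `φ(τ_i) = a_i δ_i`, and undetectedness at the unipotent WORD `τ₂ τ₀ τ₁`
(fixed direction `(1, 2)`, a fourth cusp of `Γ(3)`) forces `a₂ = a₀ + a₁`, which is exactly the
condition for `φ` to be the coboundary of `x = (-a₁/3, a₀/3)` on the generators. -/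
theorem stub_rankTwoPairingThree {G : Type} [Group G] (ρ : Representation ℚ G (Fin 2 → ℚ))
    (τ : Fin 3 → G) (hgen : Subgroup.closure (Set.range τ) = ⊤)
    (hτ₀ : ∀ v, ρ (τ 0) v = ![v 0 + 3 * v 1, v 1])
    (hτ₁ : ∀ v, ρ (τ 1) v = ![v 0, v 1 - 3 * v 0])
    (hτ₂ : ∀ v, ρ (τ 2) v = ![v 0 - 3 * (v 0 - v 1), v 1 - 3 * (v 0 - v 1)]) :
    Function.Injective (evalCoinv (Rep.of ρ)) :=
  localTubeSpan_injective_evalCoinv_rankTwoPairingThree ρ τ hgen hτ₀ hτ₁ hτ₂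

/-- stub (LANDED p120182, RankTwoPairingOne file — `localTubeSpan_injective_evalCoinv_rankTwoPairingOne`; cycle 4, wave 2 — pairing `1`, the cusp `A₂`).  For any group generated by three
elements acting on `ℚ²` as `T₁(v) = (v₀ + v₁, v₁)`, `T₂(v) = (v₀, v₁ - v₀)`,
`T₃(v) = v - (v₀ - v₁)(1, 1)` (transvections of the standard symplectic form along
`(1,0), (0,1), (1,1)`), Schnell's third map is injective: `T₃ = T₁ T₂ T₁⁻¹` (braid relation), so
the discrepancy `τ₂ (τ₀ τ₁ τ₀⁻¹)⁻¹` acts trivially and the frame argument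
(`localTubeSpan_injective_evalCoinv_of_frame_mod_bot`, as for pairing `2`) applies. -/
theorem stub_rankTwoPairingOne {G : Type} [Group G] (ρ : Representation ℚ G (Fin 2 → ℚ))
    (τ : Fin 3 → G) (hgen : Subgroup.closure (Set.range τ) = ⊤)
    (hτ₀ : ∀ v, ρ (τ 0) v = ![v 0 + v 1, v 1])
    (hτ₁ : ∀ v, ρ (τ 1) v = ![v 0, v 1 - v 0])
    (hτ₂ : ∀ v, ρ (τ 2) v = ![v 0 - (v 0 - v 1), v 1 - (v 0 - v 1)]) :
    Function.Injective (evalCoinv (Rep.of ρ)) :=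
  localTubeSpan_injective_evalCoinv_rankTwoPairingOne ρ τ hgen hτ₀ hτ₁ hτ₂

end PairingThree

section TypedGlue

open _root_.Topology Filter

variable {k S : Type u} [CommRing k] [TopologicalSpace S] {T : Type v} [TopologicalSpace T]
  (ι : C(S, T)) (V : Literature.AlgebraicGeometry.Motives.LocalSystem k S) (s : S)

/-- stub (LANDED p120174, LocalKernelOfBalls file — `localTubeSpan_mem_localKernel_of_balls`; cycle 4, wave 2 — typed glue: balls form ⇒ colimit form).  If the surrogate holds at
the local subgroups of all sufficiently small OPEN neighbourhoods of `t₀` (the shape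
`LocalTubeSpanCFreeBalls` of `Lines/SketchTypedCandidate.lean`), then a class undetected on the
local subgroups of SOME neighbourhood of `t₀` lies in the tree's `localKernel` at `t₀` (the shape
`LocalTubeSpanCFree`): shrink to `N' = interior (N ∩ N₀)`, use monotonicity of local subgroups
(`localSubgroup_mono`: undetected on a subgroup ⇒ undetected on its subgroups) and
`mem_localKernel_iff`. -/
theorem stub_localKernelOfBalls (t₀ : T)
    (hballs : ∃ N₀ ∈ 𝓝 t₀, ∀ N' ∈ 𝓝 t₀, N' ⊆ N₀ → IsOpen N' →
      ∀ (s' : S) (hs' : ι s' ∈ N') (γ : Path s' s),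
        LinearMap.ker (evalCoinvOn (monodromyRepObj V s) (localSubgroup ι s N' hs' γ)) =
          H1resKer (monodromyRepObj V s) (localSubgroup ι s N' hs' γ))
    (ξ : groupCohomology.H1 (monodromyRepObj V s))
    (hξ : ∃ N ∈ 𝓝 t₀, ∀ (s' : S) (hs' : ι s' ∈ N) (γ : Path s' s),
      evalCoinvOn (monodromyRepObj V s) (localSubgroup ι s N hs' γ) ξ = 0) :
    ξ ∈ localKernel ι V s t₀ :=
  localTubeSpan_mem_localKernel_of_balls ι V s t₀ hballs ξ hξ

end TypedGlue

section ClassSpace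

variable {k G : Type u} [CommRing k] [Group G] (A : Rep k G)

/-- REMARK (cycle 4): the surrogate implies each of its CLASS-SPACE-restricted forms
`W ⊓ ker (evalCoinvOn A S) ≤ H1resKer A S` — the printed crux restricts to
`W = c(H^{2p}(X, ℚ)_prim)`, which is all of `H¹(G, V)` for `p ≥ 2`, `d ≫ 0` (Schnell2010 Prop. 7)
but not for `p = 1`; so every theorem of this line proves the printed form as well. -/
theorem LocalTubeSpanAt.inf_ker_le (S : Subgroup G) (h : LocalTubeSpanAt A S)
    (W : Submodule k (groupCohomology.H1 A)) :
    W ⊓ LinearMap.ker (evalCoinvOn A S) ≤ H1resKer A S := fun ξ hξ => by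
  have h2 : ξ ∈ LinearMap.ker (evalCoinvOn A S) := hξ.2
  rw [show LinearMap.ker (evalCoinvOn A S) = H1resKer A S from h] at h2
  exact h2

end ClassSpace

/-!
## Cycle 4, wave 3 (continuation lead c3): independent cycles unconditionally; the whole thin family `μ ≥ 4`

* `stub_independentCycles` — ALL generator cycles linearly independent (any Dynkin graph: several isolated singular
  points and nodes on one member, no relation) ⇒ injective, unconditionally (`stub_distinguishedBasis` on the
  non-isolated vertices + `stub_reduction` for the isolated ones).  Geometrically these are the members with
  `Vis(s₀) = 0` (no relation among local vanishing cycles), where the printed crux is automatic but the c-free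
  surrogate is not.
* `stub_ncSubconfiguration` — relations supported on a pairwise-ORTHOGONAL sub-configuration (reducible members whose
  components meet in nodes plus tangency clusters off the relation: tacnode + node) ⇒ injective, unconditionally
  (`stub_ncNodal` on the sub-configuration + `stub_reduction`).
* `stub_thinRepMu`, `stub_thinDynamicsMu`, `stub_thinCocycleMu`, composition
  `exists_thinConfiguration_not_injective_of_four_le` — the thin boundary for EVERY integer pairing `μ ≥ 4`
  (the cycle-3 files are `μ = 4`); with `…RankTwoPairingOne/Two/Three` this classifies the triangle family:
  injective iff `|μ| ≤ 3`.
-/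

section IndependentCycles

variable {G : Type} [Group G] (A : Rep.{0} ℚ G)

/-- stub (LANDED p120726, IndependentCycles file — `localTubeSpan_injective_evalCoinv_of_independentCycles`; cycle 4, wave 3 — linearly independent cycles, UNCONDITIONALLY).  `G` generated by a finite set `s` of
elements acting as transvections of a nondegenerate alternating form along LINEARLY INDEPENDENT cycles `e t`
(`t ∈ s`).  Then Schnell's third map is injective: the vertices with a neighbour in the Dynkin graph form
distinguished-basis clusters (`stub_distinguishedBasis` on the subgroup they generate), and the isolated vertices'
cycles are independent modulo the span of the others (`stub_reduction`). -/
theorem stub_independentCycles [FiniteDimensional ℚ A.V] (B : LinearMap.BilinForm ℚ A.V)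
    (hB : B.Nondegenerate) (hBalt : B.IsAlt) (s : Set G) (hsfin : s.Finite)
    (hs : Subgroup.closure s = ⊤) (e : G → A.V)
    (hPL : ∀ t ∈ s, ∀ x : A.V, A.ρ t x = x - B x (e t) • e t)
    (hli : LinearIndependent ℚ (fun t : s => e t)) :
    Function.Injective (evalCoinv A) :=
  localTubeSpan_injective_evalCoinv_of_independentCycles A B hB hBalt s hsfin hs e hPL hli

/-- stub (LANDED p120731, NCSubconfiguration file — `localTubeSpan_injective_evalCoinv_of_ncSubconfiguration`; cycle 4, wave 3 — relations carried by an orthogonal sub-configuration, UNCONDITIONALLY).  `G`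
generated by `s` acting as transvections of a nondegenerate form along cycles `e t`; a finite sub-family
`s' ⊆ s` with pairwise ORTHOGONAL non-zero cycles (transversal nodes, possibly with relations among them), the
remaining cycles linearly independent modulo `ℚ e(s')` (every relation is supported on `s'`).  Then Schnell's
third map is injective (`stub_ncNodal` on `⟨s'⟩`, then `stub_reduction`).  Example: tacnode + node member with
`δ₁ + δ₃ + δ₄ = 0` (`s' = {t₁, t₃, t₄}`). -/
theorem stub_ncSubconfiguration [FiniteDimensional ℚ A.V] (B : LinearMap.BilinForm ℚ A.V)
    (hB : B.Nondegenerate) (s : Set G) (hs : Subgroup.closure s = ⊤) (e : G → A.V)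
    (hPL : ∀ t ∈ s, ∀ x : A.V, A.ρ t x = x - B x (e t) • e t)
    (s' : Set G) (hs' : s' ⊆ s) (hs'fin : s'.Finite)
    (horth : ∀ t ∈ s', ∀ t' ∈ s', B (e t) (e t') = 0) (hne : ∀ t ∈ s', e t ≠ 0)
    (hind : LinearIndependent ℚ
      (fun t : ↥(s \ s') => (Submodule.span ℚ (e '' s')).mkQ (e t))) :
    Function.Injective (evalCoinv A) :=
  localTubeSpan_injective_evalCoinv_of_ncSubconfiguration A B hB s hs e hPL s' hs' hs'fin horth hne
    hind

/-- COMPOSITION (cycle 4, wave 3): the surrogate crux at a local group all of whose meridian cycles are linearly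
independent (`stub_kerEvalCoinvOn ∘ stub_independentCycles`). -/
theorem LocalTubeSpanAt_of_independentCycles [FiniteDimensional ℚ A.V] (S : Subgroup G)
    (B : LinearMap.BilinForm ℚ A.V) (hB : B.Nondegenerate) (hBalt : B.IsAlt) (s : Set S) (hsfin : s.Finite)
    (hs : Subgroup.closure s = ⊤) (e : S → A.V)
    (hPL : ∀ t ∈ s, ∀ x : A.V, A.ρ t x = x - B x (e t) • e t)
    (hli : LinearIndependent ℚ (fun t : s => e t)) :
    LocalTubeSpanAt A S :=
  stub_kerEvalCoinvOn A S (stub_independentCycles (Rep.res S.subtype A) B hB hBalt s hsfin hs e hPL hli)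

end IndependentCycles

section ThinMu

/-- stub (LANDED p120703, ThinRepMu file — `localTubeSpan_exists_thinRepMu`; cycle 4, wave 3 — the representation, parameter `μ`).  The free group on three letters acts on `ℚ²` by the
transvections of `μ(x₀y₁ - x₁y₀)` along `(1,0), (0,1), (1,1)`. -/
theorem stub_thinRepMu (μ : ℚ) : ∃ ρ : Representation ℚ (FreeGroup (Fin 3)) (Fin 2 → ℚ),
    (∀ v, ρ (FreeGroup.of 0) v = ![v 0 + μ * v 1, v 1]) ∧
    (∀ v, ρ (FreeGroup.of 1) v = ![v 0, v 1 - μ * v 0]) ∧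
    (∀ v, ρ (FreeGroup.of 2) v = ![v 0 - μ * (v 0 - v 1), v 1 - μ * (v 0 - v 1)]) :=
  localTubeSpan_exists_thinRepMu μ

/-- stub (LANDED p121346, ThinDynamicsMu file — `localTubeSpan_thinDynamicsMu`, lemmas p120818; cycle 4, wave 3, lead — ping-pong dynamics for every `μ ≥ 4`).  As `stub_thinDynamics` (`μ = 4`) with cones
`C₁ = {2|v₁| ≤ |v₀|}`, `C₂ = {2|v₀| ≤ |v₁|}`, `C₃ = {μ|v₀ - v₁| ≤ |v₀ + v₁|}` (pairwise meeting in `0` for `μ ≥ 4`;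
`T_iⁿ`, `n ≠ 0`, maps the complement of the core of `C_i` into `C_i` since `μ - 2 ≥ 2` and `2μ - μ ≥ μ`): a
cyclically reduced alternating product of non-zero powers acts with `g - 1` invertible. -/
theorem stub_thinDynamicsMu (μ : ℚ) (hμ : 4 ≤ μ) {G : Type} [Group G] (ρ : Representation ℚ G (Fin 2 → ℚ))
    (τ : Fin 3 → G)
    (hτ₀ : ∀ v, ρ (τ 0) v = ![v 0 + μ * v 1, v 1])
    (hτ₁ : ∀ v, ρ (τ 1) v = ![v 0, v 1 - μ * v 0])
    (hτ₂ : ∀ v, ρ (τ 2) v = ![v 0 - μ * (v 0 - v 1), v 1 - μ * (v 0 - v 1)])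
    (L : List (Fin 3 × ℤ)) (hL0 : ∀ p ∈ L, p.2 ≠ 0) (hLc : L.IsChain (fun p q => p.1 ≠ q.1))
    (a b : Fin 3 × ℤ) (ha : L.head? = some a) (hb : L.getLast? = some b) (hab : a.1 ≠ b.1) :
    IsUnit (ρ (L.map fun p => τ p.1 ^ p.2).prod - 1) :=
  localTubeSpan_thinDynamicsMu μ hμ ρ τ hτ₀ hτ₁ hτ₂ L hL0 hLc a b ha hb hab

/-- stub (LANDED p120759, ThinCocycleMu file — `localTubeSpan_not_injective_evalCoinv_thinMu`; cycle 4, wave 3 — the undetected non-coboundary, parameter `μ ≠ 0`).  As `stub_thinCocycle`: granted the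
dichotomy (every element acts with `g - 1` invertible or is conjugate to a power of a generator), the cocycle with
values `0, 0, δ₃` on the free generators is undetected by every element but is not a coboundary. -/
theorem stub_thinCocycleMu (μ : ℚ) (hμ : μ ≠ 0) (ρ : Representation ℚ (FreeGroup (Fin 3)) (Fin 2 → ℚ))
    (hτ₀ : ∀ v, ρ (FreeGroup.of 0) v = ![v 0 + μ * v 1, v 1])
    (hτ₁ : ∀ v, ρ (FreeGroup.of 1) v = ![v 0, v 1 - μ * v 0])
    (hτ₂ : ∀ v, ρ (FreeGroup.of 2) v = ![v 0 - μ * (v 0 - v 1), v 1 - μ * (v 0 - v 1)])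
    (hclass : ∀ g : FreeGroup (Fin 3), IsUnit (ρ g - 1) ∨
      ∃ (h : FreeGroup (Fin 3)) (i : Fin 3) (n : ℤ), g = h * FreeGroup.of i ^ n * h⁻¹) :
    ¬ Function.Injective (evalCoinv (Rep.of ρ)) :=
  localTubeSpan_not_injective_evalCoinv_thinMu μ hμ ρ hτ₀ hτ₁ hτ₂ hclass

/-- COMPOSITION (cycle 4, wave 3 — the thin boundary for EVERY integer pairing `μ ≥ 4`; landing as `…ThinMu`).  There is a finitely
generated group acting on a 2-dimensional `ℚ`-space through integral symplectic transvections of a nondegenerate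
alternating form along three cycles `e t₃ = e t₁ + e t₂` with `B(e t₁, e t₂) = μ`, whose third map is not
injective.  With `stub_rankTwoPairingOne/Two/Three` (injective for `μ = 1, 2, 3`): the triangle configuration is
detected iff `|μ| ≤ 3`. -/
theorem exists_thinConfiguration_not_injective_of_four_le (μ : ℤ) (hμ : 4 ≤ μ) :
    ∃ (G : Type) (_ : Group G) (A : Rep ℚ G) (B : LinearMap.BilinForm ℚ A.V) (s : Set G)
      (e : G → A.V), B.Nondegenerate ∧ B.IsAlt ∧ s.Finite ∧ Subgroup.closure s = ⊤ ∧
      (∀ t ∈ s, ∀ x : A.V, A.ρ t x = x - B x (e t) • e t) ∧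
      (∀ t ∈ s, ∀ t' ∈ s, ∃ n : ℤ, B (e t) (e t') = n) ∧
      Module.finrank ℚ A.V = 2 ∧
      (∃ t₁ ∈ s, ∃ t₂ ∈ s, ∃ t₃ ∈ s, e t₃ = e t₁ + e t₂ ∧ B (e t₁) (e t₂) = μ) ∧
      ¬ Function.Injective (evalCoinv A) := by
  classical
  have hμQ : (4 : ℚ) ≤ (μ : ℚ) := by exact_mod_cast hμ
  have hμ0 : (μ : ℚ) ≠ 0 := by
    have : (0 : ℚ) < (μ : ℚ) := by linarith
    exact this.ne'
  obtain ⟨ρ, h0, h1, h2⟩ := stub_thinRepMu (μ : ℚ)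
  -- the dichotomy for the free group, from the dynamics
  have hclass := stub_thinClassification ρ FreeGroup.of (FreeGroup.closure_range_of _)
    (fun L hL0 hLc a b ha hb hab =>
      stub_thinDynamicsMu (μ : ℚ) hμQ ρ FreeGroup.of h0 h1 h2 L hL0 hLc a b ha hb hab)
  have hthin := stub_thinCocycleMu (μ : ℚ) hμ0 ρ h0 h1 h2 hclass
  -- the data
  let d : Fin 3 → (Fin 2 → ℚ) := ![![1, 0], ![0, 1], ![1, 1]]
  have hd0 : d 0 = ![1, 0] := rfl
  have hd1 : d 1 = ![0, 1] := rfl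
  have hd2 : d 2 = ![1, 1] := rfl
  let B : LinearMap.BilinForm ℚ (Fin 2 → ℚ) := Matrix.toBilin' !![(0 : ℚ), μ; -μ, 0]
  have hBapply : ∀ x y : Fin 2 → ℚ, B x y = (μ : ℚ) * (x 0 * y 1 - x 1 * y 0) := fun x y => by
    change Matrix.toBilin' !![(0 : ℚ), μ; -μ, 0] x y = _
    rw [Matrix.toBilin'_apply']
    simp [Matrix.mulVec, dotProduct, Fin.sum_univ_two]
    ring
  let e : FreeGroup (Fin 3) → (Fin 2 → ℚ) := fun g =>
    if hg : ∃ i, FreeGroup.of i = g then d (Classical.choose hg) else 0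
  have he : ∀ i, e (FreeGroup.of i) = d i := fun i => by
    have hg : ∃ j, FreeGroup.of j = FreeGroup.of i := ⟨i, rfl⟩
    change (if hg : ∃ j, FreeGroup.of j = FreeGroup.of i then d (Classical.choose hg) else 0) = d i
    rw [dif_pos hg, FreeGroup.of_injective (Classical.choose_spec hg)]
  refine ⟨FreeGroup (Fin 3), inferInstance, Rep.of ρ, B, Set.range FreeGroup.of, e, ?_, ?_,
    Set.finite_range _, FreeGroup.closure_range_of _, ?_, ?_, Module.finrank_fin_fun ℚ, ?_, hthin⟩
  · -- nondegenerate: `det = μ²`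
    refine LinearMap.BilinForm.nondegenerate_toBilin'_iff_det_ne_zero.2 ?_
    rw [Matrix.det_fin_two_of]
    have : (0 : ℚ) * 0 - (μ : ℚ) * -(μ : ℚ) = (μ : ℚ) * μ := by ring
    rw [this]
    exact mul_ne_zero hμ0 hμ0
  · -- alternating
    intro x
    rw [hBapply]
    ring
  · -- the generators act as the transvections along `d i`
    have key : ∀ (i : Fin 3) (x : Fin 2 → ℚ), ρ (FreeGroup.of i) x = x - B x (d i) • d i := by
      intro i x
      rw [hBapply]
      match i with
      | 0 => rw [h0, hd0]; ext j; fin_cases j <;> simp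
      | 1 => rw [h1, hd1]; ext j; fin_cases j <;> simp
      | 2 => rw [h2, hd2]; ext j; fin_cases j <;> simp
    rintro _ ⟨i, rfl⟩ x
    rw [he]
    exact key i x
  · -- integral pairings (`0, ±μ`)
    have key : ∀ i j : Fin 3, ∃ n : ℤ, B (d i) (d j) = n := by
      intro i j
      rw [hBapply]
      match i, j with
      | 0, 0 => exact ⟨0, by norm_num [hd0]⟩
      | 0, 1 => exact ⟨μ, by norm_num [hd0, hd1]⟩
      | 0, 2 => exact ⟨μ, by norm_num [hd0, hd2]⟩
      | 1, 0 => exact ⟨-μ, by norm_num [hd0, hd1]⟩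
      | 1, 1 => exact ⟨0, by norm_num [hd1]⟩
      | 1, 2 => exact ⟨-μ, by norm_num [hd1, hd2]⟩
      | 2, 0 => exact ⟨-μ, by norm_num [hd0, hd2]⟩
      | 2, 1 => exact ⟨μ, by norm_num [hd1, hd2]⟩
      | 2, 2 => exact ⟨0, by norm_num [hd2]⟩
    rintro _ ⟨i, rfl⟩ _ ⟨j, rfl⟩
    rw [he, he]
    exact key i j
  · refine ⟨FreeGroup.of 0, ⟨0, rfl⟩, FreeGroup.of 1, ⟨1, rfl⟩, FreeGroup.of 2, ⟨2, rfl⟩, ?_, ?_⟩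
    · rw [he, he, he, hd0, hd1, hd2]; ext j; fin_cases j <;> simp
    · rw [he, he, hBapply, hd0, hd1]; norm_num

end ThinMu

section OneViewPoint

open _root_.Topology Filter

variable {k S : Type u} [CommRing k] [TopologicalSpace S] {T : Type v} [TopologicalSpace T]
  (ι : C(S, T)) (V : Literature.AlgebraicGeometry.Motives.LocalSystem k S) (s : S)

/-- stub (LANDED p121299, LocalSubgroupConj file — `localTubeSpan_localSubgroup_conj_of_joinedIn`; the Literature file `LocalKernelConnected` (landed 2026-08-16) has the explicit-conjugator form `localSubgroup_eq_conj_smul` and `localKernelOn_eq_H1resKer`; cycle 4, wave 4 — typed glue: local subgroups at a path-connected piece are conjugate).  If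
`s₁` and `s₂` are joined by a path INSIDE `ι⁻¹ N`, then for any paths `γ₁ : s₁ ⇝ s`, `γ₂ : s₂ ⇝ s`
the local subgroups `localSubgroup ι s N hs₁ γ₁` and `localSubgroup ι s N hs₂ γ₂` are conjugate in
`π₁(S, s)` (by the class of the loop `γ₁⁻¹ · α · γ₂`).  Hence (compositions below) the tree's
`localKernelOn` and the intersection of the `ker evalCoinvOn` over all view points reduce to ONE view
point when `ι⁻¹ N` is path connected — the typed crux can be checked at a single base point of the
punctured ball (the tree's docstring of `localKernelOn` records this as "not formalised here"). -/
theorem stub_localSubgroup_conj_of_joinedIn (N : Set T) {s₁ s₂ : S} (hs₁ : ι s₁ ∈ N)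
    (hs₂ : ι s₂ ∈ N) (hjoin : JoinedIn (ι ⁻¹' N) s₁ s₂) (γ₁ : Path s₁ s) (γ₂ : Path s₂ s) :
    ∃ h : FundamentalGroup S s,
      localSubgroup ι s N hs₁ γ₁ = MulAut.conj h • localSubgroup ι s N hs₂ γ₂ :=
  localTubeSpan_localSubgroup_conj_of_joinedIn ι s N hs₁ hs₂ hjoin γ₁ γ₂

/-- COMPOSITION (cycle 4, wave 4): on a path-connected piece `ι⁻¹ N`, the local kernel at `N` is the
restriction kernel of ANY ONE local subgroup (`stub_localSubgroup_conj_of_joinedIn` +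
`H1resKer_conj_smul`). -/
theorem localKernelOn_eq_H1resKer_of_isPathConnected (N : Set T) (hN : IsPathConnected (ι ⁻¹' N))
    {s' : S} (hs' : ι s' ∈ N) (γ : Path s' s) :
    localKernelOn ι V s N = H1resKer (monodromyRepObj V s) (localSubgroup ι s N hs' γ) := by
  refine le_antisymm (fun ξ hξ => (mem_localKernelOn_iff ι V s N ξ).1 hξ s' hs' γ) fun ξ hξ => ?_
  refine (mem_localKernelOn_iff ι V s N ξ).2 fun s₂ hs₂ γ₂ => ?_
  obtain ⟨h, hh⟩ := stub_localSubgroup_conj_of_joinedIn ι s N hs₂ hs' (hN.joinedIn s₂ hs₂ s' hs') γ₂ γ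
  rw [hh, H1resKer_conj_smul]
  exact hξ

/-- COMPOSITION (cycle 4, wave 4; landed in `…OneViewPoint` p121378): on a path-connected piece, "undetected on every local subgroup at `N`"
is "undetected on one of them" (`stub_localSubgroup_conj_of_joinedIn` +
`localTubeSpan_ker_evalCoinvOn_conj_smul`). -/
theorem iInf_ker_evalCoinvOn_eq_of_isPathConnected (N : Set T) (hN : IsPathConnected (ι ⁻¹' N))
    {s' : S} (hs' : ι s' ∈ N) (γ : Path s' s) :
    (⨅ (s₂ : S) (hs₂ : ι s₂ ∈ N) (γ₂ : Path s₂ s),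
      LinearMap.ker (evalCoinvOn (monodromyRepObj V s) (localSubgroup ι s N hs₂ γ₂))) =
      LinearMap.ker (evalCoinvOn (monodromyRepObj V s) (localSubgroup ι s N hs' γ)) := by
  refine le_antisymm (iInf_le_of_le s' (iInf_le_of_le hs' (iInf_le _ γ))) ?_
  refine le_iInf fun s₂ => le_iInf fun hs₂ => le_iInf fun γ₂ => ?_
  obtain ⟨h, hh⟩ := stub_localSubgroup_conj_of_joinedIn ι s N hs₂ hs' (hN.joinedIn s₂ hs₂ s' hs') γ₂ γ
  rw [hh, localTubeSpan_ker_evalCoinvOn_conj_smul]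

/-- COMPOSITION (cycle 4, wave 4): the typed surrogate at a path-connected piece from ONE view point —
if `ker (evalCoinvOn _ S₀) = H1resKer _ S₀` for one local subgroup `S₀` at `N`, then the classes
undetected on all local subgroups at `N` are exactly `localKernelOn ι V s N`. -/
theorem localKernelOn_eq_iInf_ker_of_one (N : Set T) (hN : IsPathConnected (ι ⁻¹' N))
    {s' : S} (hs' : ι s' ∈ N) (γ : Path s' s)
    (h : LinearMap.ker (evalCoinvOn (monodromyRepObj V s) (localSubgroup ι s N hs' γ)) =
      H1resKer (monodromyRepObj V s) (localSubgroup ι s N hs' γ)) :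
    localKernelOn ι V s N = ⨅ (s₂ : S) (hs₂ : ι s₂ ∈ N) (γ₂ : Path s₂ s),
      LinearMap.ker (evalCoinvOn (monodromyRepObj V s) (localSubgroup ι s N hs₂ γ₂)) := by
  rw [iInf_ker_evalCoinvOn_eq_of_isPathConnected ι V s N hN hs' γ, h,
    localKernelOn_eq_H1resKer_of_isPathConnected ι V s N hN hs' γ]

end OneViewPoint


/-! ## Cycle 5 (continuation lead c4) — ASSEMBLY on the tree's hyperplane-section package, and two
unconditional algebra stubs

The spine is over `ℚ` (integrality, lattices, rank drops), the tree's hyperplane-section package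
(`HyperplaneSectionLocalSystem`, `monodromyRepObj`, `localSubgroup`, `localKernel`) is over `ℂ`.
Cycle 4 proved PORTABILITY abstractly (`…BaseChange`: detection over `k` ⇔ over `K` for a
finite-dimensional `k`-form `A` with an intertwining `e : K ⊗[k] A ≃ A'`).  Cycle 5 CONSTRUCTS the
`ℚ`-form from the tree (`DirectImageLocalSystem.transport_isRationalClass`,
`isRationalClass_iff_mem_range_ofRatClass`, `ofRatClass_injective`,
`ofRatClassBaseChangeEquiv : ℂ ⊗_ℚ Hᵏ(X_s;ℚ) ≃ Hᵏ(X_s;ℂ)`,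
`finite_singularCohomology_rat_complexPoints`) and assembles the line on the tree's real objects:

* `stub_ratForm` (lead) — the RATIONAL MONODROMY: a representation `ρ_ℚ` of `π₁(U, s)` on
  `Hᵏ(X_s(ℂ); ℚ)` with `ofRatClass (ρ_ℚ γ x) = monodromyBetti γ (ofRatClass x)` (unique by
  injectivity of `ofRatClass`; lands as a Literature definition `ratMonodromy`);
* `stub_ratTensorEquiv` — any such `ρ_ℚ` is a finite-dimensional `ℚ`-FORM of
  `monodromyRepObj (D.V k) s`: `e := ofRatClassBaseChangeEquiv ≫ fiberIso⁻¹` intertwines;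
* `stub_vanishingTransfer` — VANISHING vs FULL carrier: given the Lefschetz splitting
  `Hⁿ(X_s) = Hⁿ(X_s)_van ⊕ i^*Hⁿ(X)` (hypothesis `IsCompl`; the complement is monodromy-TRIVIAL by
  `monodromyBetti_map_comp`), cyclic detection for the restriction to a subgroup `S` of
  `monodromyRepObj (D.vanishingLocalSystem …) s` ⇔ for `monodromyRepObj (D.V n) s`
  (`…TrivialSummand` + the identification of the sub-local-system's monodromy with the
  subrepresentation);
* compositions (lead): the typed surrogate at a local subgroup / at a path-connected piece / the
  NC-nodal typed instance, from a `ℚ`-Picard–Lefschetz presentation of ONE local subgroup;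
* `stub_lefschetzSplitting` (wave 2) — hypothesis (L) of the vanishing-carrier statements, the
  Lefschetz splitting `Hⁿ(X_s) = van ⊕ i^*Hⁿ(X)`, from the projection formula and hard Lefschetz for
  the class `[X_s] = i_* 1` of the member;
* `stub_unimodularPencil` — UNIMODULAR ABSORPTION: for `⟨a, b⟩ = 1` the group generated by two
  elements acting as `T_a`, `T_b` realises the transvection along EVERY `m a + n b` (Euclid by
  conjugation for coprime `(m, n)`, `T_{kp} = T_p^{k²}` otherwise): more realised transvections
  from finite data (feeds `…Saturation` / `…UnimodularChain`);
* `stub_centralSplit` — CENTRAL SPLITTING: for a central `z` with `V = ker (z-1) ⊕ (z-1)V`,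
  detection for `V` ⇔ detection for the subrepresentation `V^z` (`H¹(G, (z-1)V) = 0`); with
  `z = -1 ∈ ρ(G)` this is Schnell's Prop. 12 with NO Janssen input for lattices whose monodromy
  contains `-1` (e.g. `A_{2g}` clusters: the Coxeter word).
-/

section Cycle5Algebra

variable {G : Type} [Group G] (A : Rep.{0} ℚ G)

/-- stub (cycle 5; LANDED p123217, UnimodularPencil file — `localTubeSpan_unimodularPencil`): UNIMODULAR ABSORPTION.  If `t_a`, `t_b ∈ G` act as the Picard–Lefschetz
transvections along `a`, `b` with `⟨a, b⟩ = 1` (alternating `B`), then for every `(m, n) ∈ ℤ²` some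
element of `⟨t_a, t_b⟩` acts as the transvection along `m a + n b` (for coprime `(m, n)` the vector
`m a + n b` lies in the `⟨t_a, t_b⟩`-orbit of `a` or `b` by the Euclidean algorithm —
`t_b^k (m a + n b) = m a + (n - k m) b`, `t_a^k (m a + n b) = (m + k n) a + n b` — and conjugate
meridians act as transvections along transported cycles; in general `m a + n b = d p` with `p`
primitive and `T_{d p} = T_p^{d²}`). -/
theorem stub_unimodularPencil (B : LinearMap.BilinForm ℚ A.V) (hB : B.IsAlt) (a b : A.V)
    (hab : B a b = 1) (ta tb : G)
    (hta : ∀ x : A.V, A.ρ ta x = x - B x a • a) (htb : ∀ x : A.V, A.ρ tb x = x - B x b • b)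
    (m n : ℤ) :
    ∃ g ∈ Subgroup.closure ({ta, tb} : Set G),
      ∀ x : A.V, A.ρ g x = x - B x (m • a + n • b) • (m • a + n • b) :=
  localTubeSpan_unimodularPencil A B hB a b hab ta tb hta htb m n

variable {k G' : Type u} [Field k] [Group G'] (A' : Rep k G')

/-- stub (cycle 5; LANDED p123184, CentralSplit file — `localTubeSpan_centralSplit`): CENTRAL SPLITTING.  For a central element `z` such that
`V = ker (z - 1) ⊕ (z - 1)V` (automatic for `z` of finite order in characteristic `0`), cyclic
detection for `V` is equivalent to cyclic detection for the (stable) subrepresentation `V^z`: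
`H¹(G, (z - 1)V) = 0` because `(z - 1)ψ(g) = (g - 1)ψ(z)` for every cocycle `ψ` and `z - 1` is
bijective on `(z - 1)V`, and `…DirectSum` splits detection over the two stable summands. -/
theorem stub_centralSplit (z : G') (hz : ∀ g : G', g * z = z * g) (W₁ W₂ : Submodule k A'.V)
    (hW₁ : W₁ = LinearMap.ker (A'.ρ z - LinearMap.id))
    (hW₂ : W₂ = LinearMap.range (A'.ρ z - LinearMap.id))
    (h₁ : ∀ g : G', W₁ ≤ W₁.comap (A'.ρ g)) (hc : IsCompl W₁ W₂) :
    Function.Injective (evalCoinv A') ↔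
      Function.Injective (evalCoinv (Rep.of (A'.ρ.subrepresentation W₁ h₁))) :=
  localTubeSpan_centralSplit A' z hz W₁ W₂ hW₁ hW₂ h₁ hc

end Cycle5Algebra

section Cycle5Typed

open Literature.AlgebraicGeometry Literature.AlgebraicTopology.SingularHomology
open scoped TensorProduct

variable {𝒳 Sb : Motives.SchemeOver ℂ} {π : 𝒳 ⟶ Sb} {n : ℕ}

/-- stub (cycle 5, lead; CLOSED by the Literature definition `DirectImageLocalSystem.ratMonodromy` — file `HodgeTheory/HyperplaneSectionRationalMonodromy`, p123063 ACCEPTED — and recorded as `localTubeSpan_exists_ratForm`, RatForm file): THE RATIONAL MONODROMY of `Rᵏ π_* ℂ|_U` at `s`.  Transport preserves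
rational classes (`DirectImageLocalSystem.transport_isRationalClass`), the rational classes are the
image of the injective lattice map `ofRatClass : Hᵏ(X_s(ℂ); ℚ) → Hᵏ(X_s(ℂ); ℂ)`
(`isRationalClass_iff_mem_range_ofRatClass`, `ofRatClass_injective`), so the monodromy of every loop
restricts to a `ℚ`-linear endomorphism of `Hᵏ(X_s(ℂ); ℚ)`, multiplicatively in the loop. -/
theorem stub_ratForm (D : DirectImageLocalSystem π n) (k : ℕ) (s : smoothFiberLocus π n) :
    ∃ ρ : Representation ℚ (FundamentalGroup (smoothFiberLocus π n) s)
        (Motives.bettiCohomology (Motives.fiberOver π s.1) k),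
      ∀ (g : FundamentalGroup (smoothFiberLocus π n) s)
        (x : Motives.bettiCohomology (Motives.fiberOver π s.1) k),
        ofRatClass (Motives.ComplexPoints (Motives.fiberOver π s.1)) k (ρ g x) =
          D.monodromyBetti k s g (ofRatClass (Motives.ComplexPoints (Motives.fiberOver π s.1)) k x) :=
  ⟨D.ratMonodromy k s, D.ofRatClass_ratMonodromy k s⟩

/-- stub (cycle 5; LANDED p123004, RatTensorEquiv file — `localTubeSpan_ratTensorEquiv`): the rational monodromy is a finite-dimensional `ℚ`-FORM of
`monodromyRepObj (D.V k) s` — `Hᵏ(X_s(ℂ); ℚ)` is finite-dimensional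
(`finite_singularCohomology_rat_complexPoints`) and
`e := ofRatClassBaseChangeEquiv ≫ (fiberIso k s)⁻¹ : ℂ ⊗_ℚ Hᵏ(X_s; ℚ) ≃ (V k)_s` intertwines the
two actions (`ofRatClassBaseChange_tmul`, `monodromyBetti_apply`, `transportBetti_apply`,
`LocalSystem.monodromyRep_apply`): exactly the hypotheses of `…BaseChange`
(`localTubeSpan_injective_evalCoinv_iff_of_tensorEquiv`). -/
theorem stub_ratTensorEquiv (D : DirectImageLocalSystem π n) (k : ℕ) (s : smoothFiberLocus π n)
    (ρ : Representation ℚ (FundamentalGroup (smoothFiberLocus π n) s)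
      (Motives.bettiCohomology (Motives.fiberOver π s.1) k))
    (hρ : ∀ (g : FundamentalGroup (smoothFiberLocus π n) s)
      (x : Motives.bettiCohomology (Motives.fiberOver π s.1) k),
      ofRatClass (Motives.ComplexPoints (Motives.fiberOver π s.1)) k (ρ g x) =
        D.monodromyBetti k s g (ofRatClass (Motives.ComplexPoints (Motives.fiberOver π s.1)) k x)) :
    FiniteDimensional ℚ (Motives.bettiCohomology (Motives.fiberOver π s.1) k) ∧
      ∀ (g : FundamentalGroup (smoothFiberLocus π n) s) (c : ℂ)
        (x : Motives.bettiCohomology (Motives.fiberOver π s.1) k),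
        ((ofRatClassBaseChangeEquiv s.2 k).trans (D.fiberIso k s).symm) (c ⊗ₜ[ℚ] ρ g x) =
          (monodromyRepObj (D.V k) s).ρ g
            (((ofRatClassBaseChangeEquiv s.2 k).trans (D.fiberIso k s).symm) (c ⊗ₜ[ℚ] x)) :=
  localTubeSpan_ratTensorEquiv D k s ρ hρ

/-- stub (cycle 5; LANDED p123155, VanishingTransfer file — `localTubeSpan_vanishingTransfer`): VANISHING vs FULL carrier.  Given the Lefschetz splitting
`Hⁿ(X_s(ℂ); ℂ) = Hⁿ(X_s)_van ⊕ i^*Hⁿ(X(ℂ); ℂ)` (hypothesis `IsCompl`; Voisin II Prop. 2.27), cyclic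
detection for the restriction to any subgroup `S ≤ π₁(U, s)` of the monodromy representation of the
VANISHING sub-local system is equivalent to that of the full `Rⁿ π_* ℂ`: the complement
`i^*Hⁿ(X)` is monodromy-TRIVIAL (`monodromyBetti_map_comp`), the monodromy of the sub-local system
`vanishingLocalSystem = (V n).subsystem …` is the subrepresentation of `monodromyRepObj (D.V n) s`
on `fiberIso⁻¹(Hⁿ(X_s)_van)` (`LocalSystem.subsystem_transport_apply`), and `…TrivialSummand`
(`localTubeSpan_injective_evalCoinv_iff_of_trivialComplement`) moves detection across a trivial
complement. -/
theorem stub_vanishingTransfer {X : Motives.SchemeOver ℂ} {j : 𝒳 ⟶ X}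
    (D : HyperplaneSectionLocalSystem π n j) (μ : OrientationFamily) {m b : ℕ}
    (hX : Motives.IsSmoothProjective m X) (hb : n + 2 * m = b + 2 * n) (s : smoothFiberLocus π n)
    (hcompl : IsCompl (vanishing π n j μ hX hb s)
      (LinearMap.range (complexBetti.map (Motives.fiberι π s.1 ≫ j) n).hom))
    (S : Subgroup (FundamentalGroup (smoothFiberLocus π n) s)) :
    Function.Injective
        (evalCoinv (Rep.res S.subtype (monodromyRepObj (D.vanishingLocalSystem μ hX hb) s))) ↔
      Function.Injective (evalCoinv (Rep.res S.subtype (monodromyRepObj (D.V n) s))) :=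
  localTubeSpan_vanishingTransfer D μ hX hb s hcompl S

/-- stub (cycle 5, wave 2; LANDED p123857, LefschetzSplitting file — `localTubeSpan_lefschetzSplitting`): THE LEFSCHETZ SPLITTING from hard Lefschetz for the class of the member.
Hypothesis (L) of the vanishing-carrier assembly — `Hⁿ(X_s(ℂ); ℂ) = Hⁿ(X_s)_van ⊕ i^*Hⁿ(X(ℂ); ℂ)`
(`IsCompl`, Voisin II Prop. 2.27) — follows from the projection formula `i_*(i^* x ∪ 1) = x ∪ i_* 1`
(`complexGysin_cup`, `cupProduct_one'`) and the bijectivity of `x ↦ x ∪ i_* 1 : Hⁿ(X) → Hᵇ(X)`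
(hard Lefschetz for the class `[X_s] = i_* 1` of the member; for hyperplane sections of an
`(n+1)`-fold, `HardLefschetzNFold.bijective_L` with `j = 1` once `[X_s]` is identified with the
hyperplane class): disjointness — `i^* x ∈ van ⇒ x ∪ [X_s] = i_* i^* x = 0 ⇒ x = 0`; codisjointness —
`i_* y = x ∪ [X_s] = i_* i^* x` for some `x`, so `y - i^* x ∈ ker i_* = van`. -/
theorem stub_lefschetzSplitting {X : Motives.SchemeOver ℂ} {j : 𝒳 ⟶ X} (μ : OrientationFamily)
    (hμ : μ.HasPoincareDuality) {m b : ℕ} (hX : Motives.IsSmoothProjective m X)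
    (hb : n + 2 * m = b + 2 * n) (s : smoothFiberLocus π n) {c : ℕ} (hc : 0 + 2 * m = c + 2 * n)
    (hnc : n + c = b)
    (hHL : Function.Bijective fun x : complexBetti X n =>
      cupProduct hnc x (complexGysin μ s.2 hX (Motives.fiberι π s.1 ≫ j) hc
        (singularCohomology.one ℂ (Motives.ComplexPoints (Motives.fiberOver π s.1))))) :
    IsCompl (vanishing π n j μ hX hb s)
      (LinearMap.range (complexBetti.map (Motives.fiberι π s.1 ≫ j) n).hom) :=
  localTubeSpan_lefschetzSplitting μ hμ hX hb s hc hnc hHL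

/-- COMPOSITION (cycle 5, wave 2): hypothesis (L) DISCHARGED from the tree's hard Lefschetz package for
hyperplane-section families of an `(n+1)`-fold — if the class `i_* 1 ∈ H²(X)` of the member is a
non-zero multiple of the hyperplane class of a `HardLefschetzNFold (n + 1) X` (a member of `|𝒪_X(d)|`
has class `d·[H]`; the structure exists for smooth projective `X` by `nonempty_hardLefschetzNFold_holds`),
then `Hⁿ(X_s) = Hⁿ(X_s)_van ⊕ i^*Hⁿ(X)` (`stub_lefschetzSplitting` + `…HardLefschetzMember`). -/
theorem isCompl_vanishing_of_hardLefschetz {X : Motives.SchemeOver ℂ} {j : 𝒳 ⟶ X}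
    (μ : OrientationFamily) (hμ : μ.HasPoincareDuality) (hX : Motives.IsSmoothProjective (n + 1) X)
    (s : smoothFiberLocus π n) (Λ : HardLefschetzNFold (n + 1) X) {c : ℂ} (hc : c ≠ 0)
    (hcls : complexGysin μ s.2 hX (Motives.fiberι π s.1 ≫ j) (show 0 + 2 * (n + 1) = 2 + 2 * n by omega)
        (singularCohomology.one ℂ (Motives.ComplexPoints (Motives.fiberOver π s.1))) =
      c • Λ.hyperplaneClass) :
    IsCompl (vanishing π n j μ hX (show n + 2 * (n + 1) = (n + 2) + 2 * n by omega) s)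
      (LinearMap.range (complexBetti.map (Motives.fiberι π s.1 ≫ j) n).hom) :=
  stub_lefschetzSplitting μ hμ hX _ s _ rfl
    (localTubeSpan_bijective_cup_of_hardLefschetz Λ hc hcls rfl)

end Cycle5Typed


section Cycle5Assembly

/-! ### Cycle 5 — COMPOSITIONS: the line's conclusions on the tree's hyperplane-section package

With the constructed `ℚ`-form `DirectImageLocalSystem.ratMonodromy` (Literature, p123063) and the
four landed stubs, the algebraic spine concludes TYPED statements over
`HyperplaneSectionLocalSystem` / `monodromyRepObj` / `localSubgroup` / `localKernelOn` /
`localKernel` (landed as `Theorems/LinearSystemTorelliLocalTubeSpanTypedAssembly.lean`): what a typed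
crux of the shape `LocalTubeSpanCFree(Balls)` (crux workfile `Lines/SketchTypedCandidate.lean`) needs
beyond these is the GEOMETRIC presentation of one local subgroup per small ball as a transvection
configuration of a covered type (+ the Lefschetz splitting for the vanishing carrier, + the named
facts off the unconditional types).  The companion file
`Theorems/LinearSystemTorelliLocalTubeSpanTypedInstances.lean` (p124019) states, in the same typed
form, the ISOLATED SINGULAR POINT (distinguished basis; unconditional) and ONE COMPLETE ORBIT (the
non-isolated members; conditional on `Schnell2010_lemma11`) — the typed coverage table of the line. -/

open Literature.AlgebraicGeometry Literature.AlgebraicTopology.SingularHomology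
open _root_.Topology Filter
open scoped TensorProduct

variable {𝒳 Sb : Motives.SchemeOver ℂ} {π : 𝒳 ⟶ Sb} {n : ℕ}

/-- COMPOSITION (cycle 5): cyclic detection over `ℂ` at `S ≤ π₁(U, s)` for `monodromyRepObj (D.V k) s`
⇔ over `ℚ` for the rational monodromy (`stub_ratTensorEquiv` + `…BaseChange`). -/
theorem injective_evalCoinv_res_iff_rat (D : DirectImageLocalSystem π n) (k : ℕ)
    (s : smoothFiberLocus π n) (S : Subgroup (FundamentalGroup (smoothFiberLocus π n) s)) :
    Function.Injective (evalCoinv (Rep.res S.subtype (Rep.of (D.ratMonodromy k s)))) ↔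
      Function.Injective (evalCoinv (Rep.res S.subtype (monodromyRepObj (D.V k) s))) := by
  obtain ⟨hfd, he⟩ := stub_ratTensorEquiv D k s (D.ratMonodromy k s) (D.ofRatClass_ratMonodromy k s)
  haveI : FiniteDimensional ℚ (Rep.res S.subtype (Rep.of (D.ratMonodromy k s))).V := hfd
  exact injective_evalCoinv_iff_of_tensorEquiv
    (Rep.res S.subtype (Rep.of (D.ratMonodromy k s))) (Rep.res S.subtype (monodromyRepObj (D.V k) s))
    ((ofRatClassBaseChangeEquiv s.2 k).trans (D.fiberIso k s).symm) fun g c x => he g c x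

/-- COMPOSITION (cycle 5): the SURROGATE CRUX at a local subgroup `S` of the hyperplane-section
family, from `ℚ`-cyclic detection at `S` (any covered configuration type presented on
`Hᵏ(X_s(ℂ); ℚ)`). -/
theorem LocalTubeSpanAt_monodromyRepObj_of_rat (D : DirectImageLocalSystem π n) (k : ℕ)
    (s : smoothFiberLocus π n) (S : Subgroup (FundamentalGroup (smoothFiberLocus π n) s))
    (hinj : Function.Injective (evalCoinv (Rep.res S.subtype (Rep.of (D.ratMonodromy k s))))) :
    LocalTubeSpanAt (monodromyRepObj (D.V k) s) S :=
  stub_kerEvalCoinvOn _ S ((injective_evalCoinv_res_iff_rat D k s S).1 hinj)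

variable {T : Type v} [TopologicalSpace T]

/-- COMPOSITION (cycle 5): the typed c-free local Schnell statement at a path-connected piece `N`
(`localKernelOn = ⨅ ker evalCoinvOn` over all view points) from `ℚ`-cyclic detection at ONE local
subgroup (`…OneViewPoint`). -/
theorem localKernelOn_eq_iInf_ker_of_rat (ι : C(smoothFiberLocus π n, T))
    (D : DirectImageLocalSystem π n) (k : ℕ) (s : smoothFiberLocus π n) (N : Set T)
    (hN : IsPathConnected (ι ⁻¹' N)) {s' : smoothFiberLocus π n} (hs' : ι s' ∈ N) (γ : Path s' s)
    (hinj : Function.Injective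
      (evalCoinv (Rep.res (localSubgroup ι s N hs' γ).subtype (Rep.of (D.ratMonodromy k s))))) :
    localKernelOn ι (D.V k) s N =
      ⨅ (s₂ : smoothFiberLocus π n) (hs₂ : ι s₂ ∈ N) (γ₂ : Path s₂ s),
        LinearMap.ker (evalCoinvOn (monodromyRepObj (D.V k) s) (localSubgroup ι s N hs₂ γ₂)) :=
  localKernelOn_eq_iInf_ker_of_one ι (D.V k) s N hN hs' γ
    (LocalTubeSpanAt_monodromyRepObj_of_rat D k s _ hinj)

/-- COMPOSITION (cycle 5): the NORMAL-CROSSING NODAL member, UNCONDITIONALLY on the tree's objects —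
one local subgroup at `N` generated by meridians acting on `Hᵏ(X_s(ℂ); ℚ)` as Picard–Lefschetz
transvections along mutually orthogonal non-zero cycles of a nondegenerate form ⇒ the typed statement
at `N` (`stub_ncNodal`). -/
theorem localKernelOn_eq_iInf_ker_of_ncNodal (ι : C(smoothFiberLocus π n, T))
    (D : DirectImageLocalSystem π n) (k : ℕ) (s : smoothFiberLocus π n) (N : Set T)
    (hN : IsPathConnected (ι ⁻¹' N)) {s' : smoothFiberLocus π n} (hs' : ι s' ∈ N) (γ : Path s' s)
    (B : LinearMap.BilinForm ℚ (Motives.bettiCohomology (Motives.fiberOver π s.1) k))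
    (hB : B.Nondegenerate) {m : ℕ} (t : Fin m → localSubgroup ι s N hs' γ)
    (ht : Subgroup.closure (Set.range t) = ⊤)
    (δ : Fin m → Motives.bettiCohomology (Motives.fiberOver π s.1) k) (hδ : ∀ i, δ i ≠ 0)
    (hPL : ∀ (i : Fin m) (x : Motives.bettiCohomology (Motives.fiberOver π s.1) k),
      D.ratMonodromy k s (t i : FundamentalGroup (smoothFiberLocus π n) s) x = x - B x (δ i) • δ i)
    (horth : ∀ i j, B (δ i) (δ j) = 0) :
    localKernelOn ι (D.V k) s N =
      ⨅ (s₂ : smoothFiberLocus π n) (hs₂ : ι s₂ ∈ N) (γ₂ : Path s₂ s),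
        LinearMap.ker (evalCoinvOn (monodromyRepObj (D.V k) s) (localSubgroup ι s N hs₂ γ₂)) := by
  refine localKernelOn_eq_iInf_ker_of_rat ι D k s N hN hs' γ ?_
  haveI : FiniteDimensional ℚ
      (Rep.res (localSubgroup ι s N hs' γ).subtype (Rep.of (D.ratMonodromy k s))).V :=
    (stub_ratTensorEquiv D k s (D.ratMonodromy k s) (D.ofRatClass_ratMonodromy k s)).1
  exact stub_ncNodal (Rep.res (localSubgroup ι s N hs' γ).subtype (Rep.of (D.ratMonodromy k s)))
    B hB t ht δ hδ (fun i x => hPL i x) horth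

/-- COMPOSITION (cycle 5): the colimit form at `t₀` (`localKernel`; the shape `LocalTubeSpanCFree`)
from `ℚ`-cyclic detection at the local subgroups of all small open balls (`stub_localKernelOfBalls`). -/
theorem mem_localKernel_of_rat_balls (ι : C(smoothFiberLocus π n, T))
    (D : DirectImageLocalSystem π n) (k : ℕ) (s : smoothFiberLocus π n) (t₀ : T)
    (hballs : ∃ N₀ ∈ 𝓝 t₀, ∀ N' ∈ 𝓝 t₀, N' ⊆ N₀ → IsOpen N' →
      ∀ (s' : smoothFiberLocus π n) (hs' : ι s' ∈ N') (γ : Path s' s),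
        Function.Injective (evalCoinv
          (Rep.res (localSubgroup ι s N' hs' γ).subtype (Rep.of (D.ratMonodromy k s)))))
    (ξ : groupCohomology.H1 (monodromyRepObj (D.V k) s))
    (hξ : ∃ N ∈ 𝓝 t₀, ∀ (s' : smoothFiberLocus π n) (hs' : ι s' ∈ N) (γ : Path s' s),
      evalCoinvOn (monodromyRepObj (D.V k) s) (localSubgroup ι s N hs' γ) ξ = 0) :
    ξ ∈ localKernel ι (D.V k) s t₀ := by
  obtain ⟨N₀, hN₀, h⟩ := hballs
  exact stub_localKernelOfBalls ι (D.V k) s t₀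
    ⟨N₀, hN₀, fun N' hN' hsub hopen s' hs' γ =>
      LocalTubeSpanAt_monodromyRepObj_of_rat D k s _ (h N' hN' hsub hopen s' hs' γ)⟩ ξ hξ

variable {X : Motives.SchemeOver ℂ} {j : 𝒳 ⟶ X}

/-- COMPOSITION (cycle 5): the SURROGATE CRUX at `S` for the VANISHING local system (the carrier of
the typed candidates), from `ℚ`-cyclic detection at `S` and the Lefschetz splitting
(`stub_vanishingTransfer`). -/
theorem LocalTubeSpanAt_vanishing_of_rat (D : HyperplaneSectionLocalSystem π n j)
    (μ : OrientationFamily) {m b : ℕ} (hX : Motives.IsSmoothProjective m X)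
    (hb : n + 2 * m = b + 2 * n) (s : smoothFiberLocus π n)
    (hcompl : IsCompl (vanishing π n j μ hX hb s)
      (LinearMap.range (complexBetti.map (Motives.fiberι π s.1 ≫ j) n).hom))
    (S : Subgroup (FundamentalGroup (smoothFiberLocus π n) s))
    (hinj : Function.Injective
      (evalCoinv (Rep.res S.subtype (Rep.of (D.toDirectImageLocalSystem.ratMonodromy n s))))) :
    LocalTubeSpanAt (monodromyRepObj (D.vanishingLocalSystem μ hX hb) s) S :=
  stub_kerEvalCoinvOn _ S ((stub_vanishingTransfer D μ hX hb s hcompl S).2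
    ((injective_evalCoinv_res_iff_rat D.toDirectImageLocalSystem n s S).1 hinj))

/-- COMPOSITION (cycle 5): the typed statement at a path-connected piece for the VANISHING local
system, from `ℚ`-cyclic detection at ONE local subgroup and the Lefschetz splitting. -/
theorem localKernelOn_vanishing_eq_iInf_ker_of_rat (ι : C(smoothFiberLocus π n, T))
    (D : HyperplaneSectionLocalSystem π n j) (μ : OrientationFamily) {m b : ℕ}
    (hX : Motives.IsSmoothProjective m X) (hb : n + 2 * m = b + 2 * n) (s : smoothFiberLocus π n)
    (hcompl : IsCompl (vanishing π n j μ hX hb s)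
      (LinearMap.range (complexBetti.map (Motives.fiberι π s.1 ≫ j) n).hom))
    (N : Set T) (hN : IsPathConnected (ι ⁻¹' N)) {s' : smoothFiberLocus π n} (hs' : ι s' ∈ N)
    (γ : Path s' s)
    (hinj : Function.Injective (evalCoinv (Rep.res (localSubgroup ι s N hs' γ).subtype
      (Rep.of (D.toDirectImageLocalSystem.ratMonodromy n s))))) :
    localKernelOn ι (D.vanishingLocalSystem μ hX hb) s N =
      ⨅ (s₂ : smoothFiberLocus π n) (hs₂ : ι s₂ ∈ N) (γ₂ : Path s₂ s),
        LinearMap.ker (evalCoinvOn (monodromyRepObj (D.vanishingLocalSystem μ hX hb) s)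
          (localSubgroup ι s N hs₂ γ₂)) :=
  localKernelOn_eq_iInf_ker_of_one ι (D.vanishingLocalSystem μ hX hb) s N hN hs' γ
    (LocalTubeSpanAt_vanishing_of_rat D μ hX hb s hcompl _ hinj)

/-- COMPOSITION (cycle 5): cyclic detection with a central element acting as `-1` — no arithmetic
input (`…NegOne`, companion of `stub_centralSplit`): e.g. Schnell's Prop. 12 for transvection groups
containing `-1` (A_{2g} clusters, `Sp_{2g}(ℤ)`, even-degree plane curves). -/
theorem injective_evalCoinv_of_central_neg {k G' : Type u} [Field k] [Group G'] (A' : Rep k G')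
    (z : G') (hz : ∀ g : G', g * z = z * g) (hneg : ∀ x : A'.V, A'.ρ z x = -x) (h2 : (2 : k) ≠ 0) :
    Function.Injective (evalCoinv A') :=
  localTubeSpan_injective_evalCoinv_of_central_neg A' z hz hneg h2

/-- COMPOSITION (cycle 5, FINAL TYPED SHAPE on the carrier of the typed candidates; landed as
`localTubeSpan_mem_localKernel_vanishing_of_rat_balls_one`, file `…TypedAssemblyVanishing`): for the
VANISHING local system of a hyperplane-section family — Lefschetz splitting (hypothesis (L), discharged
from hard Lefschetz by `isCompl_vanishing_of_hardLefschetz` when `[X_s] = c·[H]`) + path-connected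
punctured balls + `ℚ`-cyclic detection of the rational monodromy at ONE local subgroup per small ball
⇒ every class undetected near `t₀` lies in `localKernel` at `t₀`, i.e. `LocalTubeSpanCFree` at `t₀`.
What is left for a typed crux is hypothesis (G): the Picard–Lefschetz presentation of that one local
subgroup as a transvection configuration of a covered type (unconditional: NC-nodal, independent
cycles, orthogonal sub-configurations, |μ| ≤ 3 triangles, central `-1`; conditional on
`Schnell2010_lemma11` / `Janssen1983_thm2_9`: complete orbits with dependent generators). -/
theorem mem_localKernel_vanishing_of_rat_balls_one (ι : C(smoothFiberLocus π n, T))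
    (D : HyperplaneSectionLocalSystem π n j) (μ : OrientationFamily) {m b : ℕ}
    (hX : Motives.IsSmoothProjective m X) (hb : n + 2 * m = b + 2 * n) (s : smoothFiberLocus π n)
    (hcompl : IsCompl (vanishing π n j μ hX hb s)
      (LinearMap.range (complexBetti.map (Motives.fiberι π s.1 ≫ j) n).hom))
    (t₀ : T)
    (hballs : ∃ N₀ ∈ 𝓝 t₀, ∀ N' ∈ 𝓝 t₀, N' ⊆ N₀ → IsOpen N' →
      IsPathConnected (ι ⁻¹' N') ∧
        ∃ (s' : smoothFiberLocus π n) (hs' : ι s' ∈ N') (γ : Path s' s),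
          Function.Injective (evalCoinv (Rep.res (localSubgroup ι s N' hs' γ).subtype
            (Rep.of (D.toDirectImageLocalSystem.ratMonodromy n s)))))
    (ξ : groupCohomology.H1 (monodromyRepObj (D.vanishingLocalSystem μ hX hb) s))
    (hξ : ∃ N ∈ 𝓝 t₀, ∀ (s' : smoothFiberLocus π n) (hs' : ι s' ∈ N) (γ : Path s' s),
      evalCoinvOn (monodromyRepObj (D.vanishingLocalSystem μ hX hb) s)
        (localSubgroup ι s N hs' γ) ξ = 0) :
    ξ ∈ localKernel ι (D.vanishingLocalSystem μ hX hb) s t₀ :=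
  localTubeSpan_mem_localKernel_vanishing_of_rat_balls_one ι D μ hX hb s hcompl t₀ hballs ξ hξ

end Cycle5Assembly


/-! ## Cycle 6 (continuation lead c5) — REPAIR of the typed endpoint (neighbourhood BASIS), and Schnell's
Lemma 11 for DEGENERATE lattices from the nondegenerate case ("frames lift from the nondegenerate quotient")

(A) The cycle-5 "final typed shape" `localTubeSpan_mem_localKernel[_vanishing]_of_rat_balls_one` asks the
punctured preimages `ι⁻¹ N'` of ALL small open `N' ⊆ N₀` to be path connected — unsatisfiable (two disjoint
open pieces; PROVED: `localTubeSpan_not_forall_open_nhds_isPathConnected`, file `…TypedBasis`), and the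
all-view-points candidate `LocalTubeSpanCFreeBalls` quantifies over arbitrary small open `N'` whose local
subgroups (tiny ball + thin tubes around loops) are not local fundamental groups and may be THIN (`…ThinMu`).
The sound endpoint is the colimit form `LocalTubeSpanCFree`, proved along ONE neighbourhood basis:
`stub_hasBasisGlue` (file `…TypedBasis`: `localTubeSpan_mem_localKernel_of_hasBasis(_one)`,
`…_of_rat_hasBasis_one`, `…_vanishing_of_rat_hasBasis_one`).  `stub_stableLocalGroup`: under Milnor-type
stabilisation of the local subgroups along a basis the typed statement at `t₀` is EQUIVALENT to the
algebraic surrogate at the stable local group (faithfulness of the whole line); `stub_locTrivCharacterisation`: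
the route-facing dictionary `LocTriv(D)` = classes locally undetected element-wise at every point of `D`.

(B) Lead c4 left open whether `Schnell2010_lemma11` for the DEGENERATE lifted lattice (what
`…_of_completeOrbit` applies at the non-isolated members `Y₁ ∪ Y₂`) reduces to the nondegenerate one.  It
does, group-theoretically: `stub_quotientTransfer` (Lemma 11 downstairs on `V / ker B` ⇒ a frame modulo the
radical + finitely many cosets modulo frame-group·unipotents), `stub_frameLift` (lead: complete the lifted
frame by elements of `Δ`; the discrepancies `h⁻¹ T_δ^m` are the non-zero shears `x ↦ x - m⟨x, δ⟩ π_R δ`,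
whose conjugates span a full-rank lattice of `Hom(V/R, R)` by `stub_orbitSpan` + `stub_functionalOfAnnihilator`,
while the unipotent part of `Γ_Δ` is a lattice of at most that rank, `stub_shearLattice`; finite index by
equal ranks and `stub_indexBookkeeping`), composition `schnell2010_lemma11_of_nondegenerate :
(Lemma 11 for nondegenerate lattices) → Schnell2010_lemma11`.
-/

section Cycle6Arithmetic

/-- stub (cycle 6, worker): INDEX BOOKKEEPING (pure group theory).  For subgroups `H, N ≤ K` of a
group with `N` normalised by `K`: if `K` is covered by finitely many translates `c · H · N` and
`H ∩ N` has finite index in `N`, then `H` has finite index in `K`. -/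
theorem stub_indexBookkeeping {G : Type*} [Group G] (K H N : Subgroup G) (hH : H ≤ K) (hN : N ≤ K)
    (hnorm : ∀ k ∈ K, ∀ n ∈ N, k * n * k⁻¹ ∈ N)
    (C : Finset G) (hCK : ∀ c ∈ C, c ∈ K)
    (hC : ∀ g ∈ K, ∃ c ∈ C, ∃ h ∈ H, ∃ n ∈ N, g = c * h * n)
    (h2 : ((H ⊓ N).subgroupOf N).FiniteIndex) :
    (H.subgroupOf K).FiniteIndex :=
  -- LANDED p125368 (`…IndexBookkeeping`)
  localTubeSpan_indexBookkeeping K H N hH hN hnorm C hCK hC h2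

variable {V : Type} [AddCommGroup V] [Module ℚ V]

/-- stub (cycle 6, worker): ORBIT SPAN.  For a skew vanishing lattice `Δ` (alternating `B`, possibly
degenerate) and a finite-index subgroup `H ≤ Γ_Δ`, the `H`-orbit of any `δ₀ ∈ Δ` spans `V`
(powers `T_δ^m ∈ H` give `δ ∈ span (H·δ₀)` whenever `⟨δ₀, δ⟩ ≠ 0`, then propagate along the
non-orthogonality graph of `Δ`, which is connected because `Δ` is a single `Γ_Δ`-orbit). -/
theorem stub_orbitSpan (B : LinearMap.BilinForm ℚ V) (hB : B.IsAlt) (Δ : Set V)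
    (hΔ : IsSkewVanishingLattice B Δ) (H : Subgroup (V →ₗ[ℚ] V)ˣ)
    (hH : H ≤ transvectionGroup B Δ)
    (hfi : (H.subgroupOf (transvectionGroup B Δ)).FiniteIndex) (δ₀ : V) (hδ₀ : δ₀ ∈ Δ) :
    Submodule.span ℚ {x : V | ∃ h ∈ H, ((h : (V →ₗ[ℚ] V)ˣ) : V →ₗ[ℚ] V) δ₀ = x} = ⊤ :=
  -- LANDED p125469 (`…OrbitSpan`)
  localTubeSpan_orbitSpan B hB Δ hΔ H hH hfi δ₀ hδ₀

/-- stub (cycle 6, worker): FUNCTIONALS VANISHING ON THE RADICAL ARE `⟨·, v⟩` (finite-dimensional,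
alternating `B`; `ker B` is the radical): the range of `v ↦ B(·, v)` is the annihilator of `ker B`
(both have dimension `dim V - dim ker B`). -/
theorem stub_functionalOfAnnihilator [FiniteDimensional ℚ V] (B : LinearMap.BilinForm ℚ V)
    (hB : B.IsAlt) (φ : V →ₗ[ℚ] ℚ) (hφ : ∀ r ∈ LinearMap.ker B, φ r = 0) :
    ∃ v : V, ∀ x : V, φ x = B x v :=
  -- LANDED p125437 (`…FunctionalOfAnnihilator`)
  localTubeSpan_functionalOfAnnihilator B hB φ hφ

/-- stub (cycle 6, worker): THE SHEAR LATTICE.  For a finitely generated `ℤ`-submodule `Λ` spanning the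
finite-dimensional `ℚ`-space `V`, the endomorphisms `φ` with `im φ ⊆ ker B ⊆ ker φ` that preserve `Λ`
form a finitely generated free `ℤ`-module of rank at most `dim (V / ker B) · dim (ker B)` (it embeds in
`Hom_ℤ(Λ, Λ)` by restriction since `Λ` spans, and `ℤ`-independent elements are `ℚ`-independent in the
`ℚ`-space `{φ | im φ ⊆ ker B ⊆ ker φ} ≅ Hom(V / ker B, ker B)`). -/
theorem stub_shearLattice [FiniteDimensional ℚ V] (B : LinearMap.BilinForm ℚ V)
    (Λ : Submodule ℤ V) (hΛ : Λ.FG) (hΛspan : Submodule.span ℚ (Λ : Set V) = ⊤) :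
    ∃ N : Submodule ℤ (V →ₗ[ℚ] V),
      (∀ φ : V →ₗ[ℚ] V, φ ∈ N ↔
        ((∀ x, φ x ∈ LinearMap.ker B) ∧ (∀ r ∈ LinearMap.ker B, φ r = 0) ∧
          ∀ x ∈ Λ, φ x ∈ Λ)) ∧
      N.FG ∧ Module.Free ℤ N ∧
      Module.finrank ℤ N ≤
        Module.finrank ℚ (V ⧸ LinearMap.ker B) * Module.finrank ℚ (LinearMap.ker B) :=
  -- LANDED p125482 (`…ShearLattice`)
  localTubeSpan_shearLattice B Λ hΛ hΛspan

/-- stub (cycle 6, worker): QUOTIENT TRANSFER.  Schnell's Lemma 11 for NONDEGENERATE lattices,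
applied to the quotient `V / ker B` of a skew vanishing lattice by its radical (again a skew vanishing
lattice, nondegenerate), yields: lifts `δ₁, …, δ_r ∈ Δ` (`r = dim V / ker B`) of a frame, linearly
independent modulo the radical, and finitely many `c ∈ Γ_Δ` such that every `g ∈ Γ_Δ` agrees
modulo the radical with some `c · h`, `h` in the lifted frame group `Γ_{δ_•}` (finite index
downstairs, read through `Γ_Δ → Γ_{Δ̄}`). -/
theorem stub_quotientTransfer
    (hL11nd : ∀ (W : Type) [AddCommGroup W] [Module ℚ W] [FiniteDimensional ℚ W]
      (Bq : LinearMap.BilinForm ℚ W), Bq.IsAlt → Bq.Nondegenerate → ∀ Δq : Set W,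
      IsSkewVanishingLattice Bq Δq →
        ∃ (r : ℕ) (δ : Fin r → W), r = Module.finrank ℚ W ∧ (∀ i, δ i ∈ Δq) ∧
          LinearIndependent ℚ δ ∧
          ((transvectionGroup Bq (Set.range δ)).subgroupOf (transvectionGroup Bq Δq)).FiniteIndex)
    [FiniteDimensional ℚ V] (B : LinearMap.BilinForm ℚ V) (hB : B.IsAlt) (Δ : Set V)
    (hΔ : IsSkewVanishingLattice B Δ) :
    ∃ (r : ℕ) (δ : Fin r → V), r = Module.finrank ℚ (V ⧸ LinearMap.ker B) ∧ (∀ i, δ i ∈ Δ) ∧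
      LinearIndependent ℚ ((LinearMap.ker B).mkQ ∘ δ) ∧
      ∃ C : Finset (V →ₗ[ℚ] V)ˣ, (∀ c ∈ C, c ∈ transvectionGroup B Δ) ∧
        ∀ g ∈ transvectionGroup B Δ, ∃ c ∈ C, ∃ h ∈ transvectionGroup B (Set.range δ),
          ∀ x : V, (g : V →ₗ[ℚ] V) x - ((c * h : (V →ₗ[ℚ] V)ˣ) : V →ₗ[ℚ] V) x ∈ LinearMap.ker B :=
  -- LANDED p125642 (`…QuotientTransfer`)
  localTubeSpan_quotientTransfer hL11nd B hB Δ hΔ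

/-- stub (cycle 6, LEAD — the hardest): FRAME LIFT.  From the data of `stub_quotientTransfer` (a frame
modulo the radical whose lifted transvection group has, together with the unipotent elements of
`Γ_Δ`, finite index), Schnell's Lemma 11 holds for `(V, B, Δ)` itself: complete the lifted frame by
elements `δ_{r+j} ∈ Δ` to a basis; the discrepancies `h⁻¹ T_{δ_{r+j}}^m` are the shears
`x ↦ x - m ⟨x, δ_{r+j}⟩ π_R δ_{r+j}`; their conjugates span a lattice of shears of full rank
`dim(V/R)·dim R` (`stub_orbitSpan`, `stub_functionalOfAnnihilator`), the unipotent part of `Γ_Δ` is a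
lattice of at most that rank (`stub_shearLattice`), so the frame group meets it with finite index, and
`stub_indexBookkeeping` concludes. -/
theorem stub_frameLift [FiniteDimensional ℚ V] (B : LinearMap.BilinForm ℚ V) (hB : B.IsAlt)
    (Δ : Set V) (hΔ : IsSkewVanishingLattice B Δ) {r : ℕ} (δ : Fin r → V)
    (hr : r = Module.finrank ℚ (V ⧸ LinearMap.ker B)) (hδΔ : ∀ i, δ i ∈ Δ)
    (hli : LinearIndependent ℚ ((LinearMap.ker B).mkQ ∘ δ))
    (C : Finset (V →ₗ[ℚ] V)ˣ) (hC : ∀ c ∈ C, c ∈ transvectionGroup B Δ)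
    (hcos : ∀ g ∈ transvectionGroup B Δ, ∃ c ∈ C, ∃ h ∈ transvectionGroup B (Set.range δ),
      ∀ x : V, (g : V →ₗ[ℚ] V) x - ((c * h : (V →ₗ[ℚ] V)ˣ) : V →ₗ[ℚ] V) x ∈ LinearMap.ker B) :
    ∃ (r' : ℕ) (δ' : Fin r' → V), r' = Module.finrank ℚ V ∧ (∀ i, δ' i ∈ Δ) ∧
      LinearIndependent ℚ δ' ∧
      ((transvectionGroup B (Set.range δ')).subgroupOf (transvectionGroup B Δ)).FiniteIndex :=
  -- LANDED p126002 (`…FrameLift`)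
  localTubeSpan_frameLift B hB Δ hΔ δ hr hδΔ hli C hC hcos

/-- COMPOSITION (cycle 6): **Schnell's Lemma 11 for arbitrary (possibly degenerate) skew vanishing
lattices follows from its nondegenerate case** — so every theorem of this line that grants
`Schnell2010_lemma11` (complete orbits with radical = the non-isolated members `Y₁ ∪ Y₂`, clusters,
capstones) holds granting only the nondegenerate Lemma 11, the case of Schnell's own setting
(vanishing cohomology, nondegenerate intersection form). -/
theorem schnell2010_lemma11_of_nondegenerate
    (hL11nd : ∀ (W : Type) [AddCommGroup W] [Module ℚ W] [FiniteDimensional ℚ W]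
      (Bq : LinearMap.BilinForm ℚ W), Bq.IsAlt → Bq.Nondegenerate → ∀ Δq : Set W,
      IsSkewVanishingLattice Bq Δq →
        ∃ (r : ℕ) (δ : Fin r → W), r = Module.finrank ℚ W ∧ (∀ i, δ i ∈ Δq) ∧
          LinearIndependent ℚ δ ∧
          ((transvectionGroup Bq (Set.range δ)).subgroupOf (transvectionGroup Bq Δq)).FiniteIndex) :
    Schnell2010_lemma11 := by
  intro W _ _ _ B hB Δ hΔ
  obtain ⟨r, δ, hr, hδΔ, hli, C, hC, hcos⟩ := stub_quotientTransfer hL11nd B hB Δ hΔ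
  exact stub_frameLift B hB Δ hΔ δ hr hδΔ hli C hC hcos

end Cycle6Arithmetic

section Cycle6Typed

open _root_.Topology Filter

variable {k S : Type u} [CommRing k] [TopologicalSpace S] {T : Type v} [TopologicalSpace T]
  (ι : C(S, T)) (V : Literature.AlgebraicGeometry.Motives.LocalSystem k S) (s : S)

/-- stub (cycle 6, lead; PROVED in work/TypedBasis.lean, proposal p125024 — HasBasis glue): the colimit
form at `t₀` from the surrogate at ONE view point per basic set of a neighbourhood basis whose basic
sets have path-connected preimages. -/
theorem stub_hasBasisGlue {ι' : Sort*} {p : ι' → Prop} {b : ι' → Set T} {t₀ : T}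
    (hb : (𝓝 t₀).HasBasis p b)
    (hsur : ∀ i, p i → IsPathConnected (ι ⁻¹' b i) ∧
      ∃ (s' : S) (hs' : ι s' ∈ b i) (γ : Path s' s),
        LinearMap.ker (evalCoinvOn (monodromyRepObj V s) (localSubgroup ι s (b i) hs' γ)) =
          H1resKer (monodromyRepObj V s) (localSubgroup ι s (b i) hs' γ))
    (ξ : groupCohomology.H1 (monodromyRepObj V s))
    (hξ : ∃ N ∈ 𝓝 t₀, ∀ (s' : S) (hs' : ι s' ∈ N) (γ : Path s' s),
      evalCoinvOn (monodromyRepObj V s) (localSubgroup ι s N hs' γ) ξ = 0) :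
    ξ ∈ localKernel ι V s t₀ :=
  -- LANDED p125024 (`…TypedBasis`)
  localTubeSpan_mem_localKernel_of_hasBasis_one ι V s hb hsur ξ hξ

/-- stub (cycle 6, worker): THE ROUTE-FACING DICTIONARY.  Granting the c-free local Schnell statement
in colimit form at every point of `D` (the crux, typed as `LocalTubeSpanCFree`), the locally trivial
classes along `D` (`LocTriv`, the part of `H¹` no local fundamental group at `D` sees) are EXACTLY the
classes that are locally UNDETECTED element-wise at every point of `D` (all local tube periods vanish):
divisor-visibility becomes decidable element by element. -/
theorem stub_locTrivCharacterisation (D : Set T)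
    (hcfree : ∀ t₀ ∈ D, ∀ ξ : groupCohomology.H1 (monodromyRepObj V s),
      (∃ N ∈ 𝓝 t₀, ∀ (s' : S) (hs' : ι s' ∈ N) (γ : Path s' s),
        evalCoinvOn (monodromyRepObj V s) (localSubgroup ι s N hs' γ) ξ = 0) →
      ξ ∈ localKernel ι V s t₀)
    (ξ : groupCohomology.H1 (monodromyRepObj V s)) :
    ξ ∈ locallyTrivialClasses ι V s D ↔
      ∀ t₀ ∈ D, ∃ N ∈ 𝓝 t₀, ∀ (s' : S) (hs' : ι s' ∈ N) (γ : Path s' s),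
        evalCoinvOn (monodromyRepObj V s) (localSubgroup ι s N hs' γ) ξ = 0 :=
  -- LANDED p125352 (`…LocTrivCharacterisation`)
  localTubeSpan_locTrivCharacterisation ι V s D hcfree ξ

/-- stub (cycle 6, worker): FAITHFULNESS OF THE SURROGATE UNDER STABILISATION.  If along a
neighbourhood basis of `t₀` the basic sets have path-connected preimages and one local subgroup per
basic set EQUALS a fixed subgroup `S₀` (Milnor's conic structure: the local fundamental groups of small
balls coincide in `π₁(U, s)`), then the c-free local Schnell statement at `t₀` in colimit form holds
IF AND ONLY IF the algebraic surrogate `ker (evalCoinvOn A S₀) = H1resKer A S₀` holds at `S₀`. -/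
theorem stub_stableLocalGroup {ι' : Sort*} {p : ι' → Prop} {b : ι' → Set T} {t₀ : T}
    (hb : (𝓝 t₀).HasBasis p b) (S₀ : Subgroup (FundamentalGroup S s))
    (hstable : ∀ i, p i → IsPathConnected (ι ⁻¹' b i) ∧
      ∃ (s' : S) (hs' : ι s' ∈ b i) (γ : Path s' s), localSubgroup ι s (b i) hs' γ = S₀) :
    (∀ ξ : groupCohomology.H1 (monodromyRepObj V s),
      (∃ N ∈ 𝓝 t₀, ∀ (s' : S) (hs' : ι s' ∈ N) (γ : Path s' s),
        evalCoinvOn (monodromyRepObj V s) (localSubgroup ι s N hs' γ) ξ = 0) →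
      ξ ∈ localKernel ι V s t₀) ↔
    LinearMap.ker (evalCoinvOn (monodromyRepObj V s) S₀) = H1resKer (monodromyRepObj V s) S₀ :=
  -- LANDED p125399 (`…StableLocalGroup`)
  localTubeSpan_stableLocalGroup ι V s hb S₀ hstable

end Cycle6Typed


/-! ## Cycle 7 (continuation lead c6) — ONE NAMED FACT: Janssen's Theorem 2.9 from Theorem 2.5

After cycle 6 the line's arithmetic input is exactly Janssen's Theorems 2.5 (`Janssen1983_thm2_5`, =
[Schnell2010] Thm. 10: `Γ_Δ ⊇ Sp♯₂(ℤΔ)`) and 2.9 (`Janssen1983_thm2_9`: `x ∈ Δ ↔ x` unimodular and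
`x ≡ δ (mod 2ℤΔ)`), the latter entering through the STAR BASIS (`…StarBasis`) and the radical
COMPANIONS `δ + 2β` (`IsSkewVanishingLattice.add_two_smul_mem`).  Cycle 7 removes Theorem 2.9:

* `stub_sp2Elementary` — granting Theorem 2.5, the two ELEMENTARY families of the level-2 congruence
  subgroup lie in `Γ_Δ`: the squares `T_a²  (x ↦ x - 2⟨x, a⟩a)` of the transvections along ALL lattice
  vectors `a ∈ ℤΔ`, and the squared transvection pairs `E_{e,f}² (x ↦ x + 2(⟨x,e⟩f + ⟨x,f⟩e))`,
  `e, f ∈ ℤΔ`, `⟨e, f⟩ = 0` (both are `1 + 2N` with `N` integral of rank ≤ 2, isometries, and satisfy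
  Schnell's displayed `Sp♯₂` condition `l(gx - x) = 2⟨v, x⟩`).
* `stub_companion` — from these two families alone: `δ ∈ Δ`, `⟨δ, y⟩ = 1`, `z ∈ ℤΔ` with `⟨z, y⟩ = 0`
  ⟹ `δ + 2z ∈ Δ` (`E_{y,w}²` then `T_y^{-2β}`, `z = βy + w`).  This covers BOTH uses of Theorem 2.9 in
  the line: `stub_starBasisOfCompanions` (the star basis) and the radical companions; hence
  `stub_lemma11OfStarBasis` + cycle 6 give `Janssen1983_thm2_5 → Schnell2010_lemma11`
  (composition `schnell2010_lemma11_of_thm2_5`).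
* THE HARDEST (lead): `stub_unimodularTransitivity` — the two elementary families act TRANSITIVELY on
  the unimodular vectors of each class modulo `2ℤΔ`: Euclid on the pair (`⟨t, y⟩` odd, `⟨z, x⟩`) by
  `T_y^{±2}`, `T_x^{±2}` (`stub_euclidGame`), the sign by the word `T_x²T_y²T_{x+y}² = -1` on a
  unimodular plane (`stub_planeCalculus`), the orthogonal part by one `E_{y,w}²`, and a common factor of
  the pair broken through the orthogonal part by a coprime shift (`stub_coprimeShift`).  Hence
  `janssen_thm2_9_of_thm2_5 : Janssen1983_thm2_5 → Janssen1983_thm2_9` — THE LINE RESTS ON JANSSEN'S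
  THEOREM 2.5 ALONE (the one theorem [Schnell2010] itself cites as Thm. 10).
-/

section Cycle7OneFact

variable {V : Type} [AddCommGroup V] [Module ℚ V]

/-- stub (cycle 7, worker A): THE ELEMENTARY LEVEL-2 ELEMENTS ARE MONODROMY, granting Janssen's
Theorem 2.5.  For a skew vanishing lattice `Δ` (alternating `B`, finite-dimensional `V`): (i) for
`e, f ∈ ℤΔ` with `⟨e, f⟩ = 0` some `g ∈ Γ_Δ` acts as `x ↦ x + 2(⟨x,e⟩f + ⟨x,f⟩e)`; (ii) for `a ∈ ℤΔ`
some `g ∈ Γ_Δ` acts as `T_a²`, `x ↦ x - 2⟨x,a⟩a`.  (Each is a unit `1 + 2N`, `N² = 0`, an isometry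
preserving `ℤΔ` both ways, with `l(gx - x) = 2 B v x` for `v = -(l f • e + l e • f)` resp. `v = l a • a`;
Theorem 2.5 puts it in `Γ_Δ`.) -/
theorem stub_sp2Elementary (h25 : Janssen1983_thm2_5) [FiniteDimensional ℚ V]
    (B : LinearMap.BilinForm ℚ V) (hB : B.IsAlt) (Δ : Set V) (hΔ : IsSkewVanishingLattice B Δ) :
    (∀ e ∈ Submodule.span ℤ Δ, ∀ f ∈ Submodule.span ℤ Δ, B e f = 0 →
      ∃ g ∈ transvectionGroup B Δ, ∀ x : V,
        ((g : (V →ₗ[ℚ] V)ˣ) : V →ₗ[ℚ] V) x = x + (2 : ℚ) • (B x e • f + B x f • e)) ∧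
    (∀ a ∈ Submodule.span ℤ Δ, ∃ g ∈ transvectionGroup B Δ, ∀ x : V,
        ((g : (V →ₗ[ℚ] V)ˣ) : V →ₗ[ℚ] V) x = x - (2 : ℚ) • (B x a • a)) :=
  -- LANDED p127855 (`…Sp2Elementary`)
  localTubeSpan_sp2Elementary h25 B hB Δ hΔ

/-- stub (cycle 7, worker B): COMPANIONS FROM THE ELEMENTARY FAMILIES.  If a subgroup-worth of moves
`x ↦ x + 2(⟨x,e⟩f + ⟨x,f⟩e)` (`⟨e,f⟩ = 0`) and `T_a²` (`e, f, a ∈ ℤΔ`) is available inside `Γ_Δ`, then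
for `δ ∈ Δ` with a partner `y ∈ ℤΔ`, `⟨δ, y⟩ = 1`, and any `z ∈ ℤΔ` orthogonal to `y`, the companion
`δ + 2z` lies in `Δ` (`z = βy + w`, `w ⟂ δ, y`; `E_{y,w}² δ = δ + 2w`, then `T_y^{∓2}` `|β|` times;
`Δ` is `Γ_Δ`-stable). -/
theorem stub_companion (B : LinearMap.BilinForm ℚ V) (hB : B.IsAlt) (Δ : Set V)
    (hΔ : IsSkewVanishingLattice B Δ)
    (hpair : ∀ e ∈ Submodule.span ℤ Δ, ∀ f ∈ Submodule.span ℤ Δ, B e f = 0 →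
      ∃ g ∈ transvectionGroup B Δ, ∀ x : V,
        ((g : (V →ₗ[ℚ] V)ˣ) : V →ₗ[ℚ] V) x = x + (2 : ℚ) • (B x e • f + B x f • e))
    (hsq : ∀ a ∈ Submodule.span ℤ Δ, ∃ g ∈ transvectionGroup B Δ, ∀ x : V,
        ((g : (V →ₗ[ℚ] V)ˣ) : V →ₗ[ℚ] V) x = x - (2 : ℚ) • (B x a • a))
    {δ y z : V} (hδ : δ ∈ Δ) (hy : y ∈ Submodule.span ℤ Δ) (hδy : B δ y = 1)
    (hz : z ∈ Submodule.span ℤ Δ) (hzy : B z y = 0) :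
    δ + (2 : ℚ) • z ∈ Δ :=
  -- LANDED p127733 (`…Companion`)
  localTubeSpan_companion B hB Δ hΔ hpair hsq hδ hy hδy hz hzy

/-- stub (cycle 7, worker C): A STAR BASIS FROM COMPANIONS — `localTubeSpan_exists_starBasis` with the
named fact `Janssen1983_thm2_9` replaced by the companion property it actually uses. -/
theorem stub_starBasisOfCompanions [FiniteDimensional ℚ V] (B : LinearMap.BilinForm ℚ V)
    (hB : B.IsAlt) (Δ : Set V) (hΔ : IsSkewVanishingLattice B Δ)
    (hcomp : ∀ δ ∈ Δ, ∀ y ∈ Submodule.span ℤ Δ, B δ y = 1 →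
      ∀ z ∈ Submodule.span ℤ Δ, B z y = 0 → δ + (2 : ℚ) • z ∈ Δ) :
    ∃ (r : ℕ) (δ : Fin r → V) (i₀ : Fin r), r = Module.finrank ℚ V ∧ (∀ i, δ i ∈ Δ) ∧
      LinearIndependent ℚ δ ∧ ∀ i, i ≠ i₀ → B (δ i) (δ i₀) = 1 :=
  -- LANDED p127639 (`…StarBasisOfCompanions`)
  localTubeSpan_exists_starBasis_of_companions B hB Δ hΔ hcomp

/-- stub (cycle 7, worker D): SCHNELL'S LEMMA 11 (NONDEGENERATE) FROM THEOREM 2.5 AND STAR BASES —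
`localTubeSpan_schnell2010_lemma11_nondegenerate_of_janssen` with its only use of Theorem 2.9 (the star
basis) abstracted into a hypothesis. -/
theorem stub_lemma11OfStarBasis (h25 : Janssen1983_thm2_5)
    (hSB : ∀ (W : Type) [AddCommGroup W] [Module ℚ W] [FiniteDimensional ℚ W]
      (Bq : LinearMap.BilinForm ℚ W), Bq.IsAlt → ∀ Δq : Set W, IsSkewVanishingLattice Bq Δq →
        ∃ (r : ℕ) (δ : Fin r → W) (i₀ : Fin r), r = Module.finrank ℚ W ∧ (∀ i, δ i ∈ Δq) ∧
          LinearIndependent ℚ δ ∧ ∀ i, i ≠ i₀ → Bq (δ i) (δ i₀) = 1) :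
    Schnell2010_lemma11_nondegenerate :=
  -- LANDED p127632 (`…Lemma11OfStarBasis`)
  localTubeSpan_schnell2010_lemma11_nondegenerate_of_starBasis h25 hSB

/-- stub (cycle 7, worker F): COPRIME SHIFT (pure arithmetic).  If `U A + 2 W β + j = 1` with `A` odd
and `β, j ≠ 0`, then `A + 2 s j` is coprime to `β` for some integer `s` (no prime divides `A, β, 2j`
simultaneously; take `s = ∏ p` over the primes `p ∣ β` with `p ∤ A`; cf. the tree's
`Literature.NumberTheory.EllipticCurves.ModularForms.exists_isCoprime_add_mul` with `d = 0`). -/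
theorem stub_coprimeShift (A β j U W : ℤ) (hA : Odd A) (hrel : U * A + 2 * W * β + j = 1)
    (hβ : β ≠ 0) (hj : j ≠ 0) :
    ∃ s : ℤ, IsCoprime (A + s * (2 * j)) β :=
  -- LANDED p127872 (`…CoprimeShift`)
  localTubeSpan_coprimeShift A β j U W hA hrel hβ hj

/-- stub (cycle 7, worker G): THE EUCLID GAME (pure arithmetic).  A predicate on pairs of integers
that is invariant under `β ↦ β + kA` and `A ↦ A + 4kβ` and holds at `(1, 0)` and `(-1, 0)` holds at
every coprime pair with `A` odd (strong induction on `|β|`: a residue of `A` modulo `4β` in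
`(-2|β|, 2|β|)` — odd, so `≠ ±2|β|` — then a centred residue of `β` modulo the new `A`). -/
theorem stub_euclidGame (P : ℤ → ℤ → Prop)
    (h1 : ∀ A β k : ℤ, P A β → P A (β + k * A))
    (h2 : ∀ A β k : ℤ, P A β → P (A + 4 * k * β) β)
    (hone : P 1 0) (hneg : P (-1) 0)
    (A β : ℤ) (hA : Odd A) (hcop : IsCoprime A β) : P A β :=
  -- LANDED p127835 (`…EuclidGame`)
  localTubeSpan_euclidGame P h1 h2 hone hneg A β hA hcop

/-- stub (cycle 7, worker H): PLANE CALCULUS.  (i) For `⟨x, y⟩ = 1` the word `T_x² T_y² T_{x+y}²`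
acts as `-1` on the plane `ℚx ⊕ ℚy` and as the identity on its orthogonal complement:
`v ↦ v - 2(⟨v,y⟩x - ⟨v,x⟩y)`; (ii) powers of a unit acting as `T_a²`: `g^m v = v - 2m⟨v,a⟩a`,
`g^{-m} v = v + 2m⟨v,a⟩a`. -/
theorem stub_planeCalculus (B : LinearMap.BilinForm ℚ V) (hB : B.IsAlt) :
    (∀ x y : V, B x y = 1 → ∀ v : V,
      skewTransvection B x (skewTransvection B x (skewTransvection B y (skewTransvection B y
        (skewTransvection B (x + y) (skewTransvection B (x + y) v))))) =
        v - (2 : ℚ) • (B v y • x - B v x • y)) ∧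
    (∀ (a : V) (g : (V →ₗ[ℚ] V)ˣ),
      (∀ v, ((g : (V →ₗ[ℚ] V)ˣ) : V →ₗ[ℚ] V) v = v - (2 : ℚ) • (B v a • a)) →
      ∀ (m : ℕ) (v : V),
        (((g ^ m : (V →ₗ[ℚ] V)ˣ)) : V →ₗ[ℚ] V) v = v - (2 * m : ℚ) • (B v a • a) ∧
        (((g⁻¹ ^ m : (V →ₗ[ℚ] V)ˣ)) : V →ₗ[ℚ] V) v = v + (2 * m : ℚ) • (B v a • a)) :=
  -- LANDED p127778 (`…PlaneCalculus`)
  localTubeSpan_planeCalculus B hB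

/-- stub (cycle 7, LEAD — the hardest): UNIMODULAR TRANSITIVITY OF THE LEVEL-2 ELEMENTARY MOVES.  Let
`Γ ≤ GL(V)` contain, for the lattice `Λ = ℤΔ` on which the alternating form `B` is integral, a move
`x ↦ x + 2(⟨x,e⟩f + ⟨x,f⟩e)` for all `e, f ∈ Λ` with `⟨e,f⟩ = 0` and a move `T_a²` for all `a ∈ Λ`.  If
`x, y ∈ Λ` with `⟨x, y⟩ = 1`, then every `t ∈ x + 2Λ` that is unimodular (`⟨t, y'⟩ = 1` for some
`y' ∈ Λ`) is `g x` for some `g ∈ Γ`.  (Coordinates `A = ⟨t,y⟩` odd, `β = ⟨z,x⟩`, `2w = t - ⟨t,y⟩x +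
⟨t,x⟩y`; `T_y^{2k}`: `β ↦ β ± kA`; `T_x^{2k}`: `A ↦ A ∓ 4kβ`; coprime `(A, β)` ⇒ `(±1, 0)` by
`stub_euclidGame`, sign by `stub_planeCalculus`, then `E_{y,w}²`; a common factor of `(A, β)` is broken by
`E_{x, s w₁}²: A ↦ A + 2s⟨t, w₁⟩` with `s` from `stub_coprimeShift`, after `E_{y,w₁}²` has made
`β ≠ 0` if necessary.) -/
theorem stub_unimodularTransitivity (B : LinearMap.BilinForm ℚ V) (hB : B.IsAlt) (Δ : Set V)
    (hint : ∀ δ ∈ Δ, ∀ δ' ∈ Δ, ∃ n : ℤ, B δ δ' = n)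
    (Γ : Subgroup (V →ₗ[ℚ] V)ˣ)
    (hpair : ∀ e ∈ Submodule.span ℤ Δ, ∀ f ∈ Submodule.span ℤ Δ, B e f = 0 →
      ∃ g ∈ Γ, ∀ x : V, ((g : (V →ₗ[ℚ] V)ˣ) : V →ₗ[ℚ] V) x = x + (2 : ℚ) • (B x e • f + B x f • e))
    (hsq : ∀ a ∈ Submodule.span ℤ Δ, ∃ g ∈ Γ, ∀ x : V,
        ((g : (V →ₗ[ℚ] V)ˣ) : V →ₗ[ℚ] V) x = x - (2 : ℚ) • (B x a • a))
    {x y : V} (hx : x ∈ Submodule.span ℤ Δ) (hy : y ∈ Submodule.span ℤ Δ) (hxy : B x y = 1)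
    {t : V} (ht : ∃ z ∈ Submodule.span ℤ Δ, t = x + (2 : ℚ) • z)
    (htu : ∃ y' ∈ Submodule.span ℤ Δ, B t y' = 1) :
    ∃ g ∈ Γ, ((g : (V →ₗ[ℚ] V)ˣ) : V →ₗ[ℚ] V) x = t :=
  -- LANDED p128888 + p129289 (`…UnimodularTransitivityLemmas`, `…UnimodularTransitivity`)
  localTubeSpan_unimodularTransitivity B hB Δ hint Γ hpair hsq hx hy hxy ht htu

/-- COMPOSITION (cycle 7): the companion property of a skew vanishing lattice, granting Theorem 2.5
only. -/
theorem companion_of_thm2_5 (h25 : Janssen1983_thm2_5) [FiniteDimensional ℚ V]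
    (B : LinearMap.BilinForm ℚ V) (hB : B.IsAlt) (Δ : Set V) (hΔ : IsSkewVanishingLattice B Δ) :
    ∀ δ ∈ Δ, ∀ y ∈ Submodule.span ℤ Δ, B δ y = 1 →
      ∀ z ∈ Submodule.span ℤ Δ, B z y = 0 → δ + (2 : ℚ) • z ∈ Δ := by
  obtain ⟨hpair, hsq⟩ := stub_sp2Elementary h25 B hB Δ hΔ
  intro δ hδ y hy hδy z hz hzy
  exact stub_companion B hB Δ hΔ hpair hsq hδ hy hδy hz hzy

/-- COMPOSITION (cycle 7): **Schnell's Lemma 11 from Janssen's Theorem 2.5 ALONE** (nondegenerate case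
by `stub_lemma11OfStarBasis` on star bases from companions; general case by cycle 6's frame lift). -/
theorem schnell2010_lemma11_of_thm2_5 (h25 : Janssen1983_thm2_5) : Schnell2010_lemma11 :=
  localTubeSpan_schnell2010_lemma11_of_nondegenerate
    (stub_lemma11OfStarBasis h25 fun W _ _ _ Bq hBq Δq hΔq =>
      stub_starBasisOfCompanions (V := W) Bq hBq Δq hΔq (companion_of_thm2_5 h25 Bq hBq Δq hΔq))

/-- A skew vanishing lattice spans a finite-dimensional space (`ℤΔ` is finitely generated and `Δ`
spans). -/
theorem finiteDimensional_of_isSkewVanishingLattice (B : LinearMap.BilinForm ℚ V) (Δ : Set V)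
    (hΔ : IsSkewVanishingLattice B Δ) : FiniteDimensional ℚ V := by
  obtain ⟨S, hS⟩ := hΔ.fg
  refine Module.finite_def.2 ⟨S, ?_⟩
  have h1 : Submodule.span ℚ (S : Set V) =
      Submodule.span ℚ (Submodule.span ℤ (S : Set V) : Set V) :=
    (Submodule.span_span_of_tower ℤ ℚ (S : Set V)).symm
  rw [h1, hS, Submodule.span_span_of_tower, hΔ.span_eq_top]

/-- COMPOSITION (cycle 7, the cycle's headline): **Janssen's Theorem 2.9 follows from Theorem 2.5.**
(`⇒`: a partner `gδ₂` from the pair `⟨δ₁, δ₂⟩ = 1` and transitivity, `z = 0`; `⇐`: unimodular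
transitivity of the elementary level-2 moves, available in `Γ_Δ` by Theorem 2.5, from `δ` to
`x = δ + 2z`, then `Γ_Δ`-stability of `Δ`.) -/
theorem janssen_thm2_9_of_thm2_5 (h25 : Janssen1983_thm2_5) : Janssen1983_thm2_9 := by
  intro W _ _ B hB Δ hΔ x hx
  haveI : FiniteDimensional ℚ W := finiteDimensional_of_isSkewVanishingLattice B Δ hΔ
  constructor
  · intro hxΔ
    obtain ⟨δ₁, hδ₁, δ₂, hδ₂, h12⟩ := hΔ.exists_pair
    obtain ⟨g, hg, hgx⟩ := hΔ.transitive δ₁ hδ₁ x hxΔ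
    refine ⟨⟨((g : (W →ₗ[ℚ] W)ˣ) : W →ₗ[ℚ] W) δ₂,
      localTubeSpan_transvectionGroup_map_span_int B hB Δ hΔ.integral hg (Submodule.subset_span hδ₂),
      ?_⟩, x, hxΔ, 0, Submodule.zero_mem _, by rw [sub_self, smul_zero]⟩
    rw [← hgx, localTubeSpan_transvectionGroup_isometry B hB Δ hg, h12]
  · rintro ⟨⟨y', hy', hxy'⟩, δ, hδ, z, hz, hxδ⟩
    obtain ⟨hpair, hsq⟩ := stub_sp2Elementary h25 B hB Δ hΔ
    -- a partner of `δ` inside `ℤΔ`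
    obtain ⟨δ₁, hδ₁, δ₂, hδ₂, h12⟩ := hΔ.exists_pair
    obtain ⟨g, hg, hgδ⟩ := hΔ.transitive δ₁ hδ₁ δ hδ
    have hy : ((g : (W →ₗ[ℚ] W)ˣ) : W →ₗ[ℚ] W) δ₂ ∈ Submodule.span ℤ Δ :=
      localTubeSpan_transvectionGroup_map_span_int B hB Δ hΔ.integral hg (Submodule.subset_span hδ₂)
    have hδy : B δ (((g : (W →ₗ[ℚ] W)ˣ) : W →ₗ[ℚ] W) δ₂) = 1 := by
      rw [← hgδ, localTubeSpan_transvectionGroup_isometry B hB Δ hg, h12]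
    have ht : ∃ z ∈ Submodule.span ℤ Δ, x = δ + (2 : ℚ) • z :=
      ⟨z, hz, by rw [two_smul, ← two_nsmul, ← hxδ, add_sub_cancel]⟩
    obtain ⟨g', hg', hg'δ⟩ := stub_unimodularTransitivity B hB Δ hΔ.integral (transvectionGroup B Δ)
      hpair hsq (Submodule.subset_span hδ) hy hδy ht ⟨y', hy', hxy'⟩
    rw [← hg'δ]
    exact hΔ.stable g' hg' δ hδ

/-- COMPOSITION (cycle 7): the line's arithmetic input after cycle 7 — Schnell's Lemma 11 and
Janssen's Theorem 2.9 both from Theorem 2.5; e.g. cycle 6's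
`localTubeSpan_cfree_at_of_completeOrbitBasis_of_janssen h25 (janssen_thm2_9_of_thm2_5 h25)`. -/
example (h25 : Janssen1983_thm2_5) : Schnell2010_lemma11 ∧ Janssen1983_thm2_9 :=
  ⟨schnell2010_lemma11_of_thm2_5 h25, janssen_thm2_9_of_thm2_5 h25⟩

/-! ### Landed compositions (file `…OneFact`, p129433) and wave 2

The skeleton's compositions above are landed verbatim in `Theorems/…OneFact`:
`localTubeSpan_companion_of_thm2_5`, `localTubeSpan_add_two_smul_mem_of_thm2_5` (radical companions,
the shape of `IsSkewVanishingLattice.add_two_smul_mem`, from 2.5),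
`localTubeSpan_schnell2010_lemma11_nondegenerate_of_thm2_5`, `localTubeSpan_schnell2010_lemma11_of_thm2_5`,
`localTubeSpan_janssen_thm2_9_of_thm2_5`, `localTubeSpan_lemma11_and_thm2_9_of_thm2_5`,
`localTubeSpan_eq_of_span_eq_of_shadow_eq` (a skew vanishing lattice is determined by `ℤΔ`, `B` and its
image in `ℤΔ/2ℤΔ`, granting 2.5), and the cycle-6 capstone granting 2.5 ONLY,
`localTubeSpan_cfree_at_of_completeOrbitBasis_of_thm2_5`.  Wave 2: `localTubeSpan_janssen_thm2_5_of_finrank_eq_two`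
(file `…RankTwoJanssen`, p128991) — Janssen's Theorem 2.5 UNCONDITIONALLY in rank 2, in the strong form
"every isometry preserving `ℤΔ` is monodromy" (`SL₂(ℤ) = ⟨T_{δ₁}, T_{δ₂}⟩`). -/

/-- The landed headline, by name. -/
example (h25 : Janssen1983_thm2_5) : Schnell2010_lemma11 ∧ Janssen1983_thm2_9 :=
  localTubeSpan_lemma11_and_thm2_9_of_thm2_5 h25

end Cycle7OneFact


/-! ## Cycle 8 (continuation lead c7) — DISCHARGING JANSSEN: Theorem 2.9 UNCONDITIONALLY, Lemma 2.7, and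
Theorem 2.5 reduced to its residual (stabiliser) form

After cycle 7 the line rests on `Janssen1983_thm2_5` alone (`Γ_Δ ⊇ Sp♯₂(ℤΔ)`).  Cycle 8 attacks the
fact itself.  Write `M = ℤΔ`, `Γ = Γ_Δ`, `K = Sp♯₂(M)` (the four hypotheses of `Janssen1983_thm2_5` on a
unit `g`), and fix a unimodular pair `u, w ∈ Δ` (`⟨u, w⟩ = 1`), `P = ℤu ⊕ ℤw`, `N = P^⊥ ∩ M`,
`N_w = {n ∈ N : w + n ∈ Δ}`.

* `stub_planeEuclid` (worker A1) — Euclid in `⟨T_u, T_w⟩`: every lattice vector is moved into `u^⊥`.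
* `stub_partnersGenerate` (worker A2) — JANSSEN'S LEMMA 2.7, unconditionally: `M` is generated by `u`
  and the partners `{δ ∈ Δ : ⟨u, δ⟩ = 1}` of `u` (the sublattice they span is `Γ`-stable: for
  `ε ∈ Δ ∩ u^⊥`, `T_ε` maps partners to partners; a general `ε ∈ Δ` is conjugated into `u^⊥` by A1).
* `stub_transvectionIdentities` (worker B) — the transvection calculus behind the cycle:
  `T_{kd+a} T_{kd-a} = T_a² T_d^{2k²}` (`a ⟂ d`), the composite of the `-1`'s of the planes `(u, w)` and
  `(u, w + n)` is the pair move `E_{u,n}²`, and the Heisenberg composition law along an isotropic vector.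
* `stub_pairMovesOfPartners` (worker C) — granting Lemma 2.7 at `u`: for EVERY `m ∈ M ∩ u^⊥` some
  element of `Γ` acts as `E_{u,m}² : v ↦ v + 2(⟨v,u⟩m + ⟨v,m⟩u)` (for `n ∈ N_w` it is the product of the
  six squares `T_u²T_w²T_{u+w}² · T_u²T_{w+n}²T_{u+w+n}²`; these `n` generate `N` by Lemma 2.7; the
  Heisenberg law closes under sums).
* `stub_unimodularTransitivityLocal` (worker D) — cycle 7's unimodular transitivity with LOCAL
  hypotheses: pair moves only at `e ∈ {x, y}` and squares only at `a ∈ {x, y, x + y}` (all its proof uses).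
* `stub_sp2Closure` (worker K) — the four `Sp♯₂` conditions are closed under products and inverses and
  hold for the moves `T_a²`, `E_{e,f}²`.
* `stub_orthogonalPartnersSquare` (worker P) — `u, δ, δ' ∈ Δ`, `⟨u,δ⟩ = ⟨u,δ'⟩ = 1`, `⟨δ, δ'⟩ = 0` ⟹
  some element of `Γ` acts as `T_{δ'-δ}²` (the four-letter identity
  `T_{w+n} T_w⁻¹ T_{w-n} T_w⁻¹ = T_n²` for `w ⟂ n`, with `w - n = -(-1_{(u,w)})(w + n) ∈ Δ`).
* LEAD: `stub_descent` — every `g ∈ K` is `h · g'` with `h ∈ Γ ∩ K` and `g'` FIXING `u` AND `w`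
  (transitivity D with the moves C inside the subgroup `Γ ⊓ K`, then `T_u^{2β}` and `E_{u,-m}²`); and
  `stub_residual` — THE HARDEST, open in general: an element of `K` fixing `u` and `w` lies in `Γ`
  (`= id_P ⊕ γ`, `γ ∈ Sp♯₂(N)`; trivial when `B|_N = 0`; for `N/rad` unimodular it is `T_m² ∈ Γ ∀ m ∈ N`;
  for non-unimodular `N` it needs non-unipotent stabiliser elements — evidence `work/compute/`).

COMPOSITIONS: `janssen_thm2_9 : Janssen1983_thm2_9` — UNCONDITIONAL (A2 + C twice + D + squares of
`T_δ, T_y, T_{δ+y}`); `janssen_thm2_5_of_residual : (residual) → Janssen1983_thm2_5` (descent).  Hence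
the star basis, the companions and every "granting 2.9" statement of cycles 4–7 hold outright, and the
line's remaining arithmetic input is the RESIDUAL alone.
-/

section Cycle8Janssen

variable {V : Type} [AddCommGroup V] [Module ℚ V]

/-- stub (cycle 8, worker A1): EUCLID IN A UNIMODULAR PENCIL.  If units `tu, tw` act as the
transvections `T_u, T_w` of an alternating form with `⟨u, w⟩ = 1`, then every `ε` with integral
pairings `⟨u, ε⟩, ⟨w, ε⟩` is moved into `u^⊥` by some element of `⟨tu, tw⟩`
(`T_w^k : ⟨u,ε⟩ ↦ ⟨u,ε⟩ + k⟨w,ε⟩`, `T_u^j : ⟨w,ε⟩ ↦ ⟨w,ε⟩ - j⟨u,ε⟩`; Euclid on `|⟨u,ε⟩| + |⟨w,ε⟩|`). -/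
theorem stub_planeEuclid (B : LinearMap.BilinForm ℚ V) (hB : B.IsAlt) {u w : V} (huw : B u w = 1)
    (tu tw : (V →ₗ[ℚ] V)ˣ) (htu : ∀ v, ((tu : (V →ₗ[ℚ] V)ˣ) : V →ₗ[ℚ] V) v = v - B v u • u)
    (htw : ∀ v, ((tw : (V →ₗ[ℚ] V)ˣ) : V →ₗ[ℚ] V) v = v - B v w • w)
    (ε : V) (hb : ∃ b : ℤ, B u ε = b) (hc : ∃ c : ℤ, B w ε = c) :
    ∃ g ∈ Subgroup.closure ({tu, tw} : Set (V →ₗ[ℚ] V)ˣ), B u (((g : (V →ₗ[ℚ] V)ˣ) : V →ₗ[ℚ] V) ε) = 0 := by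
  sorry

/-- stub (cycle 8, worker A2): **JANSSEN'S LEMMA 2.7** ([Schnell2010] §7, proof of Lemma 11: "V is
already generated by the smaller set Δ₁ = {δ ∈ Δ : ⟨δ₁, δ⟩ = 1 or δ = δ₁}"), UNCONDITIONALLY, granting
the pencil Euclid of A1 as a hypothesis: for a skew vanishing lattice and `u ∈ Δ`, the lattice `ℤΔ` is
generated by `u` and the partners of `u`.  (`M₁ :=` that span contains a partner `w`; for `ε ∈ Δ` with
`⟨u, ε⟩ = 0`, `T_ε` maps partners to partners, so `T_ε M₁ ⊆ M₁`; a general `ε ∈ Δ` is `g⁻¹ ε'` with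
`ε' = g ε ∈ Δ ∩ u^⊥`, `g ∈ ⟨T_u, T_w⟩` preserving `M₁`; so `M₁` is `Γ_Δ`-stable and contains
`Δ = Γ_Δ u`.) -/
theorem stub_partnersGenerate (B : LinearMap.BilinForm ℚ V) (hB : B.IsAlt) (Δ : Set V)
    (hΔ : IsSkewVanishingLattice B Δ)
    (heuclid : ∀ {u w : V}, B u w = 1 → ∀ (tu tw : (V →ₗ[ℚ] V)ˣ),
      (∀ v, ((tu : (V →ₗ[ℚ] V)ˣ) : V →ₗ[ℚ] V) v = v - B v u • u) →
      (∀ v, ((tw : (V →ₗ[ℚ] V)ˣ) : V →ₗ[ℚ] V) v = v - B v w • w) →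
      ∀ ε : V, (∃ b : ℤ, B u ε = b) → (∃ c : ℤ, B w ε = c) →
        ∃ g ∈ Subgroup.closure ({tu, tw} : Set (V →ₗ[ℚ] V)ˣ),
          B u (((g : (V →ₗ[ℚ] V)ˣ) : V →ₗ[ℚ] V) ε) = 0)
    {u : V} (hu : u ∈ Δ) :
    Submodule.span ℤ (insert u {δ ∈ Δ | B u δ = 1}) = Submodule.span ℤ Δ := by
  sorry

/-- stub (cycle 8, worker B): TRANSVECTION IDENTITIES of an alternating form (pointwise, no groups):
(i) `T_{kd+a} (T_{kd-a} v) = v - 2⟨v,a⟩a - 2k²⟨v,d⟩d` for `⟨d, a⟩ = 0`;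
(ii) with `⟨u,w⟩ = 1`, `n ⟂ u, w`: the `-1` of the plane `(u, w)` (`v ↦ v - 2(⟨v,w⟩u - ⟨v,u⟩w)`)
after the `-1` of the plane `(u, w + n)` is the pair move `v ↦ v + 2(⟨v,u⟩n + ⟨v,n⟩u)`;
(iii) the Heisenberg law along an isotropic `n`: for `c, c' ⟂ n` the maps
`h_{c,k} v = v + ⟨v,c⟩n + ⟨v,n⟩c + k⟨v,n⟩n` compose as `h_{c,k} ∘ h_{c',k'} = h_{c+c', k+k'+⟨c',c⟩}`. -/
theorem stub_transvectionIdentities (B : LinearMap.BilinForm ℚ V) (hB : B.IsAlt) :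
    (∀ (d a : V), B d a = 0 → ∀ (k : ℤ) (v : V),
      skewTransvection B ((k : ℚ) • d + a) (skewTransvection B ((k : ℚ) • d - a) v) =
        v - (2 : ℚ) • (B v a • a) - (2 * (k : ℚ) ^ 2) • (B v d • d)) ∧
    (∀ (u w n : V), B u w = 1 → B u n = 0 → B w n = 0 → ∀ v : V,
      (v - (2 : ℚ) • (B v (w + n) • u - B v u • (w + n))) -
          (2 : ℚ) • (B (v - (2 : ℚ) • (B v (w + n) • u - B v u • (w + n))) w • u -
            B (v - (2 : ℚ) • (B v (w + n) • u - B v u • (w + n))) u • w) =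
        v + (2 : ℚ) • (B v u • n + B v n • u)) ∧
    (∀ (n c c' : V) (k k' : ℚ), B c n = 0 → B c' n = 0 → ∀ v : V,
      (fun x => x + B x c • n + B x n • c + k • (B x n • n))
          ((fun x => x + B x c' • n + B x n • c' + k' • (B x n • n)) v) =
        v + B v (c + c') • n + B v n • (c + c') + (k + k' + B c' c) • (B v n • n)) := by
  sorry

/-- stub (cycle 8, worker C): PAIR MOVES ALONG A UNIMODULAR VECTOR, granting Lemma 2.7 at `u`.  For a
skew vanishing lattice, a unimodular pair `u, w ∈ Δ` (`⟨u, w⟩ = 1`) and EVERY lattice vector `m ⟂ u`,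
some element of `Γ_Δ` acts as `E_{u,m}² : v ↦ v + 2(⟨v,u⟩m + ⟨v,m⟩u)`.  (For `n ⟂ u, w` with
`w + n ∈ Δ`: the product of the six squares `T_u²T_w²T_{u+w}² · T_u²T_{w+n}²T_{u+w+n}²` — the `-1`'s of the
planes `(u,w)` and `(u,w+n)` — acts as `E_{u,n}²`; such `n`, i.e. the `N`-components
`δ - ⟨δ,w⟩u - w` of the partners `δ` of `u`, generate the `N`-components of all of `ℤΔ` by Lemma 2.7;
the Heisenberg law `E_{u,2m}E_{u,2m'} = E_{u,2(m+m')}T_u^{4⟨m',m⟩}` and `E_{u,2ku} = T_u^{-4k}` close up.) -/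
theorem stub_pairMovesOfPartners (B : LinearMap.BilinForm ℚ V) (hB : B.IsAlt) (Δ : Set V)
    (hΔ : IsSkewVanishingLattice B Δ) {u w : V} (hu : u ∈ Δ) (hw : w ∈ Δ) (huw : B u w = 1)
    (hgen : Submodule.span ℤ (insert u {δ ∈ Δ | B u δ = 1}) = Submodule.span ℤ Δ)
    {m : V} (hm : m ∈ Submodule.span ℤ Δ) (hum : B u m = 0) :
    ∃ g ∈ transvectionGroup B Δ, ∀ v : V,
      ((g : (V →ₗ[ℚ] V)ˣ) : V →ₗ[ℚ] V) v = v + (2 : ℚ) • (B v u • m + B v m • u) := by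
  sorry

/-- stub (cycle 8, worker D): UNIMODULAR TRANSITIVITY WITH LOCAL HYPOTHESES — cycle 7's
`localTubeSpan_unimodularTransitivity` verbatim, except that the pair moves are required only at
`e ∈ {x, y}` and the square moves only at `a ∈ {x, y, x + y}` (every use in its proof is of this form:
`E_{y,z}²`, `E_{y,w₁}²`, `E_{x,sw₁}²`; `T_x^{2k}`, `T_y^{2k}`, the word `T_x²T_y²T_{x+y}²`). -/
theorem stub_unimodularTransitivityLocal (B : LinearMap.BilinForm ℚ V) (hB : B.IsAlt) (Δ : Set V)
    (hint : ∀ δ ∈ Δ, ∀ δ' ∈ Δ, ∃ n : ℤ, B δ δ' = n)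
    (Γ : Subgroup (V →ₗ[ℚ] V)ˣ) {x y : V} (hx : x ∈ Submodule.span ℤ Δ)
    (hy : y ∈ Submodule.span ℤ Δ) (hxy : B x y = 1)
    (hpair : ∀ e ∈ ({x, y} : Set V), ∀ f ∈ Submodule.span ℤ Δ, B e f = 0 →
      ∃ g ∈ Γ, ∀ v : V, ((g : (V →ₗ[ℚ] V)ˣ) : V →ₗ[ℚ] V) v = v + (2 : ℚ) • (B v e • f + B v f • e))
    (hsq : ∀ a ∈ ({x, y, x + y} : Set V), ∃ g ∈ Γ, ∀ v : V,
        ((g : (V →ₗ[ℚ] V)ˣ) : V →ₗ[ℚ] V) v = v - (2 : ℚ) • (B v a • a))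
    {t : V} (ht : ∃ z ∈ Submodule.span ℤ Δ, t = x + (2 : ℚ) • z)
    (htu : ∃ y' ∈ Submodule.span ℤ Δ, B t y' = 1) :
    ∃ g ∈ Γ, ((g : (V →ₗ[ℚ] V)ˣ) : V →ₗ[ℚ] V) x = t := by
  sorry

/-- stub (cycle 8, worker K): THE `Sp♯₂` CONDITIONS ARE A GROUP AND CONTAIN THE MOVES.  For the lattice
`ℤΔ` of a form `B`: the conjunction "isometry ∧ preserves `ℤΔ` ∧ inverse preserves `ℤΔ` ∧ Schnell's
displayed condition `l(gx - x) = 2⟨v, x⟩`" (the four hypotheses of `Janssen1983_thm2_5` on a unit `g`) is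
closed under products (`v_{gh} = h⁻¹ v_g + v_h`) and inverses (`v_{g⁻¹} = -g v_g`), and holds for any unit
acting as a square `T_a²` (`a ∈ ℤΔ`, `v = l(a) a`) or as a pair move `E_{e,f}²` (`e, f ∈ ℤΔ`, `⟨e,f⟩ = 0`,
`v = -(l f • e + l e • f)`), `B` alternating and integral on `Δ`. -/
theorem stub_sp2Closure (B : LinearMap.BilinForm ℚ V) (hB : B.IsAlt) (Δ : Set V)
    (hint : ∀ δ ∈ Δ, ∀ δ' ∈ Δ, ∃ n : ℤ, B δ δ' = n) :
    let C : (V →ₗ[ℚ] V)ˣ → Prop := fun g =>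
      (∀ x y : V, B ((g : V →ₗ[ℚ] V) x) ((g : V →ₗ[ℚ] V) y) = B x y) ∧
      (∀ x ∈ Submodule.span ℤ Δ, (g : V →ₗ[ℚ] V) x ∈ Submodule.span ℤ Δ) ∧
      (∀ x ∈ Submodule.span ℤ Δ, ((g⁻¹ : (V →ₗ[ℚ] V)ˣ) : V →ₗ[ℚ] V) x ∈ Submodule.span ℤ Δ) ∧
      (∀ l : V →ₗ[ℚ] ℚ, (∀ x ∈ Submodule.span ℤ Δ, ∃ z : ℤ, l x = z) →
        ∃ v ∈ Submodule.span ℤ Δ, ∀ x ∈ Submodule.span ℤ Δ,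
          l ((g : V →ₗ[ℚ] V) x - x) = 2 * B v x)
    (∀ g h, C g → C h → C (g * h)) ∧ (∀ g, C g → C g⁻¹) ∧ C 1 ∧
    (∀ a ∈ Submodule.span ℤ Δ, ∀ g : (V →ₗ[ℚ] V)ˣ,
      (∀ v, (g : V →ₗ[ℚ] V) v = v - (2 : ℚ) • (B v a • a)) → C g) ∧
    (∀ e ∈ Submodule.span ℤ Δ, ∀ f ∈ Submodule.span ℤ Δ, B e f = 0 → ∀ g : (V →ₗ[ℚ] V)ˣ,
      (∀ v, (g : V →ₗ[ℚ] V) v = v + (2 : ℚ) • (B v e • f + B v f • e)) → C g) := by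
  sorry

/-- stub (cycle 8, worker P): SQUARES ALONG DIFFERENCES OF ORTHOGONAL PARTNERS.  For a skew vanishing
lattice, `u ∈ Δ` and two partners `δ, δ' ∈ Δ` of `u` (`⟨u, δ⟩ = ⟨u, δ'⟩ = 1`) with `⟨δ, δ'⟩ = 0`, some
element of `Γ_Δ` acts as `T_{δ'-δ}² : v ↦ v - 2⟨v, δ'-δ⟩(δ'-δ)`.  (Four-letter identity
`T_{w+n} T_w⁻¹ T_{w-n} T_w⁻¹ = T_n²` for `w ⟂ n` (`w = δ`, `n = δ' - δ`), where
`w - n = 2δ - δ' = ∓(T_u²T_δ²T_{u+δ}²) δ'` lies in `Δ` up to the sign absorbed by `T_{-x} = T_x`.) -/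
theorem stub_orthogonalPartnersSquare (B : LinearMap.BilinForm ℚ V) (hB : B.IsAlt) (Δ : Set V)
    (hΔ : IsSkewVanishingLattice B Δ) {u δ δ' : V} (hu : u ∈ Δ) (hδ : δ ∈ Δ) (hδ' : δ' ∈ Δ)
    (huδ : B u δ = 1) (huδ' : B u δ' = 1) (hδδ' : B δ δ' = 0) :
    ∃ g ∈ transvectionGroup B Δ, ∀ v : V,
      ((g : (V →ₗ[ℚ] V)ˣ) : V →ₗ[ℚ] V) v = v - (2 : ℚ) • (B v (δ' - δ) • (δ' - δ)) := by
  sorry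

/-- stub (cycle 8, LEAD): DESCENT TO THE STABILISER OF A UNIMODULAR PAIR.  For a skew vanishing lattice
with unimodular pair `u, w ∈ Δ` and any unit `g` satisfying the four `Sp♯₂` conditions, there is `h`
in `Γ_Δ`, itself satisfying the four conditions, with `h⁻¹ g` fixing `u` and `w`.  (`g u` is unimodular
and `≡ u (mod 2ℤΔ)`, so reachable from `u` by the moves of C inside `Γ_Δ ⊓ Sp♯₂` (D with the local subgroup
cut out by K); then `g w = w + 2βu + 2m`, `m ⟂ u, w`, is corrected by `T_u^{∓2β}` and `E_{u,∓m}²`.) -/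
theorem stub_descent [FiniteDimensional ℚ V] (B : LinearMap.BilinForm ℚ V) (hB : B.IsAlt)
    (Δ : Set V) (hΔ : IsSkewVanishingLattice B Δ) {u w : V} (hu : u ∈ Δ) (hw : w ∈ Δ)
    (huw : B u w = 1) (g : (V →ₗ[ℚ] V)ˣ)
    (h1 : ∀ x y : V, B ((g : V →ₗ[ℚ] V) x) ((g : V →ₗ[ℚ] V) y) = B x y)
    (h2 : ∀ x ∈ Submodule.span ℤ Δ, (g : V →ₗ[ℚ] V) x ∈ Submodule.span ℤ Δ)
    (h3 : ∀ x ∈ Submodule.span ℤ Δ, ((g⁻¹ : (V →ₗ[ℚ] V)ˣ) : V →ₗ[ℚ] V) x ∈ Submodule.span ℤ Δ)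
    (h4 : ∀ l : V →ₗ[ℚ] ℚ, (∀ x ∈ Submodule.span ℤ Δ, ∃ z : ℤ, l x = z) →
      ∃ v ∈ Submodule.span ℤ Δ, ∀ x ∈ Submodule.span ℤ Δ, l ((g : V →ₗ[ℚ] V) x - x) = 2 * B v x) :
    ∃ h ∈ transvectionGroup B Δ,
      (∀ x y : V, B ((h : V →ₗ[ℚ] V) x) ((h : V →ₗ[ℚ] V) y) = B x y) ∧
      (∀ x ∈ Submodule.span ℤ Δ, (h : V →ₗ[ℚ] V) x ∈ Submodule.span ℤ Δ) ∧
      (∀ x ∈ Submodule.span ℤ Δ, ((h⁻¹ : (V →ₗ[ℚ] V)ˣ) : V →ₗ[ℚ] V) x ∈ Submodule.span ℤ Δ) ∧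
      (∀ l : V →ₗ[ℚ] ℚ, (∀ x ∈ Submodule.span ℤ Δ, ∃ z : ℤ, l x = z) →
        ∃ v ∈ Submodule.span ℤ Δ, ∀ x ∈ Submodule.span ℤ Δ, l ((h : V →ₗ[ℚ] V) x - x) = 2 * B v x) ∧
      ((h⁻¹ * g : (V →ₗ[ℚ] V)ˣ) : V →ₗ[ℚ] V) u = u ∧ ((h⁻¹ * g : (V →ₗ[ℚ] V)ˣ) : V →ₗ[ℚ] V) w = w := by
  sorry

/-- stub (cycle 8, LEAD — THE HARDEST, open in general): THE RESIDUAL.  For a skew vanishing lattice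
with unimodular pair `u, w ∈ Δ`, a unit satisfying the four `Sp♯₂` conditions and FIXING `u` and `w`
(so `= id_P ⊕ γ` with `γ ∈ Sp♯₂(N)`, `N = ⟨u,w⟩^⊥ ∩ ℤΔ`) lies in `Γ_Δ`.  Known: `B|_N = 0` ⇒ `g = 1`;
`N/rad N` unimodular ⇒ equivalent to `T_m² ∈ Γ_Δ` for all `m ∈ N`; non-unimodular `N` needs
non-unipotent stabiliser elements (`work/compute/schreier_fixP.py`: for `N` a `3`-plane the stabiliser
contains `T_{e-f}` and elements whose images in the `(2,3,6)` triangle group are translations by `6ℤ[ω]`,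
consistent with `⊇ Γ(6)`). -/
theorem stub_residual [FiniteDimensional ℚ V] (B : LinearMap.BilinForm ℚ V) (hB : B.IsAlt)
    (Δ : Set V) (hΔ : IsSkewVanishingLattice B Δ) {u w : V} (hu : u ∈ Δ) (hw : w ∈ Δ)
    (huw : B u w = 1) (g : (V →ₗ[ℚ] V)ˣ)
    (h1 : ∀ x y : V, B ((g : V →ₗ[ℚ] V) x) ((g : V →ₗ[ℚ] V) y) = B x y)
    (h2 : ∀ x ∈ Submodule.span ℤ Δ, (g : V →ₗ[ℚ] V) x ∈ Submodule.span ℤ Δ)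
    (h3 : ∀ x ∈ Submodule.span ℤ Δ, ((g⁻¹ : (V →ₗ[ℚ] V)ˣ) : V →ₗ[ℚ] V) x ∈ Submodule.span ℤ Δ)
    (h4 : ∀ l : V →ₗ[ℚ] ℚ, (∀ x ∈ Submodule.span ℤ Δ, ∃ z : ℤ, l x = z) →
      ∃ v ∈ Submodule.span ℤ Δ, ∀ x ∈ Submodule.span ℤ Δ, l ((g : V →ₗ[ℚ] V) x - x) = 2 * B v x)
    (hgu : (g : V →ₗ[ℚ] V) u = u) (hgw : (g : V →ₗ[ℚ] V) w = w) :
    g ∈ transvectionGroup B Δ := by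
  sorry

/-! ### Compositions -/

/-- The unit of `GL(V)` underlying `T_δ` (`B` alternating). -/
theorem c8_exists_unit_transvection (B : LinearMap.BilinForm ℚ V) (hB : B.IsAlt) (Δ : Set V)
    {δ : V} (hδ : δ ∈ Δ) :
    ∃ t ∈ transvectionGroup B Δ, ∀ v : V, ((t : (V →ₗ[ℚ] V)ˣ) : V →ₗ[ℚ] V) v = v - B v δ • δ :=
  ⟨LinearMap.GeneralLinearGroup.ofLinearEquiv (skewTransvectionEquiv B (hB.self_eq_zero δ)),
    unit_skewTransvection_mem_transvectionGroup B hδ (hB.self_eq_zero δ),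
    fun v => by
      change skewTransvection B δ v = _
      exact skewTransvection_apply B δ v⟩

/-- Squares of transvections along elements of `Δ` are moves of `Γ_Δ`: some `g ∈ Γ_Δ` acts as
`v ↦ v - 2⟨v, δ⟩δ`. -/
theorem c8_exists_sqMove_of_mem (B : LinearMap.BilinForm ℚ V) (hB : B.IsAlt) (Δ : Set V)
    {δ : V} (hδ : δ ∈ Δ) :
    ∃ g ∈ transvectionGroup B Δ, ∀ v : V,
      ((g : (V →ₗ[ℚ] V)ˣ) : V →ₗ[ℚ] V) v = v - (2 : ℚ) • (B v δ • δ) := by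
  obtain ⟨t, ht, htv⟩ := c8_exists_unit_transvection B hB Δ hδ
  refine ⟨t * t, mul_mem ht ht, fun v => ?_⟩
  rw [Units.val_mul, Module.End.mul_apply, htv, htv, map_sub, map_smul, LinearMap.sub_apply,
    LinearMap.smul_apply, hB.self_eq_zero δ, smul_eq_mul, mul_zero, sub_zero]
  module

/-- For a unimodular pair `u, w ∈ Δ` (`⟨u, w⟩ = 1`): `u + w ∈ Δ` and `-w ∈ Δ` (`u + w = T_w⁻¹ u`,
`-w = T_u (T_w u)`). -/
theorem c8_add_mem_and_neg_mem_of_pair (B : LinearMap.BilinForm ℚ V) (hB : B.IsAlt) (Δ : Set V)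
    (hΔ : IsSkewVanishingLattice B Δ) {u w : V} (hu : u ∈ Δ) (hw : w ∈ Δ) (huw : B u w = 1) :
    u + w ∈ Δ ∧ -w ∈ Δ := by
  obtain ⟨tu, htu, htuv⟩ := c8_exists_unit_transvection B hB Δ hu
  obtain ⟨tw, htw, htwv⟩ := c8_exists_unit_transvection B hB Δ hw
  have hwu : B w u = -1 := by rw [← hB.neg_eq, huw]
  constructor
  · have h := hΔ.stable tw⁻¹ (inv_mem htw) u hu
    have e : ((tw⁻¹ : (V →ₗ[ℚ] V)ˣ) : V →ₗ[ℚ] V) u = u + w := by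
      have h1 : ((tw : (V →ₗ[ℚ] V)ˣ) : V →ₗ[ℚ] V) (u + w) = u := by
        rw [htwv, map_add, LinearMap.add_apply, huw, hB.self_eq_zero w, add_zero, one_smul,
          add_sub_cancel_right]
      calc ((tw⁻¹ : (V →ₗ[ℚ] V)ˣ) : V →ₗ[ℚ] V) u
          = ((tw⁻¹ : (V →ₗ[ℚ] V)ˣ) : V →ₗ[ℚ] V) (((tw : (V →ₗ[ℚ] V)ˣ) : V →ₗ[ℚ] V) (u + w)) := by
            rw [h1]
        _ = u + w := localTubeSpan_units_inv_apply_apply tw _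
    rwa [e] at h
  · have h := hΔ.stable (tu * tw) (mul_mem htu htw) u hu
    have e : ((tu * tw : (V →ₗ[ℚ] V)ˣ) : V →ₗ[ℚ] V) u = -w := by
      rw [Units.val_mul, Module.End.mul_apply, htwv, huw, one_smul, htuv, map_sub,
        LinearMap.sub_apply, hB.self_eq_zero u, hwu]
      module
    rwa [e] at h

/-- The pair and square moves needed by local transitivity at a unimodular pair `x, y ∈ Δ`, supplied by
`stub_pairMovesOfPartners` (at `x`, and at `y` with partner `-x`) and the squares of `T_x, T_y, T_{x+y}`. -/
theorem c8_movesAtPair (B : LinearMap.BilinForm ℚ V) (hB : B.IsAlt) (Δ : Set V)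
    (hΔ : IsSkewVanishingLattice B Δ) {x y : V} (hx : x ∈ Δ) (hy : y ∈ Δ) (hxy : B x y = 1) :
    (∀ e ∈ ({x, y} : Set V), ∀ f ∈ Submodule.span ℤ Δ, B e f = 0 →
      ∃ g ∈ transvectionGroup B Δ, ∀ v : V,
        ((g : (V →ₗ[ℚ] V)ˣ) : V →ₗ[ℚ] V) v = v + (2 : ℚ) • (B v e • f + B v f • e)) ∧
    (∀ a ∈ ({x, y, x + y} : Set V), ∃ g ∈ transvectionGroup B Δ, ∀ v : V,
        ((g : (V →ₗ[ℚ] V)ˣ) : V →ₗ[ℚ] V) v = v - (2 : ℚ) • (B v a • a)) := by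
  have heu : ∀ {u w : V}, B u w = 1 → ∀ (tu tw : (V →ₗ[ℚ] V)ˣ),
      (∀ v, ((tu : (V →ₗ[ℚ] V)ˣ) : V →ₗ[ℚ] V) v = v - B v u • u) →
      (∀ v, ((tw : (V →ₗ[ℚ] V)ˣ) : V →ₗ[ℚ] V) v = v - B v w • w) →
      ∀ ε : V, (∃ b : ℤ, B u ε = b) → (∃ c : ℤ, B w ε = c) →
        ∃ g ∈ Subgroup.closure ({tu, tw} : Set (V →ₗ[ℚ] V)ˣ),
          B u (((g : (V →ₗ[ℚ] V)ˣ) : V →ₗ[ℚ] V) ε) = 0 :=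
    fun huw tu tw htu htw ε hb hc => stub_planeEuclid B hB huw tu tw htu htw ε hb hc
  -- `-x ∈ Δ` is a partner of `y`: `⟨y, -x⟩ = 1`
  obtain ⟨hxyΔ, hnegy⟩ := c8_add_mem_and_neg_mem_of_pair B hB Δ hΔ hx hy hxy
  have hyx : B y (-x) = 1 := by rw [map_neg, ← hB.neg_eq, neg_neg, hxy]
  have hnegx : -x ∈ Δ := by
    have hnegyx : B (-y) x = 1 := by rw [map_neg, LinearMap.neg_apply, ← hB.neg_eq, neg_neg, hxy]
    -- `-x = -(partner)` : apply the lemma to the pair `(-y, x)`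
    exact (c8_add_mem_and_neg_mem_of_pair B hB Δ hΔ hnegy hx hnegyx).2
  refine ⟨fun e he f hf hef => ?_, fun a ha => ?_⟩
  · simp only [Set.mem_insert_iff, Set.mem_singleton_iff] at he
    rcases he with rfl | rfl
    · exact stub_pairMovesOfPartners B hB Δ hΔ hx hy hxy
        (stub_partnersGenerate B hB Δ hΔ heu hx) hf hef
    · exact stub_pairMovesOfPartners B hB Δ hΔ hy hnegx hyx
        (stub_partnersGenerate B hB Δ hΔ heu hy) hf hef
  · simp only [Set.mem_insert_iff, Set.mem_singleton_iff] at ha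
    rcases ha with rfl | rfl | rfl
    · exact c8_exists_sqMove_of_mem B hB Δ hx
    · exact c8_exists_sqMove_of_mem B hB Δ hy
    · exact c8_exists_sqMove_of_mem B hB Δ hxyΔ

/-- COMPOSITION (cycle 8, headline 1): **JANSSEN'S THEOREM 2.9 HOLDS** — unconditionally.
(`⇒`: a partner `gδ₂`; `⇐`: local unimodular transitivity at the pair `(δ, gδ₂)` with the moves of
`movesAtPair`, then `Γ_Δ`-stability of `Δ`.) -/
theorem janssen_thm2_9 : Janssen1983_thm2_9 := by
  intro W _ _ B hB Δ hΔ x hx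
  constructor
  · intro hxΔ
    obtain ⟨δ₁, hδ₁, δ₂, hδ₂, h12⟩ := hΔ.exists_pair
    obtain ⟨g, hg, hgx⟩ := hΔ.transitive δ₁ hδ₁ x hxΔ
    refine ⟨⟨((g : (W →ₗ[ℚ] W)ˣ) : W →ₗ[ℚ] W) δ₂,
      localTubeSpan_transvectionGroup_map_span_int B hB Δ hΔ.integral hg (Submodule.subset_span hδ₂),
      ?_⟩, x, hxΔ, 0, Submodule.zero_mem _, by rw [sub_self, smul_zero]⟩
    rw [← hgx, localTubeSpan_transvectionGroup_isometry B hB Δ hg, h12]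
  · rintro ⟨⟨y', hy', hxy'⟩, δ, hδ, z, hz, hxδ⟩
    obtain ⟨δ₁, hδ₁, δ₂, hδ₂, h12⟩ := hΔ.exists_pair
    obtain ⟨g, hg, hgδ⟩ := hΔ.transitive δ₁ hδ₁ δ hδ
    set y := ((g : (W →ₗ[ℚ] W)ˣ) : W →ₗ[ℚ] W) δ₂ with hydef
    have hyΔ : y ∈ Δ := hΔ.stable g hg δ₂ hδ₂
    have hδy : B δ y = 1 := by
      rw [hydef, ← hgδ, localTubeSpan_transvectionGroup_isometry B hB Δ hg, h12]
    have ht : ∃ z ∈ Submodule.span ℤ Δ, x = δ + (2 : ℚ) • z :=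
      ⟨z, hz, by rw [two_smul, ← two_nsmul, ← hxδ, add_sub_cancel]⟩
    obtain ⟨hpair, hsq⟩ := c8_movesAtPair B hB Δ hΔ hδ hyΔ hδy
    obtain ⟨g', hg', hg'δ⟩ := stub_unimodularTransitivityLocal B hB Δ hΔ.integral
      (transvectionGroup B Δ) (Submodule.subset_span hδ) (Submodule.subset_span hyΔ) hδy hpair hsq
      ht ⟨y', hy', hxy'⟩
    rw [← hg'δ]
    exact hΔ.stable g' hg' δ hδ

/-- COMPOSITION (cycle 8, headline 2): **JANSSEN'S THEOREM 2.5 FROM ITS RESIDUAL** (descent at the pair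
`(δ₁, δ₂)` of the definition, then the residual for the stabiliser element). -/
theorem janssen_thm2_5_of_residual
    (hres : ∀ (W : Type) [AddCommGroup W] [Module ℚ W] [FiniteDimensional ℚ W]
      (B : LinearMap.BilinForm ℚ W), B.IsAlt → ∀ Δ : Set W, IsSkewVanishingLattice B Δ →
      ∀ ⦃u w : W⦄, u ∈ Δ → w ∈ Δ → B u w = 1 → ∀ g : (W →ₗ[ℚ] W)ˣ,
        (∀ x y : W, B ((g : W →ₗ[ℚ] W) x) ((g : W →ₗ[ℚ] W) y) = B x y) →
        (∀ x ∈ Submodule.span ℤ Δ, (g : W →ₗ[ℚ] W) x ∈ Submodule.span ℤ Δ) →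
        (∀ x ∈ Submodule.span ℤ Δ, ((g⁻¹ : (W →ₗ[ℚ] W)ˣ) : W →ₗ[ℚ] W) x ∈ Submodule.span ℤ Δ) →
        (∀ l : W →ₗ[ℚ] ℚ, (∀ x ∈ Submodule.span ℤ Δ, ∃ z : ℤ, l x = z) →
          ∃ v ∈ Submodule.span ℤ Δ, ∀ x ∈ Submodule.span ℤ Δ,
            l ((g : W →ₗ[ℚ] W) x - x) = 2 * B v x) →
        (g : W →ₗ[ℚ] W) u = u → (g : W →ₗ[ℚ] W) w = w → g ∈ transvectionGroup B Δ) :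
    Janssen1983_thm2_5 := by
  intro W _ _ _ B hB Δ hΔ g h1 h2 h3 h4
  obtain ⟨u, hu, w, hw, huw⟩ := hΔ.exists_pair
  obtain ⟨h, hh, hh1, hh2, hh3, hh4, hgu, hgw⟩ := stub_descent B hB Δ hΔ hu hw huw g h1 h2 h3 h4
  obtain ⟨hmul, hinv, -, -, -⟩ := stub_sp2Closure B hB Δ hΔ.integral
  have hC := hmul _ _ (hinv _ ⟨hh1, hh2, hh3, hh4⟩) ⟨h1, h2, h3, h4⟩
  have hmem : h⁻¹ * g ∈ transvectionGroup B Δ :=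
    hres W B hB Δ hΔ hu hw huw (h⁻¹ * g) hC.1 hC.2.1 hC.2.2.1 hC.2.2.2 hgu hgw
  simpa using mul_mem hh hmem

/-- COMPOSITION (cycle 8): Janssen's Theorem 2.5 outright, once the residual stub is closed. -/
theorem janssen_thm2_5 : Janssen1983_thm2_5 :=
  janssen_thm2_5_of_residual fun _ _ _ _ B hB Δ hΔ _ _ hu hw huw g h1 h2 h3 h4 hgu hgw =>
    stub_residual B hB Δ hΔ hu hw huw g h1 h2 h3 h4 hgu hgw

/-- COMPOSITION (cycle 8): the cycle-7 consequences now UNCONDITIONAL — the companions of Theorem 2.9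
(`IsSkewVanishingLattice.add_two_smul_mem`) need no named fact. -/
example {W : Type} [AddCommGroup W] [Module ℚ W] {B : LinearMap.BilinForm ℚ W} (hB : B.IsAlt)
    {Δ : Set W} (hΔ : IsSkewVanishingLattice B Δ) {δ β : W} (hδ : δ ∈ Δ)
    (hβ : β ∈ Submodule.span ℤ Δ) (hβrad : ∀ x ∈ Δ, B β x = 0) : δ + 2 • β ∈ Δ :=
  hΔ.add_two_smul_mem janssen_thm2_9 hB hδ hβ hβrad

end Cycle8Janssen



end Summit.HodgeConjecture.HodgeConjecture.Cruxes.LocalTubeSpan.Sketch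

end
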